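import Literature.MathematicalPhysics.QuantumFieldTheory.BalabanImbrieJaffe1984to88.BIJ85CurlyDkHolderTorus
import Literature.MathematicalPhysics.QuantumFieldTheory.BalabanImbrieJaffe1984to88.BIJ88CurlyDkLocTorus
import Literature.MathematicalPhysics.QuantumFieldTheory.BalabanImbrieJaffe1984to88.BIJ88HkLocTorus
import Literature.MathematicalPhysics.QuantumFieldTheory.BalabanImbrieJaffe1984to88.BIJ85Prop12AllTori
import Literature.MathematicalPhysics.QuantumFieldTheory.Balaban1983to89.B3ConstantField433
import Literature.Analysis.Calculus.LogCutoff
import Mathlib.Analysis.Calculus.MeanValue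

/-!
# `BalabanImbrieJaffe1984to88.BIJ88HkLocHolderTorus` — T. Bałaban, J. Imbrie, A. Jaffe, *Effective action and cluster properties of the
abelian Higgs model*, Commun. Math. Phys. **114** (1988) 257–315 [BalabanImbrieJaffe1988]: **(2.1)/(2.4)–(2.7) p. 260 — a localization
function that IS *"a smooth function of b"*, and THE HÖLDER MEMBERS *"of order less than two"* of (2.5) and (2.7) for the localized Landau
minimizer `H_{k,loc} = ζ_kH_k` ON THE TORI OF THE SERIES**, from the three members of (I.7.2.2)

statement-level skeleton of published theorems with citation tags; proofs where landed; nothing here is a claim about the Yang–Mills mass gap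

PDF held: `paper:balaban1988-cmp114-bij-abelian-higgs-effective-action` (journal page = PDF page + 256); p. 260 [PDF 4] re-read this session
as an image rendered from the held PDF (seat folder `renders/c2-p004.png`) and from the text layer; [I] = [BalabanImbrieJaffe1985], (7.2.2)
p. 325.

CITATION HEADER (lean-in-tree rule).  Part of the lit-balaban TYPED SKELETON (HOME `run/shared/lean/pub/lit-balaban/`), unit
`lit-balaban-r18` (C2 §§1–4 fold owner; literature-prover-lit-balaban-r18-g21-0), own lane = `C2S14-CLOSURE.md` §3 item 5 / §5 item 1;
SKELETON rows **C2.Eq2.1**, **C2.Eq2.4**, **C2.Eq2.5**, **C2.Eq2.6**, **C2.Eq2.7** (owner r18, referee ref-5), kind «model instance with a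
print-faithful cutoff»; TAKING line HOME/STATUS.md 2026-08-22T19:5xZ.  Decls used BY NAME (nothing restated, nothing re-proved): p13's
`BIJ88Cutoffs21.cutoffProfile` (the `C^∞` profile of (2.1)) and its 0/1 thresholds; r18's `BIJ88Sect2Statements.IsCutoff`/`loc`/`Vanishes`/
`Close`; r18/p08's torus objects `BIJ88CurlyDkLocTorus.hKer`/`hdist`/`hlKer` and p08's `BIJ88HkLocTorus.eq25_26_27_HkE_torus_unscaled` (ANY
`IsCutoff`); p09's torus carrier `BIJ85Ineq722Torus.torusRep`/`distEU`/`ctr`/`supDist_triangle`, r15's typed `BIJ85Sect7Statements.KernelData.Ineq722`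
and p08's extraction of its three members `BIJ85CurlyDkHolderTorus.exists_holderBounds_of_ineq722`; p19's HYPOTHESIS-FREE (7.2.2)
`BIJ85Prop12AllTori.ineq722_deltaA_printed`; the tree's lattice mean-value bound `Balaban1983to89.B3ConstantField433.norm_sub_le_local`/
`norm_sub_le_tdist`, `B3TorusRadialSums.cdist`/`supDist_eq_sup_cdist`/`supDist_le_tdist`/`tdist_le_mul_supDist`; the tree's bounds on
Mathlib's smooth transition `Literature.Analysis.Calculus.LogCutoff.exists_abs_deriv_and_deriv_deriv_smoothTransition_le`.

THE PRINTED TEXT (p. 260 [PDF 4], verbatim): *"Construct a translation invariant localization function ζ_k such that ζ_k(b,b′) = 0, if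
dist(b,b′) ≧ ⅛r(e_k), 1, if dist(b,b′) ≦ (1/16)r(e_k), (2.1) and such that ζ_k is a smooth function of b. Here b ∈ T_η, b′ ∈ T₁^{(k)} … Then
the localized version of H_k has a kernel H_{k,loc}(b,b′) = ζ_k(b,b′)H_k(b,b′). (2.4) There is no ambiguity because ζ_k permits a sampling only
of b near b′, relative to the size of T_{0,η}; H_k is also translation invariant. Since ζ_k is smooth, H_{k,loc} inherits the regularity and
decay properties of H_k, see (I.7.2.2). So we have |H_{k,loc}(b,b′)| ≦ ce^{−c dist(b,b′)}, (2.5) H_{k,loc}(b,b′) = 0 for dist(b,b′) ≧ ⅛r(e_k),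
(2.6) |H_{k,loc}(b,b′) − H_k(b,b′)| ≦ e^{−cr(e_k)}e^{−c dist(b,b′)}, (2.7) and similarly for ∂H_{k,loc}, ∂*H_{k,loc}, and for Hölder derivatives
of H_{k,loc} of order less than two."*  [I] (7.2.2) p. 325: *"there exists δ > 0 and for 0 ≦ α < 1 a constant M = M(α) < ∞ such that for
|x − x′| ≦ 1, |H_{k,μν}(x,y)| + |∇H_{k,μν}(x,y)| + |x − x′|^{−α}|∇H_{k,μν}(x,y) − ∇H_{k,μν}(x′,y)| ≦ Me^{−δ|x−y|}. (7.2.2)"*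

WHY THIS FILE (owner's note `C2S14-CLOSURE.md` §3 item 5, p08 g9's observation).  The cutoff of record `ζ_j = cutoff R₁ R₀ hdist`
(`BIJ88CurlyDkLocTorus.hlKer`) composes the `C^∞` profile with the SUP-NORM block distance `max_μ |b_μ − y_μ|_T/L^j`, which is Lipschitz but
not `C²` in `b`: at the corners of its cubical level sets the lattice second differences of `ζ_j` have full first-difference size, so `∇(ζ_jH_j)`
has NO `k`-uniform Hölder quotient of order `1 + α` for THAT object — the sup, finite-range, closeness and first-derivative members of
(2.5)–(2.7) hold for it (p08/r18 files of rows C2.Eq2.4–2.7), the Hölder member does not.  Print asks for *"a smooth function of b"*; this file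
supplies one with the SAME 0/1 regions and certifies the Hölder members for it.  Objects of record are untouched (Q-OWN-1′); heads unchanged.

WHAT IS CONSTRUCTED AND PROVED (0 `sorry`, standard axioms).
* §1 the profile calculus: `p(t) = σ((R₀ − t)/(R₀ − R₁))` has `|p′| ≤ C_σ/(R₀ − R₁)`, `|p″| ≤ C_σ/(R₀ − R₁)²` (`hasDerivAt_cutoffProfile`,
  `hasDerivAt_deriv_cutoffProfile`), is Lipschitz (`abs_cutoffProfile_sub_le`), and its second differences obey `|p(t+2h) − 2p(t+h) + p(t)| ≤
  (C_σ/(R₀ − R₁)²)h²` (`abs_secondDiff_cutoffProfile_le`; mean value twice), `C_σ` = the tree's common bound for `|σ′|`, `|σ″|`.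
* §2 the circular coordinate distance `cdist` on `ℤ/N`: one step changes it by at most one (`cdist_add_one_le_and`), and three consecutive
  points give an arithmetic progression of step `±1` except next to the centre or the antipode (`cdist_three_consecutive`).
* §3 one coordinate factor `f(m) = p(cdist(m)/s)`: `|f(m+1) − f(m)| ≤ (C_σ/(R₀−R₁))/s` (`abs_zfac_add_one_sub_le`) and, for `1 ≤ R₁s`,
  `R₀s ≤ (N − 3)/2`, `|f(m+2) − 2f(m+1) + f(m)| ≤ (C_σ/(R₀−R₁)²)/s²` (`abs_zfac_secondDiff_le`).
* §4 **THE PRODUCT-FORM SMOOTH CUTOFF** `zetaPi R₁ R₀ j x y = Π_μ p(|x_μ − c_μ|_T/L^j)` (`c = ctr j y`; bond form `zetaPiB`; DEFINITIONS with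
  bodies): values in `[0, 1]`; **`isCutoff_zetaPiB`** — r18's `IsCutoff (hdist j) ζ^Π R₁ R₀`, i.e. THE SAME 0/1 REGIONS (2.1) as the cutoff of
  record; LATTICE SMOOTHNESS IN `b`: **`abs_zetaPi_shift_sub_le`** `|Δ_λζ^Π| ≤ C_σ/((R₀−R₁)L^j)`, **`abs_zetaPi_secondDiff_le`** `|Δ_κΔ_λζ^Π| ≤
  ((C_σ/(R₀−R₁))² + C_σ/(R₀−R₁)²)/L^{2j}` for ALL `κ, λ` under the side conditions `1 ≤ R₁L^j`, `R₀L^j ≤ (|T_η| − 3)/2` (the transition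
  annulus meets neither the block centre nor the antipode), and the path-summed forms `abs_zetaPi_sub_le`, `abs_zetaPi_diff_sub_le`
  (`|x − x′|₁`-Lipschitz bounds for `ζ^Π` and `Δ_λζ^Π`).
* §5 the product rule behind *"H_{k,loc} inherits the regularity … of H_k"*, one output component, for an abstract lattice-smooth `Z` and
  a kernel column `G` with sup/gradient/Hölder bounds (**`holder_prodRule_comp`**, `deriv_prodRule_comp`; explicit constant `holderConst`):
  `∇(ZG)(x) − ∇(ZG)(x′) = Z(∇G − ∇G′) + (Z − Z′)∇G′ + ∇Z(G − G′) + (∇Z − ∇Z′)G′`, the `G − G′` term by the lattice mean-value bound along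
  the staircase path (every path point stays within `(d+1)L^j` fine steps, costing `e^{δ(d+1)}`).
* §6 ON p09's KERNEL FAMILY `H_{j,μν}(x; y)` GIVEN THE TYPED (7.2.2): for every `0 ≤ α < 1` ONE `(δ, M′)` FOR ALL SCALES `j = lev i` and all
  radii with `R₀ − R₁ ≥ 1`, `R₁L^j ≥ 1`, `R₀L^j ≤ (|T_η| − 3)/2` — **`holder25_zetaPi_of_ineq722`**: `|x − x′|^{−α}‖λ ↦ ∇_λ(ζ^ΠH)(x) −
  ∇_λ(ζ^ΠH)(x′)‖ ≤ M′e^{−δ|x − y|}` (`x ≠ x′`, `|x − x′| = |x − x′|_∞/L^j ≤ 1`, `∇_λ = L^jΔ_λ`); `deriv25_zetaPi_of_ineq722` (the derivative member,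
  `R₀ − R₁ ≥ 1` only); **`holder27_zetaPi_of_ineq722`**: the same for `(ζ^Π − 1)H = H^Π_{loc} − H` with the small factor, `≤ M′e^{−(δ/2)(R₁−2)}·
  e^{−(δ/2)|x − y|}` (inside `R₁ − 2` the difference VANISHES; at print's `R₁ = r(e_k)/16` the prefactor is `e^{δ}e^{−(δ/32)r(e_k)}` = print's
  `e^{−cr(e_k)}`).
* §7 (2.4) with the smooth cutoff for the `H_j` OF RECORD: `hlKerPi w c R₁ R₀ j := loc (zetaPiB R₁ R₀ j) (hKer w c j)` (DEFINITION), `hKer_eq_H` /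
  `hlKerPi_eq_H` (p08's dictionary `hKer = H_{j,μν}`); the sup members (2.5)/(2.6)/(2.7) by instantiation of p08 (`eq25_26_27_hlKerPi_of_ineq722`);
  the derivative and Hölder members in this vocabulary (`deriv25_hlKerPi_of_ineq722`, **`holder25_hlKerPi_of_ineq722`**, **`holder27_hlKerPi_of_ineq722`**);
  and ALL OF THEM HYPOTHESIS-FREE ON EVERY TORUS OF THE SERIES (**`eq25_26_27_hlKerPi`**, **`deriv25_hlKerPi`**, **`holder25_hlKerPi`**,
  **`holder27_hlKerPi`**: constants per torus, uniform in the scale `j ≤ m + K`, the weights `w > 0`, `c ≠ 0` and the admissible radii), by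
  p19's `ineq722_deltaA_printed`; (2.6) for the derivative (`deriv26_hlKerPi`); the printed radii `r(e_j)/16 < r(e_j)/8` are admissible as soon as
  `r(e_j) ≥ 16` and `r(e_j)L^j/4 + 3 ≤ |T_η|` (`printedRadii_admissible`).
* §8 (v1.1) ONE `(δ, M′)` FOR ALL TORI AND ALL SCALES — (I.7.2.2)'s *"constants independent of k, T_η"*: [6I] Prop. 1.2 over all tori and
  all scales `0 ≤ j ≤ m + K` (p19's `BIJ85Prop12AllTori.prop12Printed_allTori_allScales`, hypothesis-free) read through p09's one-scale theorem
  WITH EXPLICIT CONSTANTS (`BIJ85Ineq722ProofPart2.ineq722_kernelData`: rate `rate722 d C δ₀ …`, constant `M722 … α·e^{rate/2}`; the torus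
  inputs `hyps_torus_deltaA_dim`, `cutoffHyps_torus`, `distEU_le`, `dS_pos` carry torus-independent constants) gives **`exists_holderBounds_allTori`**
  (`∃ δ > 0, M ≥ 0` from `(d, L, a, α)`: `|H| + ‖∇H‖ ≤ Me^{−δ|x−y|}` and `|x − x′|^{−α}‖∇H(x) − ∇H(x′)‖ ≤ Me^{−δ|x−y|}` on EVERY torus `P` with
  `P.d = d`, `P.L = L`, at EVERY scale `j ≤ m + K`); fed into the pointwise product rules of §6 (**`holder25_zetaPi_of_bounds`**,
  `deriv25_zetaPi_of_bounds`, **`holder27_zetaPi_of_bounds`** — the §6 theorems are now derived from them) this yields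
  **`holder25_zetaPi_allTori`**, `deriv25_zetaPi_allTori`, **`holder27_zetaPi_allTori`** and, in the (2.4) vocabulary,
  **`holder25_hlKerPi_allTori`**, `deriv25_hlKerPi_allTori`, **`holder27_hlKerPi_allTori`**: the statements of §6–§7 with `(δ, M′)` quantified
  BEFORE the torus (no enumeration of the tori, no transport).

HONEST SCOPE.  (i) «Hölder derivatives of order less than two» is typed as ONE lattice derivative in the output point plus a Hölder quotient of
order `0 ≤ α < 1` of it at separation `|x − x′|_∞/L^j ≤ 1` — the shape of (I.7.2.2); `∂*H_{k,loc}` (backward differences) is the same statement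
at `x − ηe_λ` and is not typed separately; derivatives in the INPUT bond `b′` are not part of (7.2.2) and not treated.  (ii) The cutoff is the
PRODUCT over coordinates of p13's profile of the circular coordinate distance to the block centre: same 0/1 regions as the cutoff of record in the
sup distance `hdist`, translation invariant by construction (a function of `x − ctr j y`); it is «smooth in b» in the lattice sense of §4 under the
side conditions `1 ≤ R₁L^j` (inner radius at least one fine step) and `R₀L^j ≤ (|T_η| − 3)/2` (outer radius before the antipode) — explicit
hypotheses of every Hölder statement, met by the printed radii when `r(e_j) ≥ 16` and the torus is large (`printedRadii_admissible`); the
uniformity of the constants also uses `R₀ − R₁ ≥ 1` (print: `r(e_j)/16`).  (iii) Constants: in §6–§7 `δ` and `M(α)` of (7.2.2) enter existentially per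
torus through p19's theorem (uniform in the scale); §8 (v1.1) quantifies them before the torus (uniform over all tori with `P.d = d`, `P.L = L`
and all scales, from Prop. 1.2 over all tori); `C_σ` is non-explicit (compactness); nothing optimised.  (iv) `U = 1`, real abelian fields, torus, standing range `j ≤ m + K`; the `H_j` of record
(p11's `HkE`); the objects of record `hlKer`/`dkLocKer` (sup-norm cutoff) are NOT modified and the Hölder member is NOT claimed for them.
(v) 0 `sorry`, no new `Prop` fact; definitions with bodies (`zfac`, `coordDiff`, `zetaPi`, `zetaPiB`, `secondDiffConst`, `holderConst`, `hlKerPi`)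
and theorems; NOT summit progress.  Unit `lit-balaban-r18` (literature-prover-lit-balaban-r18-g21-0), 2026-08-22; v1.1 (§8, the
`_of_bounds` forms of §6; every v1 statement unchanged) same seat, same day.
-/

open scoped BigOperators

namespace Literature.MathematicalPhysics.QuantumFieldTheory.BalabanImbrieJaffe1984to88.BIJ88HkLocHolderTorus

open Balaban1983to89 hiding Site Plaq
open Balaban1983to89.LatticeFieldCalculus
open Balaban1983to89.B3TorusRadialSums (cdist cdist_le_supDist supDist_eq_sup_cdist supDist_le_tdist tdist_le_mul_supDist
  supDist_eq_zero_iff supDist_comm)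
open Balaban1983to89.B3ConstantField433 (norm_sub_le_local norm_sub_le_tdist)
open BIJ88Sect2Statements (IsCutoff loc Vanishes Close)
open BIJ88Cutoffs21 (cutoffProfile cutoffProfile_eq_one cutoffProfile_eq_zero)
open BIJ85Sect7Statements BIJ85Ineq722Torus
open BIJ85Ineq722DeltaA (deltaAData ineq722_deltaA_of_prop12Printed)
open BIJ85Ineq722ProofPart2 (settingOf)
open BIJ85Eq721MinimizerKernel (torusKernelData_gradH torusKernelData_H)
open BIJ85CurlyDkHolderTorus (torusKernelData_gradHDiff exists_holderBounds_of_ineq722)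
open BIJ88Ineq217Ineq722Torus (ofLp_HkE_single torusKernelData_gradH_nonneg torusKernelData_gradHDiff_nonneg)
open BIJ85Prop12AllTori (ineq722_deltaA_printed)
open BIJ88CurlyDkLocTorus (hKer hdist hlKer)
open BIJ88HkLocTorus (eq25_26_27_HkE_torus_unscaled)
open Literature.Analysis.Calculus (exists_abs_deriv_and_deriv_deriv_smoothTransition_le contDiff_deriv_smoothTransition)
-- inside this namespace the bare `Site`/`Plaq` are the `ℤ^d` carriers of the QFT root; the torus ones are renamed:
open Balaban1983to89 renaming Site → TSite, Plaq → TPlaq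

noncomputable section

/-! ## §1  The profile `p(t) = σ((R₀ − t)/(R₀ − R₁))` of p13's cutoff: first and second derivative, Lipschitz bounds, second differences -/

section Profile

variable {R₁ R₀ : ℝ}

/-- the affine reparametrisation `t ↦ (R₀ − t)/(R₀ − R₁)` has derivative `−1/(R₀ − R₁)`. [folklore] -/
private theorem hasDerivAt_affine (R₁ R₀ t : ℝ) :
    HasDerivAt (fun t : ℝ => (R₀ - t) / (R₀ - R₁)) (-1 / (R₀ - R₁)) t := by
  have h := ((hasDerivAt_id t).const_sub R₀).div_const (R₀ - R₁)
  simpa using h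

/-- **the derivative of the cutoff profile**: `p′(t) = σ′((R₀ − t)/(R₀ − R₁))·(−1/(R₀ − R₁))` (`σ` = Mathlib's `Real.smoothTransition`,
`p = BIJ88Cutoffs21.cutoffProfile R₁ R₀` the profile of the printed smooth cutoff (2.1)). [cite: BalabanImbrieJaffe1988, (2.1) p.260] -/
theorem hasDerivAt_cutoffProfile (R₁ R₀ t : ℝ) :
    HasDerivAt (cutoffProfile R₁ R₀)
      (deriv Real.smoothTransition ((R₀ - t) / (R₀ - R₁)) * (-1 / (R₀ - R₁))) t := by
  have hS : HasDerivAt Real.smoothTransition (deriv Real.smoothTransition ((R₀ - t) / (R₀ - R₁)))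
      ((R₀ - t) / (R₀ - R₁)) :=
    ((Real.smoothTransition.contDiff (n := 1)).differentiable (by simp) _).hasDerivAt
  have h := hS.comp t (hasDerivAt_affine R₁ R₀ t)
  exact h

/-- the derivative as a function. [cite: BalabanImbrieJaffe1988, (2.1) p.260] -/
theorem deriv_cutoffProfile_eq (R₁ R₀ : ℝ) :
    deriv (cutoffProfile R₁ R₀) = fun t => deriv Real.smoothTransition ((R₀ - t) / (R₀ - R₁)) * (-1 / (R₀ - R₁)) :=
  funext fun t => (hasDerivAt_cutoffProfile R₁ R₀ t).deriv

/-- **the second derivative of the cutoff profile**: `p″(t) = σ″((R₀ − t)/(R₀ − R₁))·(1/(R₀ − R₁))²`. [cite: BalabanImbrieJaffe1988, (2.1) p.260] -/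
theorem hasDerivAt_deriv_cutoffProfile (R₁ R₀ t : ℝ) :
    HasDerivAt (deriv (cutoffProfile R₁ R₀))
      (deriv (deriv Real.smoothTransition) ((R₀ - t) / (R₀ - R₁)) * (-1 / (R₀ - R₁)) * (-1 / (R₀ - R₁))) t := by
  rw [deriv_cutoffProfile_eq]
  have hS' : HasDerivAt (deriv Real.smoothTransition) (deriv (deriv Real.smoothTransition) ((R₀ - t) / (R₀ - R₁)))
      ((R₀ - t) / (R₀ - R₁)) :=
    (contDiff_deriv_smoothTransition.differentiable (by simp) _).hasDerivAt
  exact (hS'.comp t (hasDerivAt_affine R₁ R₀ t)).mul_const _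

/-- `|p′| ≤ C/(R₀ − R₁)` when `|σ′| ≤ C` and `R₁ < R₀`. [cite: BalabanImbrieJaffe1988, (2.1) p.260] -/
theorem abs_deriv_cutoffProfile_le {C : ℝ} (hC : ∀ u, |deriv Real.smoothTransition u| ≤ C) (hR : R₁ < R₀) (t : ℝ) :
    |deriv (cutoffProfile R₁ R₀) t| ≤ C / (R₀ - R₁) := by
  have hw : 0 < R₀ - R₁ := sub_pos.2 hR
  rw [(hasDerivAt_cutoffProfile R₁ R₀ t).deriv, abs_mul, abs_div, abs_neg, abs_one, abs_of_pos hw]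
  calc |deriv Real.smoothTransition ((R₀ - t) / (R₀ - R₁))| * (1 / (R₀ - R₁)) ≤ C * (1 / (R₀ - R₁)) :=
        mul_le_mul_of_nonneg_right (hC _) (by positivity)
    _ = C / (R₀ - R₁) := by ring

/-- `|p″| ≤ C/(R₀ − R₁)²` when `|σ″| ≤ C` and `R₁ < R₀`. [cite: BalabanImbrieJaffe1988, (2.1) p.260] -/
theorem abs_deriv_deriv_cutoffProfile_le {C : ℝ} (hC : ∀ u, |deriv (deriv Real.smoothTransition) u| ≤ C) (hR : R₁ < R₀)
    (t : ℝ) : |deriv (deriv (cutoffProfile R₁ R₀)) t| ≤ C / (R₀ - R₁) ^ 2 := by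
  have hw : 0 < R₀ - R₁ := sub_pos.2 hR
  rw [(hasDerivAt_deriv_cutoffProfile R₁ R₀ t).deriv, abs_mul, abs_mul, abs_div, abs_neg, abs_one, abs_of_pos hw]
  calc |deriv (deriv Real.smoothTransition) ((R₀ - t) / (R₀ - R₁))| * (1 / (R₀ - R₁)) * (1 / (R₀ - R₁))
      ≤ C * (1 / (R₀ - R₁)) * (1 / (R₀ - R₁)) := by gcongr; exact hC _
    _ = C / (R₀ - R₁) ^ 2 := by field_simp

/-- **the profile is Lipschitz**: `|p(t) − p(s)| ≤ (C/(R₀ − R₁))·|t − s|` (`|σ′| ≤ C`, `R₁ < R₀`) — the smooth cutoff varies on the scale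
`R₀ − R₁`. [cite: BalabanImbrieJaffe1988, (2.1) p.260] -/
theorem abs_cutoffProfile_sub_le {C : ℝ} (hC : ∀ u, |deriv Real.smoothTransition u| ≤ C) (hR : R₁ < R₀) (s t : ℝ) :
    |cutoffProfile R₁ R₀ t - cutoffProfile R₁ R₀ s| ≤ C / (R₀ - R₁) * |t - s| := by
  have h := Convex.norm_image_sub_le_of_norm_deriv_le (f := cutoffProfile R₁ R₀) (s := Set.univ) (x := s) (y := t)
    (fun x _ => (hasDerivAt_cutoffProfile R₁ R₀ x).differentiableAt)
    (fun x _ => by rw [Real.norm_eq_abs]; exact abs_deriv_cutoffProfile_le hC hR x) convex_univ (Set.mem_univ s)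
    (Set.mem_univ t)
  simpa only [Real.norm_eq_abs] using h

/-- the derivative of the profile is Lipschitz: `|p′(t) − p′(s)| ≤ (C/(R₀ − R₁)²)·|t − s|` (`|σ″| ≤ C`). [cite: BalabanImbrieJaffe1988, (2.1) p.260] -/
theorem abs_deriv_cutoffProfile_sub_le {C : ℝ} (hC : ∀ u, |deriv (deriv Real.smoothTransition) u| ≤ C) (hR : R₁ < R₀)
    (s t : ℝ) : |deriv (cutoffProfile R₁ R₀) t - deriv (cutoffProfile R₁ R₀) s| ≤ C / (R₀ - R₁) ^ 2 * |t - s| := by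
  have h := Convex.norm_image_sub_le_of_norm_deriv_le (f := deriv (cutoffProfile R₁ R₀)) (s := Set.univ) (x := s) (y := t)
    (fun x _ => (hasDerivAt_deriv_cutoffProfile R₁ R₀ x).differentiableAt)
    (fun x _ => by rw [Real.norm_eq_abs]; exact abs_deriv_deriv_cutoffProfile_le hC hR x) convex_univ (Set.mem_univ s)
    (Set.mem_univ t)
  simpa only [Real.norm_eq_abs] using h

/-- **second differences of the profile**: `|p(t + 2h) − 2p(t + h) + p(t)| ≤ (C/(R₀ − R₁)²)·h²` (`|σ″| ≤ C`, `R₁ < R₀`) — the lattice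
second differences of a `C²` cutoff gain TWO inverse lengths. [cite: BalabanImbrieJaffe1988, (2.1) p.260] -/
theorem abs_secondDiff_cutoffProfile_le {C : ℝ} (hC : ∀ u, |deriv (deriv Real.smoothTransition) u| ≤ C) (hR : R₁ < R₀)
    (t h : ℝ) :
    |cutoffProfile R₁ R₀ (t + 2 * h) - 2 * cutoffProfile R₁ R₀ (t + h) + cutoffProfile R₁ R₀ t| ≤
      C / (R₀ - R₁) ^ 2 * h ^ 2 := by
  -- `g(u) = p(u + h) − p(u)` has derivative `p′(u + h) − p′(u)`, bounded by `(C/(R₀−R₁)²)|h|`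
  have hpd : ∀ u, HasDerivAt (cutoffProfile R₁ R₀) (deriv (cutoffProfile R₁ R₀) u) u := fun u =>
    (hasDerivAt_cutoffProfile R₁ R₀ u).differentiableAt.hasDerivAt
  have hg : ∀ u, HasDerivAt (fun u => cutoffProfile R₁ R₀ (u + h) - cutoffProfile R₁ R₀ u)
      (deriv (cutoffProfile R₁ R₀) (u + h) - deriv (cutoffProfile R₁ R₀) u) u := by
    intro u
    have h1 : HasDerivAt (fun v => cutoffProfile R₁ R₀ (v + h)) (deriv (cutoffProfile R₁ R₀) (u + h)) u := by
      have := (hpd (u + h)).comp u ((hasDerivAt_id u).add_const h)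
      simpa [Function.comp_def] using this
    exact h1.sub (hpd u)
  have hgb : ∀ u, |deriv (cutoffProfile R₁ R₀) (u + h) - deriv (cutoffProfile R₁ R₀) u| ≤ C / (R₀ - R₁) ^ 2 * |h| := by
    intro u
    have := abs_deriv_cutoffProfile_sub_le hC hR u (u + h)
    rwa [add_sub_cancel_left] at this
  have hmv := Convex.norm_image_sub_le_of_norm_deriv_le (f := fun u => cutoffProfile R₁ R₀ (u + h) - cutoffProfile R₁ R₀ u)
    (s := Set.univ) (x := t) (y := t + h)
    (fun u _ => (hg u).differentiableAt) (fun u _ => by rw [(hg u).deriv, Real.norm_eq_abs]; exact hgb u) convex_univ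
    (Set.mem_univ _) (Set.mem_univ _)
  rw [Real.norm_eq_abs, Real.norm_eq_abs, add_sub_cancel_left] at hmv
  have e1 : cutoffProfile R₁ R₀ (t + h + h) - cutoffProfile R₁ R₀ (t + h) - (cutoffProfile R₁ R₀ (t + h) - cutoffProfile R₁ R₀ t) =
      cutoffProfile R₁ R₀ (t + 2 * h) - 2 * cutoffProfile R₁ R₀ (t + h) + cutoffProfile R₁ R₀ t := by ring_nf
  rw [e1] at hmv
  calc _ ≤ C / (R₀ - R₁) ^ 2 * |h| * |h| := hmv
    _ = C / (R₀ - R₁) ^ 2 * h ^ 2 := by rw [mul_assoc, ← abs_mul, abs_mul_self]; ring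

end Profile

/-! ## §2  The circular coordinate distance on `ℤ/N`: one lattice step changes it by at most one; three consecutive points -/

section Circ

variable {N : ℕ} [NeZero N]

/-- `cdist m = min(m.val, N − m.val)`. [folklore] -/
private theorem cdist_eq_min (m : ZMod N) : cdist m = min m.val (N - m.val) := by
  show min m.val (-m).val = _
  rw [ZMod.neg_val]
  split_ifs with h
  · subst h; simp
  · rfl

/-- `(m + 1).val = (m.val + 1) mod N`. [folklore] -/
private theorem val_add_one (m : ZMod N) : (m + 1).val = (m.val + 1) % N := by
  rw [ZMod.val_add, ZMod.val_one_eq_one_mod, Nat.add_mod_mod]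

/-- **one lattice step changes the circular distance by at most one**: `cdist(m + 1) ≤ cdist m + 1` and `cdist m ≤ cdist(m + 1) + 1`
(the coordinate summand of the torus distances (1.3) of [Balaban1982Higgs1], as in `B3TorusRadialSums`). [cite: Balaban1982Higgs1, (1.3) p.604] -/
theorem cdist_add_one_le_and (m : ZMod N) : cdist (m + 1) ≤ cdist m + 1 ∧ cdist m ≤ cdist (m + 1) + 1 := by
  have ha : m.val < N := ZMod.val_lt m
  rw [cdist_eq_min, cdist_eq_min, val_add_one]
  rcases Nat.lt_or_ge (m.val + 1) N with h | h
  · rw [Nat.mod_eq_of_lt h]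
    simp only [Nat.min_def]
    split_ifs <;> omega
  · have h1 : m.val + 1 = N := le_antisymm ha h
    rw [h1, Nat.mod_self]
    simp only [Nat.min_def]
    split_ifs <;> omega

/-- the real form: `|cdist(m + 1) − cdist m| ≤ 1`. [cite: Balaban1982Higgs1, (1.3) p.604] -/
theorem abs_cdist_add_one_sub_le (m : ZMod N) : |((cdist (m + 1) : ℕ) : ℝ) - (cdist m : ℕ)| ≤ 1 := by
  obtain ⟨h1, h2⟩ := cdist_add_one_le_and m
  rw [abs_le]
  constructor
  · have : (cdist m : ℝ) ≤ (cdist (m + 1) : ℝ) + 1 := by exact_mod_cast h2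
    linarith
  · have : (cdist (m + 1) : ℝ) ≤ (cdist m : ℝ) + 1 := by exact_mod_cast h1
    linarith

/-- **three consecutive points of the discrete circle**: their circular distances from a fixed point form an arithmetic progression of
step `±1`, except next to that point (all three distances `≤ 1`) or next to its antipode (all three `≥ (N − 3)/2`) — the geometry of the
torus distance (1.3) behind the second differences of the cutoff. [cite: Balaban1982Higgs1, (1.3) p.604] -/
theorem cdist_three_consecutive (m : ZMod N) :
    (cdist (m + 1) = cdist m + 1 ∧ cdist (m + 1 + 1) = cdist m + 2) ∨
      (cdist m = cdist (m + 1) + 1 ∧ cdist (m + 1) = cdist (m + 1 + 1) + 1) ∨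
      (cdist m ≤ 1 ∧ cdist (m + 1) ≤ 1 ∧ cdist (m + 1 + 1) ≤ 1) ∨
      (N ≤ 2 * cdist m + 3 ∧ N ≤ 2 * cdist (m + 1) + 3 ∧ N ≤ 2 * cdist (m + 1 + 1) + 3) := by
  have ha : m.val < N := ZMod.val_lt m
  have hv1 : (m + 1).val = (m.val + 1) % N := val_add_one m
  have hv2 : (m + 1 + 1).val = ((m.val + 1) % N + 1) % N := by rw [val_add_one, hv1]
  rw [cdist_eq_min, cdist_eq_min, cdist_eq_min, hv2, hv1]
  rcases Nat.lt_or_ge (m.val + 1) N with h | h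
  · rw [Nat.mod_eq_of_lt h]
    rcases Nat.lt_or_ge (m.val + 1 + 1) N with h' | h'
    · rw [Nat.mod_eq_of_lt h']
      simp only [Nat.min_def]
      split_ifs <;> omega
    · have h1 : m.val + 1 + 1 = N := le_antisymm h h'
      rw [h1, Nat.mod_self]
      simp only [Nat.min_def]
      split_ifs <;> omega
  · have h1 : m.val + 1 = N := le_antisymm ha h
    rw [h1, Nat.mod_self, zero_add]
    rcases Nat.lt_or_ge 1 N with h' | h'
    · rw [Nat.mod_eq_of_lt h']
      simp only [Nat.min_def]
      split_ifs <;> omega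
    · have h2 : N = 1 := by have := NeZero.ne N; omega
      subst h2
      rw [Nat.mod_self]
      simp only [Nat.min_def]
      split_ifs <;> omega

end Circ

/-! ## §3  One coordinate factor of the product cutoff: `f(m) = p(cdist(m)/s)` on `ℤ/N`, `s = L^j` fine steps per unit length -/

section Factor

variable {N : ℕ}

/-- ONE COORDINATE FACTOR of the product-form cutoff: `f(m) = p(cdist(m)/s) = σ((R₀ − |m|_T/s)/(R₀ − R₁))`, `|m|_T = cdist m` the
circular distance in lattice steps, `s` the number of fine steps per unit length (`s = L^j` on `T_η` in the unit of `T₁^{(j)}`), `p` = p13's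
profile of the printed cutoff (2.1). [cite: BalabanImbrieJaffe1988, (2.1) p.260] -/
def zfac (R₁ R₀ s : ℝ) (m : ZMod N) : ℝ := cutoffProfile R₁ R₀ ((cdist m : ℝ) / s)

/-- `0 ≤ f`. [cite: BalabanImbrieJaffe1988, (2.1) p.260] -/
theorem zfac_nonneg (R₁ R₀ s : ℝ) (m : ZMod N) : 0 ≤ zfac R₁ R₀ s m := Real.smoothTransition.nonneg _

/-- `f ≤ 1`. [cite: BalabanImbrieJaffe1988, (2.1) p.260] -/
theorem zfac_le_one (R₁ R₀ s : ℝ) (m : ZMod N) : zfac R₁ R₀ s m ≤ 1 := Real.smoothTransition.le_one _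

/-- `|f| ≤ 1`. [cite: BalabanImbrieJaffe1988, (2.1) p.260] -/
theorem abs_zfac_le_one (R₁ R₀ s : ℝ) (m : ZMod N) : |zfac R₁ R₀ s m| ≤ 1 :=
  abs_le.2 ⟨by linarith [zfac_nonneg R₁ R₀ s m], zfac_le_one R₁ R₀ s m⟩

/-- `f = 1` within `R₁`: `cdist(m)/s ≤ R₁ ⇒ f(m) = 1`. [cite: BalabanImbrieJaffe1988, (2.1) p.260] -/
theorem zfac_eq_one {R₁ R₀ s : ℝ} (hR : R₁ < R₀) {m : ZMod N} (h : (cdist m : ℝ) / s ≤ R₁) : zfac R₁ R₀ s m = 1 :=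
  cutoffProfile_eq_one hR h

/-- `f = 0` beyond `R₀`: `R₀ ≤ cdist(m)/s ⇒ f(m) = 0`. [cite: BalabanImbrieJaffe1988, (2.1) p.260] -/
theorem zfac_eq_zero {R₁ R₀ s : ℝ} (hR : R₁ < R₀) {m : ZMod N} (h : R₀ ≤ (cdist m : ℝ) / s) : zfac R₁ R₀ s m = 0 :=
  cutoffProfile_eq_zero hR h

/-- **one lattice step changes a factor by at most `C/((R₀ − R₁)s)`**: `|f(m + 1) − f(m)| ≤ (C/(R₀ − R₁))/s` (`|σ′| ≤ C`, `s > 0`).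
[cite: BalabanImbrieJaffe1988, (2.1) p.260] -/
theorem abs_zfac_add_one_sub_le [NeZero N] {C : ℝ} (hC : ∀ u, |deriv Real.smoothTransition u| ≤ C) {R₁ R₀ s : ℝ}
    (hR : R₁ < R₀) (hs : 0 < s) (m : ZMod N) : |zfac R₁ R₀ s (m + 1) - zfac R₁ R₀ s m| ≤ C / (R₀ - R₁) / s := by
  have hC0 : 0 ≤ C := (abs_nonneg _).trans (hC 0)
  have hw : 0 < R₀ - R₁ := sub_pos.2 hR
  unfold zfac
  refine (abs_cutoffProfile_sub_le hC hR _ _).trans ?_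
  rw [← sub_div, abs_div, abs_of_pos hs, div_eq_mul_one_div (C / (R₀ - R₁)) s]
  refine mul_le_mul_of_nonneg_left ?_ (div_nonneg hC0 hw.le)
  rw [div_le_div_iff_of_pos_right hs]
  exact abs_cdist_add_one_sub_le m

/-- **two lattice steps: the second difference of a factor is `≤ (C/(R₀ − R₁)²)/s²`** when the transition annulus `R₁ < |·|_T/s < R₀`
stays one step away from the centre (`1 ≤ R₁s`) and from the antipode (`R₀s ≤ (N − 3)/2`): `|f(m + 2) − 2f(m + 1) + f(m)| ≤
(C/(R₀ − R₁)²)/s²` (`|σ″| ≤ C`). [cite: BalabanImbrieJaffe1988, (2.1) p.260] -/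
theorem abs_zfac_secondDiff_le [NeZero N] {C : ℝ} (hC : ∀ u, |deriv (deriv Real.smoothTransition) u| ≤ C) {R₁ R₀ s : ℝ}
    (hR : R₁ < R₀) (hs : 0 < s) (h1 : 1 ≤ R₁ * s) (h2 : R₀ * s ≤ ((N : ℝ) - 3) / 2) (m : ZMod N) :
    |zfac R₁ R₀ s (m + 1 + 1) - 2 * zfac R₁ R₀ s (m + 1) + zfac R₁ R₀ s m| ≤ C / (R₀ - R₁) ^ 2 / s ^ 2 := by
  have hC0 : 0 ≤ C := (abs_nonneg _).trans (hC 0)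
  have hw : 0 < R₀ - R₁ := sub_pos.2 hR
  have hbound : 0 ≤ C / (R₀ - R₁) ^ 2 / s ^ 2 := by positivity
  have near : ∀ m' : ZMod N, cdist m' ≤ 1 → zfac R₁ R₀ s m' = 1 := by
    intro m' hm'
    refine zfac_eq_one hR ?_
    rw [div_le_iff₀ hs]
    have : (cdist m' : ℝ) ≤ 1 := by exact_mod_cast hm'
    linarith
  have far : ∀ m' : ZMod N, N ≤ 2 * cdist m' + 3 → zfac R₁ R₀ s m' = 0 := by
    intro m' hm'
    refine zfac_eq_zero hR ?_
    rw [le_div_iff₀ hs]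
    have : (N : ℝ) ≤ 2 * (cdist m' : ℝ) + 3 := by exact_mod_cast hm'
    linarith
  have key : ∀ t : ℝ, |cutoffProfile R₁ R₀ ((t + 2) / s) - 2 * cutoffProfile R₁ R₀ ((t + 1) / s) + cutoffProfile R₁ R₀ (t / s)| ≤
      C / (R₀ - R₁) ^ 2 / s ^ 2 := by
    intro t
    have h := abs_secondDiff_cutoffProfile_le hC hR (t / s) (1 / s)
    have e1 : t / s + 2 * (1 / s) = (t + 2) / s := by ring
    have e2 : t / s + 1 / s = (t + 1) / s := by ring
    rw [e1, e2] at h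
    calc _ ≤ C / (R₀ - R₁) ^ 2 * (1 / s) ^ 2 := h
      _ = C / (R₀ - R₁) ^ 2 / s ^ 2 := by ring
  have key' : ∀ t : ℝ, cutoffProfile R₁ R₀ (t / s) - 2 * cutoffProfile R₁ R₀ ((t + 1) / s) + cutoffProfile R₁ R₀ ((t + 1 + 1) / s) =
      cutoffProfile R₁ R₀ ((t + 2) / s) - 2 * cutoffProfile R₁ R₀ ((t + 1) / s) + cutoffProfile R₁ R₀ (t / s) := by
    intro t; rw [show t + 1 + 1 = t + 2 by ring]; ring
  rcases cdist_three_consecutive m with ⟨ha, hb⟩ | ⟨ha, hb⟩ | ⟨ha, hb, hc⟩ | ⟨ha, hb, hc⟩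
  · -- increasing arithmetic progression
    unfold zfac
    rw [hb, ha]
    push_cast
    exact key _
  · -- decreasing arithmetic progression
    unfold zfac
    rw [ha, hb]
    push_cast
    rw [key']
    exact key _
  · have e : zfac R₁ R₀ s (m + 1 + 1) - 2 * zfac R₁ R₀ s (m + 1) + zfac R₁ R₀ s m = 0 := by
      rw [near _ ha, near _ hb, near _ hc]; ring
    rw [e, abs_zero]
    exact hbound
  · have e : zfac R₁ R₀ s (m + 1 + 1) - 2 * zfac R₁ R₀ s (m + 1) + zfac R₁ R₀ s m = 0 := by
      rw [far _ ha, far _ hb, far _ hc]; ring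
    rw [e, abs_zero]
    exact hbound

end Factor

/-! ## §4  THE PRODUCT-FORM SMOOTH CUTOFF `ζ^Π_j(x, y) = Π_μ p(|x_μ − (y)_μ|_T / L^j)` on the torus: same 0/1 regions as the cutoff of
record, values in `[0, 1]`, and LATTICE SMOOTHNESS IN `b` -/

section ProductCutoff

variable {P : Params}

/-- `0 < L^n`. [folklore] -/
private theorem cast_pow_L_pos' (n : ℕ) : (0 : ℝ) < (P.L : ℝ) ^ n := pow_pos P.cast_L_pos n

/-- the coordinate differences `x_μ − c_μ ∈ ℤ/|T_η|` between a fine site and the centre `c = ctr j y` of the `j`-block of `y`; their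
circular sizes `cdist` are the coordinate distances whose maximum is the sup distance `|x − c|_∞ = supDist x c` of (2.1)/(7.2.2)
(`B3TorusRadialSums.supDist_eq_sup_cdist`). [cite: BalabanImbrieJaffe1988, (2.1) p.260] -/
abbrev coordDiff (j : ℕ) (x : TSite P 0) (y : TSite P j) (μ : Fin P.d) : ZMod (P.sitesPerDir 0) := x μ - ctr j y μ

/-- **THE PRODUCT-FORM SMOOTH CUTOFF** `ζ^Π_j(x, y) := Π_{μ<d} σ((R₀ − |x_μ − c_μ|_T/L^j)/(R₀ − R₁))`, `c = ctr j y` the centre of the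
`j`-block of `y` in the fine lattice `T_η`, `|·|_T` the circular coordinate distance (fine steps), `L^j` fine steps = one unit of `T₁^{(j)}`:
print's *"translation invariant localization function ζ_k … such that ζ_k is a smooth function of b"* (2.1), realised coordinatewise so that
it is smooth IN THE LATTICE POINT (the cutoff of record `cutoff R₁ R₀ hdist` composes the profile with the sup-norm distance `max_μ|x_μ − c_μ|_T`,
which is only Lipschitz in `x`).  Print's radii: `R₁ = r(e_j)/16`, `R₀ = r(e_j)/8`. [cite: BalabanImbrieJaffe1988, (2.1) p.260] -/
def zetaPi (R₁ R₀ : ℝ) (j : ℕ) (x : TSite P 0) (y : TSite P j) : ℝ :=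
  ∏ μ : Fin P.d, zfac R₁ R₀ ((P.L : ℝ) ^ j) (coordDiff j x y μ)

/-- the bond form `ζ^Π_j(b, b₁) = ζ^Π_j(b₋, (b₁)₋)` of (2.1)/(2.4) (`b ∈ T_η`, `b₁ ∈ T₁^{(j)}`; as the cutoff of record, a function of the
initial points). [cite: BalabanImbrieJaffe1988, (2.1) p.260] -/
def zetaPiB (R₁ R₀ : ℝ) (j : ℕ) (b : PBond P 0) (b₁ : PBond P j) : ℝ := zetaPi R₁ R₀ j b.src b₁.src

/-- `0 ≤ ζ^Π`. [cite: BalabanImbrieJaffe1988, (2.1) p.260] -/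
theorem zetaPi_nonneg (R₁ R₀ : ℝ) (j : ℕ) (x : TSite P 0) (y : TSite P j) : 0 ≤ zetaPi R₁ R₀ j x y :=
  Finset.prod_nonneg fun _ _ => zfac_nonneg _ _ _ _

/-- `ζ^Π ≤ 1`. [cite: BalabanImbrieJaffe1988, (2.1) p.260] -/
theorem zetaPi_le_one (R₁ R₀ : ℝ) (j : ℕ) (x : TSite P 0) (y : TSite P j) : zetaPi R₁ R₀ j x y ≤ 1 :=
  Finset.prod_le_one (fun _ _ => zfac_nonneg _ _ _ _) fun _ _ => zfac_le_one _ _ _ _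

/-- `|ζ^Π| ≤ 1`. [cite: BalabanImbrieJaffe1988, (2.1) p.260] -/
theorem abs_zetaPi_le_one (R₁ R₀ : ℝ) (j : ℕ) (x : TSite P 0) (y : TSite P j) : |zetaPi R₁ R₀ j x y| ≤ 1 :=
  abs_le.2 ⟨by linarith [zetaPi_nonneg R₁ R₀ j x y], zetaPi_le_one R₁ R₀ j x y⟩

/-- `|ζ^Π − 1| ≤ 1`. [cite: BalabanImbrieJaffe1988, (2.7) p.260] -/
theorem abs_zetaPi_sub_one_le_one (R₁ R₀ : ℝ) (j : ℕ) (x : TSite P 0) (y : TSite P j) : |zetaPi R₁ R₀ j x y - 1| ≤ 1 :=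
  abs_le.2 ⟨by linarith [zetaPi_nonneg R₁ R₀ j x y], by linarith [zetaPi_le_one R₁ R₀ j x y]⟩

/-- `0 ≤ ζ^Π ≤ 1` in the paired bond form used downstream. [cite: BalabanImbrieJaffe1988, (2.1) p.260] -/
theorem zetaPiB_mem_Icc (R₁ R₀ : ℝ) (j : ℕ) :
    ∀ (b : PBond P 0) (b₁ : PBond P j), 0 ≤ zetaPiB R₁ R₀ j b b₁ ∧ zetaPiB R₁ R₀ j b b₁ ≤ 1 :=
  fun _ _ => ⟨zetaPi_nonneg _ _ _ _ _, zetaPi_le_one _ _ _ _ _⟩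

/-- **SAME 0/1 REGIONS AS THE CUTOFF OF RECORD: `ζ^Π_j = 1` for `dist(b, b₁) ≤ R₁` and `ζ^Π_j = 0` for `dist(b, b₁) ≥ R₀`**, `dist = hdist j` =
`|b₋ − c(b₁)|_∞/L^j` the (2.1)/(7.2.2) distance of record (`BIJ88CurlyDkLocTorus.hdist` = `distEU`) — r18's `IsCutoff` INHABITED (the sup
distance is `≤ R₁` iff EVERY coordinate distance is, and `≥ R₀` iff SOME coordinate distance is). [cite: BalabanImbrieJaffe1988, (2.1) p.260] -/
theorem isCutoff_zetaPiB {R₁ R₀ : ℝ} (hR : R₁ < R₀) (j : ℕ) :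
    IsCutoff (BIJ88CurlyDkLocTorus.hdist (P := P) j) (zetaPiB R₁ R₀ j) R₁ R₀ := by
  have hLj := cast_pow_L_pos' (P := P) j
  refine ⟨fun b b₁ h => ?_, fun b b₁ h => ?_⟩ <;> unfold zetaPiB zetaPi
  · -- every coordinate distance is within `R₁`
    refine Finset.prod_eq_one fun μ _ => zfac_eq_one hR ?_
    refine le_trans ?_ h
    show (cdist (b.src μ - ctr j b₁.src μ) : ℝ) / (P.L : ℝ) ^ j ≤ (supDist b.src (ctr j b₁.src) : ℝ) / (P.L : ℝ) ^ j
    exact div_le_div_of_nonneg_right (by exact_mod_cast cdist_le_supDist b.src (ctr j b₁.src) μ) hLj.le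
  · -- some coordinate realises the sup distance, beyond `R₀`
    have hne : (Finset.univ : Finset (Fin P.d)).Nonempty := ⟨⟨0, P.hd⟩, Finset.mem_univ _⟩
    obtain ⟨μ, -, hμ⟩ := Finset.exists_mem_eq_sup Finset.univ hne fun μ : Fin P.d => cdist (b.src μ - ctr j b₁.src μ)
    refine Finset.prod_eq_zero (Finset.mem_univ μ) (zfac_eq_zero hR ?_)
    refine le_trans h (le_of_eq ?_)
    show (supDist b.src (ctr j b₁.src) : ℝ) / (P.L : ℝ) ^ j = (cdist (b.src μ - ctr j b₁.src μ) : ℝ) / (P.L : ℝ) ^ j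
    rw [supDist_eq_sup_cdist, hμ]

/-! ### coordinates of shifted sites -/

/-- `(x + e_λ)_λ − c_λ = (x_λ − c_λ) + 1`. [folklore] -/
private theorem coordDiff_shift_self (j : ℕ) (x : TSite P 0) (y : TSite P j) (lam : Fin P.d) :
    coordDiff j (x.shift lam) y lam = coordDiff j x y lam + 1 := by
  simp only [coordDiff, Balaban1983to89.Site.shift, Function.update_self]; ring

/-- `(x + e_λ)_μ − c_μ = x_μ − c_μ` for `μ ≠ λ`. [folklore] -/
private theorem coordDiff_shift_ne (j : ℕ) (x : TSite P 0) (y : TSite P j) {lam μ : Fin P.d} (h : μ ≠ lam) :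
    coordDiff j (x.shift lam) y μ = coordDiff j x y μ := by
  simp only [coordDiff, Balaban1983to89.Site.shift, Function.update_of_ne h]

/-- `(x + e_λ)_μ = x_μ` for `μ ≠ λ`. [folklore] -/
private theorem shift_ne (x : TSite P 0) {lam μ : Fin P.d} (h : μ ≠ lam) : x.shift lam μ = x μ := by
  simp only [Balaban1983to89.Site.shift, Function.update_of_ne h]

/-- lattice translations commute. [folklore] -/
private theorem shift_comm (x : TSite P 0) (κ lam : Fin P.d) : (x.shift κ).shift lam = (x.shift lam).shift κ := by
  funext μ
  by_cases h1 : μ = lam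
  · subst h1
    by_cases h2 : μ = κ
    · subst h2; rfl
    · simp only [Balaban1983to89.Site.shift, Function.update_self, Function.update_of_ne h2]
  · by_cases h2 : μ = κ
    · subst h2
      simp only [Balaban1983to89.Site.shift, Function.update_self, Function.update_of_ne h1]
    · simp only [Balaban1983to89.Site.shift, Function.update_of_ne h1, Function.update_of_ne h2]

/-- a simultaneous shift does not change coordinate differences. [folklore] -/
private theorem shift_sub_shift (x x' : TSite P 0) (lam μ : Fin P.d) : x.shift lam μ - x'.shift lam μ = x μ - x' μ := by
  by_cases h : μ = lam
  · subst h; simp only [Balaban1983to89.Site.shift, Function.update_self]; ring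
  · rw [shift_ne x h, shift_ne x' h]

/-- `|x + e_λ − (x′ + e_λ)|_∞ = |x − x′|_∞`. [folklore] -/
private theorem supDist_shift_shift (x x' : TSite P 0) (lam : Fin P.d) : supDist (x.shift lam) (x'.shift lam) = supDist x x' := by
  unfold supDist
  congr 1
  funext μ
  rw [shift_sub_shift, ← neg_sub (x.shift lam μ), shift_sub_shift, neg_sub]

/-! ### the product split off one or two coordinates -/

/-- `ζ^Π = f_λ · Π_{μ ≠ λ} f_μ`. [folklore] -/
private theorem zetaPi_eq_mul_erase (R₁ R₀ : ℝ) (j : ℕ) (x : TSite P 0) (y : TSite P j) (lam : Fin P.d) :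
    zetaPi R₁ R₀ j x y = zfac R₁ R₀ ((P.L : ℝ) ^ j) (coordDiff j x y lam) *
      ∏ μ ∈ Finset.univ.erase lam, zfac R₁ R₀ ((P.L : ℝ) ^ j) (coordDiff j x y μ) :=
  (Finset.mul_prod_erase _ _ (Finset.mem_univ lam)).symm

/-- the complementary products are in `[0, 1]`. [folklore] -/
private theorem abs_prod_le_one (R₁ R₀ : ℝ) (j : ℕ) (x : TSite P 0) (y : TSite P j) (s : Finset (Fin P.d)) :
    |∏ μ ∈ s, zfac R₁ R₀ ((P.L : ℝ) ^ j) (coordDiff j x y μ)| ≤ 1 := by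
  rw [abs_of_nonneg (Finset.prod_nonneg fun _ _ => zfac_nonneg _ _ _ _)]
  exact Finset.prod_le_one (fun _ _ => zfac_nonneg _ _ _ _) fun _ _ => zfac_le_one _ _ _ _

/-- `ζ^Π(x + e_λ) = f(x_λ − c_λ + 1) · Π_{μ ≠ λ} f_μ(x)`. [folklore] -/
private theorem zetaPi_shift_eq (R₁ R₀ : ℝ) (j : ℕ) (x : TSite P 0) (y : TSite P j) (lam : Fin P.d) :
    zetaPi R₁ R₀ j (x.shift lam) y = zfac R₁ R₀ ((P.L : ℝ) ^ j) (coordDiff j x y lam + 1) *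
      ∏ μ ∈ Finset.univ.erase lam, zfac R₁ R₀ ((P.L : ℝ) ^ j) (coordDiff j x y μ) := by
  rw [zetaPi_eq_mul_erase R₁ R₀ j (x.shift lam) y lam, coordDiff_shift_self]
  congr 1
  exact Finset.prod_congr rfl fun μ hμ => by rw [coordDiff_shift_ne j x y (Finset.mem_erase.1 hμ).1]

/-- `ζ^Π(x + 2e_λ) = f(x_λ − c_λ + 2) · Π_{μ ≠ λ} f_μ(x)`. [folklore] -/
private theorem zetaPi_shift_shift_eq (R₁ R₀ : ℝ) (j : ℕ) (x : TSite P 0) (y : TSite P j) (lam : Fin P.d) :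
    zetaPi R₁ R₀ j ((x.shift lam).shift lam) y = zfac R₁ R₀ ((P.L : ℝ) ^ j) (coordDiff j x y lam + 1 + 1) *
      ∏ μ ∈ Finset.univ.erase lam, zfac R₁ R₀ ((P.L : ℝ) ^ j) (coordDiff j x y μ) := by
  rw [zetaPi_shift_eq R₁ R₀ j (x.shift lam) y lam, coordDiff_shift_self]
  congr 1
  exact Finset.prod_congr rfl fun μ hμ => by rw [coordDiff_shift_ne j x y (Finset.mem_erase.1 hμ).1]

/-- **ONE LATTICE STEP IN `b` CHANGES `ζ^Π_j` BY AT MOST `C_σ/((R₀ − R₁)L^j)`** (`|σ′| ≤ C_σ`): the first differences of the smooth cutoff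
carry one inverse length `(R₀ − R₁)L^j` = the width of the transition annulus in fine steps. [cite: BalabanImbrieJaffe1988, (2.1) p.260] -/
theorem abs_zetaPi_shift_sub_le {C : ℝ} (hC : ∀ u, |deriv Real.smoothTransition u| ≤ C) {R₁ R₀ : ℝ} (hR : R₁ < R₀) (j : ℕ)
    (x : TSite P 0) (y : TSite P j) (lam : Fin P.d) :
    |zetaPi R₁ R₀ j (x.shift lam) y - zetaPi R₁ R₀ j x y| ≤ C / (R₀ - R₁) / (P.L : ℝ) ^ j := by
  rw [zetaPi_shift_eq, zetaPi_eq_mul_erase R₁ R₀ j x y lam, ← sub_mul, abs_mul]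
  have h1 := abs_zfac_add_one_sub_le hC hR (cast_pow_L_pos' (P := P) j) (coordDiff j x y lam)
  have h2 := abs_prod_le_one R₁ R₀ j x y (Finset.univ.erase lam)
  have h0 : 0 ≤ C / (R₀ - R₁) / (P.L : ℝ) ^ j := le_trans (abs_nonneg _) h1
  calc _ ≤ C / (R₀ - R₁) / (P.L : ℝ) ^ j * 1 := mul_le_mul h1 h2 (abs_nonneg _) h0
    _ = _ := mul_one _

/-- the constant of the second differences: `A₂ = (C/(R₀ − R₁))² + C/(R₀ − R₁)²` (mixed directions: two first differences; one
direction twice: a second difference of the profile). [cite: BalabanImbrieJaffe1988, (2.1) p.260] -/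
def secondDiffConst (C R₁ R₀ : ℝ) : ℝ := (C / (R₀ - R₁)) ^ 2 + C / (R₀ - R₁) ^ 2

/-- `0 ≤ A₂` for `C ≥ 0`. [cite: BalabanImbrieJaffe1988, (2.1) p.260] -/
theorem secondDiffConst_nonneg {C : ℝ} (hC : 0 ≤ C) (R₁ R₀ : ℝ) : 0 ≤ secondDiffConst C R₁ R₀ := by
  unfold secondDiffConst; positivity

/-- **TWO LATTICE STEPS: THE SECOND DIFFERENCES OF `ζ^Π_j` IN `b` ARE `≤ A₂/L^{2j}`** — `|ζ^Π(x + e_λ + e_κ) − ζ^Π(x + e_λ) − ζ^Π(x + e_κ) +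
ζ^Π(x)| ≤ ((C_σ/(R₀ − R₁))² + C_σ/(R₀ − R₁)²)/L^{2j}` for ALL directions `κ, λ` (`|σ′|, |σ″| ≤ C_σ`), provided the transition annulus stays one
fine step away from the block centre and from the antipode: `1 ≤ R₁L^j` and `R₀L^j ≤ (|T_η| − 3)/2`, `|T_η| = sitesPerDir 0` — THIS is the
lattice form of print's *"ζ_k is a smooth function of b"*: the SECOND differences gain TWO inverse lengths, which the sup-norm composite
`σ(max_μ|·|_T/L^j)` of record does not do at the corners of its cubical level sets. [cite: BalabanImbrieJaffe1988, (2.1) p.260] -/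
theorem abs_zetaPi_secondDiff_le {C : ℝ} (hC1 : ∀ u, |deriv Real.smoothTransition u| ≤ C)
    (hC2 : ∀ u, |deriv (deriv Real.smoothTransition) u| ≤ C) {R₁ R₀ : ℝ} (hR : R₁ < R₀) (j : ℕ)
    (h1 : 1 ≤ R₁ * (P.L : ℝ) ^ j) (h2 : R₀ * (P.L : ℝ) ^ j ≤ ((P.sitesPerDir 0 : ℝ) - 3) / 2)
    (x : TSite P 0) (y : TSite P j) (κ lam : Fin P.d) :
    |zetaPi R₁ R₀ j ((x.shift lam).shift κ) y - zetaPi R₁ R₀ j (x.shift lam) y - zetaPi R₁ R₀ j (x.shift κ) y + zetaPi R₁ R₀ j x y| ≤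
      secondDiffConst C R₁ R₀ / ((P.L : ℝ) ^ j) ^ 2 := by
  have hLj := cast_pow_L_pos' (P := P) j
  have hC0 : 0 ≤ C := (abs_nonneg _).trans (hC1 0)
  have hw : 0 < R₀ - R₁ := sub_pos.2 hR
  by_cases hκ : κ = lam
  · -- the same direction twice: a second difference of one factor
    subst hκ
    rw [zetaPi_shift_shift_eq, zetaPi_shift_eq, zetaPi_eq_mul_erase R₁ R₀ j x y κ]
    have e3 : ∀ f0 f1 f2 Q : ℝ, f2 * Q - f1 * Q - f1 * Q + f0 * Q = (f2 - 2 * f1 + f0) * Q := fun _ _ _ _ => by ring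
    rw [e3, abs_mul]
    have hf := abs_zfac_secondDiff_le hC2 hR hLj h1 h2 (coordDiff j x y κ)
    have hp := abs_prod_le_one R₁ R₀ j x y (Finset.univ.erase κ)
    calc _ ≤ C / (R₀ - R₁) ^ 2 / ((P.L : ℝ) ^ j) ^ 2 * 1 := mul_le_mul hf hp (abs_nonneg _) (by positivity)
      _ ≤ secondDiffConst C R₁ R₀ / ((P.L : ℝ) ^ j) ^ 2 := by
          rw [mul_one, secondDiffConst, add_div]
          exact le_add_of_nonneg_left (by positivity)
  · -- two different directions: a product of two first differences
    have hκ' : κ ∈ Finset.univ.erase lam := Finset.mem_erase.2 ⟨hκ, Finset.mem_univ κ⟩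
    have split : ∀ z : TSite P 0, zetaPi R₁ R₀ j z y = zfac R₁ R₀ ((P.L : ℝ) ^ j) (coordDiff j z y lam) *
        (zfac R₁ R₀ ((P.L : ℝ) ^ j) (coordDiff j z y κ) *
          ∏ μ ∈ (Finset.univ.erase lam).erase κ, zfac R₁ R₀ ((P.L : ℝ) ^ j) (coordDiff j z y μ)) := by
      intro z
      rw [zetaPi_eq_mul_erase R₁ R₀ j z y lam, ← Finset.mul_prod_erase _ _ hκ']
    have restl : ∏ μ ∈ (Finset.univ.erase lam).erase κ, zfac R₁ R₀ ((P.L : ℝ) ^ j) (coordDiff j (x.shift lam) y μ) =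
        ∏ μ ∈ (Finset.univ.erase lam).erase κ, zfac R₁ R₀ ((P.L : ℝ) ^ j) (coordDiff j x y μ) :=
      Finset.prod_congr rfl fun μ hμ => by
        rw [coordDiff_shift_ne j x y (Finset.mem_erase.1 (Finset.mem_erase.1 hμ).2).1]
    have restk : ∀ z : TSite P 0, ∏ μ ∈ (Finset.univ.erase lam).erase κ, zfac R₁ R₀ ((P.L : ℝ) ^ j) (coordDiff j (z.shift κ) y μ) =
        ∏ μ ∈ (Finset.univ.erase lam).erase κ, zfac R₁ R₀ ((P.L : ℝ) ^ j) (coordDiff j z y μ) := fun z =>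
      Finset.prod_congr rfl fun μ hμ => by rw [coordDiff_shift_ne j z y (Finset.mem_erase.1 hμ).1]
    rw [split ((x.shift lam).shift κ), split (x.shift lam), split (x.shift κ), split x, restk, restl, restk,
      coordDiff_shift_ne j (x.shift lam) y (Ne.symm hκ), coordDiff_shift_self, coordDiff_shift_self, coordDiff_shift_ne j x y hκ,
      coordDiff_shift_self, coordDiff_shift_ne j x y (Ne.symm hκ)]
    have e3 : ∀ a0 a1 b0 b1 Q : ℝ, a1 * (b1 * Q) - a1 * (b0 * Q) - a0 * (b1 * Q) + a0 * (b0 * Q) = (a1 - a0) * (b1 - b0) * Q :=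
      fun _ _ _ _ _ => by ring
    rw [e3, abs_mul, abs_mul]
    have ha := abs_zfac_add_one_sub_le hC1 hR hLj (coordDiff j x y lam)
    have hb := abs_zfac_add_one_sub_le hC1 hR hLj (coordDiff j x y κ)
    have hq := abs_prod_le_one R₁ R₀ j x y ((Finset.univ.erase lam).erase κ)
    have h0 : 0 ≤ C / (R₀ - R₁) / (P.L : ℝ) ^ j := by positivity
    calc _ ≤ C / (R₀ - R₁) / (P.L : ℝ) ^ j * (C / (R₀ - R₁) / (P.L : ℝ) ^ j) * 1 :=
          mul_le_mul (mul_le_mul ha hb (abs_nonneg _) h0) hq (abs_nonneg _) (by positivity)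
      _ = (C / (R₀ - R₁)) ^ 2 / ((P.L : ℝ) ^ j) ^ 2 := by rw [mul_one]; ring
      _ ≤ secondDiffConst C R₁ R₀ / ((P.L : ℝ) ^ j) ^ 2 := by
          rw [secondDiffConst, add_div]
          exact le_add_of_nonneg_right (by positivity)

/-! ### summed along a lattice path: differences at two points `x, x′` -/

/-- **`ζ^Π_j` IS LIPSCHITZ IN `b` ALONG THE LATTICE**: `|ζ^Π(x) − ζ^Π(x′)| ≤ |x − x′|₁·C_σ/((R₀ − R₁)L^j)` (`|·|₁ = Site.tdist` fine steps; the
tree's lattice mean-value bound `B3ConstantField433.norm_sub_le_tdist`). [cite: BalabanImbrieJaffe1988, (2.1) p.260] -/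
theorem abs_zetaPi_sub_le {C : ℝ} (hC : ∀ u, |deriv Real.smoothTransition u| ≤ C) {R₁ R₀ : ℝ} (hR : R₁ < R₀) (j : ℕ)
    (x x' : TSite P 0) (y : TSite P j) :
    |zetaPi R₁ R₀ j x y - zetaPi R₁ R₀ j x' y| ≤ (x'.tdist x : ℝ) * (C / (R₀ - R₁) / (P.L : ℝ) ^ j) := by
  have h := norm_sub_le_tdist (P := P) (j := 0) (V := ℝ) zero_lt_one (fun z => zetaPi R₁ R₀ j z y)
    (Pb := C / (R₀ - R₁) / (P.L : ℝ) ^ j) (fun z μ => by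
      rw [pdiff, inv_one, one_smul, Real.norm_eq_abs]
      exact abs_zetaPi_shift_sub_le hC hR j z y μ) x' x
  rw [Real.norm_eq_abs, one_mul] at h
  exact h

/-- **THE FIRST DIFFERENCES OF `ζ^Π_j` ARE LIPSCHITZ IN `b` ALONG THE LATTICE**: `|Δ_λζ^Π(x) − Δ_λζ^Π(x′)| ≤ |x − x′|₁·A₂/L^{2j}` (side
conditions of `abs_zetaPi_secondDiff_le`). [cite: BalabanImbrieJaffe1988, (2.1) p.260] -/
theorem abs_zetaPi_diff_sub_le {C : ℝ} (hC1 : ∀ u, |deriv Real.smoothTransition u| ≤ C)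
    (hC2 : ∀ u, |deriv (deriv Real.smoothTransition) u| ≤ C) {R₁ R₀ : ℝ} (hR : R₁ < R₀) (j : ℕ)
    (h1 : 1 ≤ R₁ * (P.L : ℝ) ^ j) (h2 : R₀ * (P.L : ℝ) ^ j ≤ ((P.sitesPerDir 0 : ℝ) - 3) / 2)
    (x x' : TSite P 0) (y : TSite P j) (lam : Fin P.d) :
    |(zetaPi R₁ R₀ j (x.shift lam) y - zetaPi R₁ R₀ j x y) - (zetaPi R₁ R₀ j (x'.shift lam) y - zetaPi R₁ R₀ j x' y)| ≤
      (x'.tdist x : ℝ) * (secondDiffConst C R₁ R₀ / ((P.L : ℝ) ^ j) ^ 2) := by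
  have h := norm_sub_le_tdist (P := P) (j := 0) (V := ℝ) zero_lt_one
    (fun z => zetaPi R₁ R₀ j (z.shift lam) y - zetaPi R₁ R₀ j z y)
    (Pb := secondDiffConst C R₁ R₀ / ((P.L : ℝ) ^ j) ^ 2) (fun z κ => by
      rw [pdiff, inv_one, one_smul, Real.norm_eq_abs, shift_comm z κ lam]
      have e : zetaPi R₁ R₀ j ((z.shift lam).shift κ) y - zetaPi R₁ R₀ j (z.shift κ) y -
          (zetaPi R₁ R₀ j (z.shift lam) y - zetaPi R₁ R₀ j z y) =
          zetaPi R₁ R₀ j ((z.shift lam).shift κ) y - zetaPi R₁ R₀ j (z.shift lam) y - zetaPi R₁ R₀ j (z.shift κ) y +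
            zetaPi R₁ R₀ j z y := by ring
      rw [e]
      exact abs_zetaPi_secondDiff_le hC1 hC2 hR j h1 h2 z y κ lam) x' x
  rw [Real.norm_eq_abs, one_mul] at h
  exact h

end ProductCutoff

/-! ## §5  The product rule behind *"the derivative and Hölder derivative of order less than 2 also have exponential decay"*: one output
component, abstract cutoff `Z` and kernel column `G` on the fine torus -/

section ProductRule

variable {P : Params}

/-- `|x − y|₁` is symmetric on the torus. [folklore] -/
private theorem tdist_comm' {j : ℕ} (x y : TSite P j) : x.tdist y = y.tdist x := by
  unfold Balaban1983to89.Site.tdist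
  exact Finset.sum_congr rfl fun μ _ => min_comm _ _

/-- `|x′ − x|₁ ≤ d·|x − x′|_∞` (real form). [folklore] -/
private theorem tdist_le_d_supDist {j : ℕ} (x x' : TSite P j) : (x'.tdist x : ℝ) ≤ (P.d : ℝ) * (supDist x x' : ℝ) := by
  rw [supDist_comm]; exact_mod_cast tdist_le_mul_supDist x' x

/-- THE PRODUCT RULE, pointwise identity: `∇(ZG)(x) − ∇(ZG)(x′) = Z(x+e)(∇G(x) − ∇G(x′)) + (Z(x+e) − Z(x′+e))∇G(x′) + ∇Z(x)(G(x) − G(x′)) +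
(∇Z(x) − ∇Z(x′))G(x′)` with `∇F(x) = c(F(x+e) − F(x))`. [folklore] -/
private theorem prodRule_identity (c Z₁ Z₀ G₁ G₀ Z₁' Z₀' G₁' G₀' : ℝ) :
    c * (Z₁ * G₁ - Z₀ * G₀) - c * (Z₁' * G₁' - Z₀' * G₀') =
      Z₁ * (c * (G₁ - G₀) - c * (G₁' - G₀')) + (Z₁ - Z₁') * (c * (G₁' - G₀')) +
        c * (Z₁ - Z₀) * (G₀ - G₀') + (c * (Z₁ - Z₀) - c * (Z₁' - Z₀')) * G₀' := by
  ring

/-- the product rule, bound: the four terms estimated separately. [folklore] -/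
private theorem prodRule_bound {c Z₁ Z₀ G₁ G₀ Z₁' Z₀' G₁' G₀' hG ℓZ g₁ aZ ℓG hZ g₀ : ℝ}
    (h1 : |Z₁| ≤ 1) (hT1 : |c * (G₁ - G₀) - c * (G₁' - G₀')| ≤ hG)
    (hT2a : |Z₁ - Z₁'| ≤ ℓZ) (hT2b : |c * (G₁' - G₀')| ≤ g₁)
    (hT3a : |c * (Z₁ - Z₀)| ≤ aZ) (hT3b : |G₀ - G₀'| ≤ ℓG)
    (hT4a : |c * (Z₁ - Z₀) - c * (Z₁' - Z₀')| ≤ hZ) (hT4b : |G₀'| ≤ g₀) :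
    |c * (Z₁ * G₁ - Z₀ * G₀) - c * (Z₁' * G₁' - Z₀' * G₀')| ≤ hG + ℓZ * g₁ + aZ * ℓG + hZ * g₀ := by
  rw [prodRule_identity]
  have hℓZ : 0 ≤ ℓZ := (abs_nonneg _).trans hT2a
  have haZ : 0 ≤ aZ := (abs_nonneg _).trans hT3a
  have hhZ : 0 ≤ hZ := (abs_nonneg _).trans hT4a
  refine (abs_add_le _ _).trans (add_le_add ((abs_add_le _ _).trans (add_le_add ((abs_add_le _ _).trans (add_le_add ?_ ?_)) ?_)) ?_)
  · rw [abs_mul]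
    calc |Z₁| * |c * (G₁ - G₀) - c * (G₁' - G₀')| ≤ 1 * hG := mul_le_mul h1 hT1 (abs_nonneg _) zero_le_one
      _ = hG := one_mul _
  · rw [abs_mul]; exact mul_le_mul hT2a hT2b (abs_nonneg _) hℓZ
  · rw [abs_mul]; exact mul_le_mul hT3a hT3b (abs_nonneg _) haZ
  · rw [abs_mul]; exact mul_le_mul hT4a hT4b (abs_nonneg _) hhZ

/-- exponential weights at nearby points: `E(x) ≤ E(z) + T`, `δ ≥ 0` ⇒ `e^{−δE(z)} ≤ e^{δT}e^{−δE(x)}`. [folklore] -/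
private theorem exp_le_exp_mul {δ Ex Ez T : ℝ} (hδ : 0 ≤ δ) (h : Ex ≤ Ez + T) :
    Real.exp (-(δ * Ez)) ≤ Real.exp (δ * T) * Real.exp (-(δ * Ex)) := by
  rw [← Real.exp_add]
  exact Real.exp_le_exp.2 (by nlinarith)

/-- the constant of the Hölder member: `K = M_h + d·M·(A₁e^δ + A₁e^{δ(d+1)} + A₂e^δ)`. [cite: BalabanImbrieJaffe1988, (2.5) p.260] -/
def holderConst (d : ℕ) (Mh M A₁ A₂ δ : ℝ) : ℝ :=
  Mh + (d : ℝ) * M * (A₁ * Real.exp δ + A₁ * Real.exp (δ * ((d : ℝ) + 1)) + A₂ * Real.exp δ)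

/-- `0 ≤ K`. [cite: BalabanImbrieJaffe1988, (2.5) p.260] -/
theorem holderConst_nonneg (d : ℕ) {Mh M A₁ A₂ : ℝ} (hMh : 0 ≤ Mh) (hM : 0 ≤ M) (hA₁ : 0 ≤ A₁) (hA₂ : 0 ≤ A₂) (δ : ℝ) :
    0 ≤ holderConst d Mh M A₁ A₂ δ := by
  unfold holderConst; positivity

/-- `K` is monotone in `M_h`. [cite: BalabanImbrieJaffe1988, (2.5) p.260] -/
theorem holderConst_mono (d : ℕ) {Mh Mh' : ℝ} (h : Mh ≤ Mh') (M A₁ A₂ δ : ℝ) :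
    holderConst d Mh M A₁ A₂ δ ≤ holderConst d Mh' M A₁ A₂ δ := by
  unfold holderConst; linarith

/-- **THE HÖLDER MEMBER OF A LOCALIZED COLUMN, ONE OUTPUT COMPONENT.**  On the fine torus `T_η` at scale `j` (`s = L^j` fine steps per unit
length) let `Z` be a lattice-smooth cutoff (`|Z| ≤ 1`, first differences `≤ A₁/s`, second differences `≤ A₂/s²`) and `G` a kernel column
with `|G(z)| ≤ Me^{−δE(z)}`, `|s(G(z+e_κ) − G(z))| ≤ Me^{−δE(z)}` for a weight `E` that is 1-Lipschitz for `|·|_∞/s` from the base point `x`, and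
with the Hölder member `|∇_λG(x) − ∇_λG(x′)| ≤ M_h r^α e^{−δE(x)}` at the pair `x ≠ x′`, `r = |x − x′|_∞/s ≤ 1`.  Then the localized column
`ZG` has the Hölder member `|∇_λ(ZG)(x) − ∇_λ(ZG)(x′)| ≤ K r^α e^{−δE(x)}`, `K = holderConst d M_h M A₁ A₂ δ` — print's *"Since ζ_k and H_k have
good decay properties, so does H_{k,loc}"* for the Hölder derivative of order `1 + α`. [cite: BalabanImbrieJaffe1988, (2.5) p.260] -/
theorem holder_prodRule_comp {s A₁ A₂ M Mh δ α : ℝ} (hs : 0 < s) (hA₁ : 0 ≤ A₁) (hA₂ : 0 ≤ A₂) (hM : 0 ≤ M) (hδ : 0 ≤ δ)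
    (hα1 : α ≤ 1) {Z G E : TSite P 0 → ℝ} {x x' : TSite P 0}
    (hZ1 : ∀ z, |Z z| ≤ 1) (hZd : ∀ z κ, |Z (z.shift κ) - Z z| ≤ A₁ / s)
    (hZdd : ∀ z κ lam, |Z ((z.shift lam).shift κ) - Z (z.shift lam) - Z (z.shift κ) + Z z| ≤ A₂ / s ^ 2)
    (hG0 : ∀ z, |G z| ≤ M * Real.exp (-(δ * E z)))
    (hG1 : ∀ z κ, |s * (G (z.shift κ) - G z)| ≤ M * Real.exp (-(δ * E z)))
    (hE : ∀ z, E x ≤ E z + (supDist x z : ℝ) / s)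
    (hne : x ≠ x') (hr : (supDist x x' : ℝ) / s ≤ 1) (lam : Fin P.d)
    (hGh : |s * (G (x.shift lam) - G x) - s * (G (x'.shift lam) - G x')| ≤
      Mh * ((supDist x x' : ℝ) / s) ^ α * Real.exp (-(δ * E x))) :
    |s * (Z (x.shift lam) * G (x.shift lam) - Z x * G x) - s * (Z (x'.shift lam) * G (x'.shift lam) - Z x' * G x')| ≤
      holderConst P.d Mh M A₁ A₂ δ * ((supDist x x' : ℝ) / s) ^ α * Real.exp (-(δ * E x)) := by
  set r : ℝ := (supDist x x' : ℝ) / s with hrdef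
  set e : ℝ := Real.exp (-(δ * E x)) with hedef
  have he : 0 < e := Real.exp_pos _
  have hr0 : 0 < r := by
    refine div_pos ?_ hs
    have h1 : supDist x x' ≠ 0 := fun h0 => hne ((supDist_eq_zero_iff x x').mp h0)
    exact_mod_cast Nat.pos_of_ne_zero h1
  have hsr : (supDist x x' : ℝ) = r * s := by rw [hrdef, div_mul_cancel₀ _ hs.ne']
  have hrα : r ≤ r ^ α := by
    calc r = r ^ (1 : ℝ) := (Real.rpow_one r).symm
      _ ≤ r ^ α := Real.rpow_le_rpow_of_exponent_ge hr0 hr hα1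
  have hrα0 : 0 ≤ r ^ α := Real.rpow_nonneg hr0.le α
  have hMh : 0 ≤ Mh := by
    have h0 : 0 ≤ Mh * r ^ α * e := (abs_nonneg _).trans hGh
    by_contra hneg
    rw [not_le] at hneg
    have hrαp : 0 < r ^ α := Real.rpow_pos_of_pos hr0 α
    nlinarith [mul_pos (mul_pos (neg_pos.2 hneg) hrαp) he]
  have htd : (x'.tdist x : ℝ) ≤ (P.d : ℝ) * (r * s) := hsr ▸ tdist_le_d_supDist x x'
  -- weights at `x′` and along the path from `x′` to `x`
  have hEx' : E x ≤ E x' + 1 := by have := hE x'; linarith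
  have hex' : Real.exp (-(δ * E x')) ≤ Real.exp δ * e := by
    have := exp_le_exp_mul (T := 1) hδ hEx'; rwa [mul_one] at this
  -- T1: the Hölder member of `G`
  -- T2: `|Z(x+e) − Z(x′+e)| ≤ dA₁r`, `|∇G(x′)| ≤ Me^δ e`
  have hT2a : |Z (x.shift lam) - Z (x'.shift lam)| ≤ (P.d : ℝ) * A₁ * r := by
    have h := norm_sub_le_tdist (P := P) (j := 0) (V := ℝ) zero_lt_one Z (Pb := A₁ / s) (fun z μ => by
      rw [pdiff, inv_one, one_smul, Real.norm_eq_abs]; exact hZd z μ) (x'.shift lam) (x.shift lam)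
    rw [Real.norm_eq_abs, one_mul] at h
    refine h.trans ?_
    have htd' : ((x'.shift lam).tdist (x.shift lam) : ℝ) ≤ (P.d : ℝ) * (r * s) := by
      have h1 := tdist_le_d_supDist (x.shift lam) (x'.shift lam)
      rwa [supDist_shift_shift, hsr] at h1
    calc ((x'.shift lam).tdist (x.shift lam) : ℝ) * (A₁ / s) ≤ (P.d : ℝ) * (r * s) * (A₁ / s) :=
          mul_le_mul_of_nonneg_right htd' (div_nonneg hA₁ hs.le)
      _ = (P.d : ℝ) * A₁ * r := by field_simp
  have hT2b : |s * (G (x'.shift lam) - G x')| ≤ M * (Real.exp δ * e) :=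
    (hG1 x' lam).trans (mul_le_mul_of_nonneg_left hex' hM)
  -- T3: `|∇Z(x)| ≤ A₁`, `|G(x) − G(x′)| ≤ d r M e^{δ(d+1)} e`
  have hT3a : |s * (Z (x.shift lam) - Z x)| ≤ A₁ := by
    rw [abs_mul, abs_of_pos hs]
    calc s * |Z (x.shift lam) - Z x| ≤ s * (A₁ / s) := mul_le_mul_of_nonneg_left (hZd x lam) hs.le
      _ = A₁ := mul_div_cancel₀ _ hs.ne'
  have hT3b : |G x - G x'| ≤ (P.d : ℝ) * r * M * Real.exp (δ * ((P.d : ℝ) + 1)) * e := by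
    have h := norm_sub_le_local (P := P) (j := 0) (V := ℝ) zero_lt_one G x' x
      (Pb := M / s * (Real.exp (δ * ((P.d : ℝ) + 1)) * e)) (fun z κ hz => by
        rw [pdiff, inv_one, one_smul, Real.norm_eq_abs]
        -- the path point `z` is within `(d + 1)s` fine steps of `x`
        have hz' : (supDist x z : ℝ) / s ≤ (P.d : ℝ) + 1 := by
          rw [div_le_iff₀ hs]
          have h1 : (supDist x z : ℝ) ≤ (supDist x x' : ℝ) + (supDist x' z : ℝ) := by exact_mod_cast supDist_triangle x x' z
          have h2 : (supDist x' z : ℝ) ≤ (z.tdist x' : ℝ) := by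
            rw [supDist_comm]; exact_mod_cast supDist_le_tdist z x'
          have h3 : (z.tdist x' : ℝ) ≤ (x'.tdist x : ℝ) := by exact_mod_cast hz
          have h4 : r * s ≤ 1 * s := mul_le_mul_of_nonneg_right hr hs.le
          nlinarith [htd, hsr]
        have hw : Real.exp (-(δ * E z)) ≤ Real.exp (δ * ((P.d : ℝ) + 1)) * e :=
          exp_le_exp_mul (Ex := E x) (T := (P.d : ℝ) + 1) hδ (by have := hE z; linarith)
        have hg := hG1 z κ
        rw [abs_mul, abs_of_pos hs] at hg
        rw [div_mul_eq_mul_div, le_div_iff₀ hs, mul_comm]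
        exact hg.trans (mul_le_mul_of_nonneg_left hw hM)) 
    rw [Real.norm_eq_abs, one_mul] at h
    refine h.trans ?_
    calc (x'.tdist x : ℝ) * (M / s * (Real.exp (δ * ((P.d : ℝ) + 1)) * e)) ≤
        (P.d : ℝ) * (r * s) * (M / s * (Real.exp (δ * ((P.d : ℝ) + 1)) * e)) :=
          mul_le_mul_of_nonneg_right htd (by positivity)
      _ = (P.d : ℝ) * r * M * Real.exp (δ * ((P.d : ℝ) + 1)) * e := by field_simp
  -- T4: `|∇Z(x) − ∇Z(x′)| ≤ dA₂r`, `|G(x′)| ≤ Me^δ e`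
  have hT4a : |s * (Z (x.shift lam) - Z x) - s * (Z (x'.shift lam) - Z x')| ≤ (P.d : ℝ) * A₂ * r := by
    rw [← mul_sub, abs_mul, abs_of_pos hs]
    have h := norm_sub_le_tdist (P := P) (j := 0) (V := ℝ) zero_lt_one (fun z => Z (z.shift lam) - Z z) (Pb := A₂ / s ^ 2)
      (fun z κ => by
        rw [pdiff, inv_one, one_smul, Real.norm_eq_abs, shift_comm z κ lam]
        have e1 : Z ((z.shift lam).shift κ) - Z (z.shift κ) - (Z (z.shift lam) - Z z) =
            Z ((z.shift lam).shift κ) - Z (z.shift lam) - Z (z.shift κ) + Z z := by ring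
        rw [e1]; exact hZdd z κ lam) x' x
    rw [Real.norm_eq_abs, one_mul] at h
    calc s * |Z (x.shift lam) - Z x - (Z (x'.shift lam) - Z x')| ≤ s * ((x'.tdist x : ℝ) * (A₂ / s ^ 2)) :=
          mul_le_mul_of_nonneg_left h hs.le
      _ ≤ s * ((P.d : ℝ) * (r * s) * (A₂ / s ^ 2)) :=
          mul_le_mul_of_nonneg_left (mul_le_mul_of_nonneg_right htd (by positivity)) hs.le
      _ = (P.d : ℝ) * A₂ * r := by field_simp
  have hT4b : |G x'| ≤ M * (Real.exp δ * e) := (hG0 x').trans (mul_le_mul_of_nonneg_left hex' hM)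
  have hmain := prodRule_bound (c := s) (hZ1 (x.shift lam)) hGh hT2a hT2b hT3a hT3b hT4a hT4b
  refine hmain.trans ?_
  -- collect: every term carries `r ≤ r^α` and `e`
  have hd0 : (0 : ℝ) ≤ P.d := Nat.cast_nonneg _
  have h2 : (P.d : ℝ) * A₁ * r * (M * (Real.exp δ * e)) ≤ (P.d : ℝ) * M * (A₁ * Real.exp δ) * r ^ α * e := by
    have : (P.d : ℝ) * A₁ * r * (M * (Real.exp δ * e)) = (P.d : ℝ) * M * (A₁ * Real.exp δ) * r * e := by ring
    rw [this]; gcongr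
  have h3 : A₁ * ((P.d : ℝ) * r * M * Real.exp (δ * ((P.d : ℝ) + 1)) * e) ≤
      (P.d : ℝ) * M * (A₁ * Real.exp (δ * ((P.d : ℝ) + 1))) * r ^ α * e := by
    have : A₁ * ((P.d : ℝ) * r * M * Real.exp (δ * ((P.d : ℝ) + 1)) * e) =
        (P.d : ℝ) * M * (A₁ * Real.exp (δ * ((P.d : ℝ) + 1))) * r * e := by ring
    rw [this]; gcongr
  have h4 : (P.d : ℝ) * A₂ * r * (M * (Real.exp δ * e)) ≤ (P.d : ℝ) * M * (A₂ * Real.exp δ) * r ^ α * e := by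
    have : (P.d : ℝ) * A₂ * r * (M * (Real.exp δ * e)) = (P.d : ℝ) * M * (A₂ * Real.exp δ) * r * e := by ring
    rw [this]; gcongr
  have hsum := add_le_add (add_le_add (add_le_add (le_refl (Mh * r ^ α * e)) h2) h3) h4
  refine hsum.trans (le_of_eq ?_)
  unfold holderConst
  ring

/-- **THE DERIVATIVE MEMBER OF A LOCALIZED COLUMN, one output component**: `|∇_λ(ZG)(x)| ≤ (1 + A₁)Me^{−δE(x)}` (`∇_λ(ZG)(x) = Z(x+e_λ)∇_λG(x) +
∇_λZ(x)G(x)`). [cite: BalabanImbrieJaffe1988, (2.5) p.260] -/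
theorem deriv_prodRule_comp {s A₁ M δ : ℝ} (hs : 0 < s) {Z G E : TSite P 0 → ℝ}
    (hZ1 : ∀ z, |Z z| ≤ 1) (hZd : ∀ z κ, |Z (z.shift κ) - Z z| ≤ A₁ / s)
    (hG0 : ∀ z, |G z| ≤ M * Real.exp (-(δ * E z))) (hG1 : ∀ z κ, |s * (G (z.shift κ) - G z)| ≤ M * Real.exp (-(δ * E z)))
    (x : TSite P 0) (lam : Fin P.d) :
    |s * (Z (x.shift lam) * G (x.shift lam) - Z x * G x)| ≤ (1 + A₁) * M * Real.exp (-(δ * E x)) := by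
  have e1 : s * (Z (x.shift lam) * G (x.shift lam) - Z x * G x) =
      Z (x.shift lam) * (s * (G (x.shift lam) - G x)) + s * (Z (x.shift lam) - Z x) * G x := by ring
  rw [e1]
  have hA : |s * (Z (x.shift lam) - Z x)| ≤ A₁ := by
    rw [abs_mul, abs_of_pos hs]
    calc s * |Z (x.shift lam) - Z x| ≤ s * (A₁ / s) := mul_le_mul_of_nonneg_left (hZd x lam) hs.le
      _ = A₁ := mul_div_cancel₀ _ hs.ne'
  have hA0 : 0 ≤ A₁ := (abs_nonneg _).trans hA
  refine (abs_add_le _ _).trans ?_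
  have h1 : |Z (x.shift lam) * (s * (G (x.shift lam) - G x))| ≤ M * Real.exp (-(δ * E x)) := by
    rw [abs_mul]
    calc |Z (x.shift lam)| * |s * (G (x.shift lam) - G x)| ≤ 1 * (M * Real.exp (-(δ * E x))) :=
        mul_le_mul (hZ1 _) (hG1 x lam) (abs_nonneg _) zero_le_one
      _ = _ := one_mul _
  have h2 : |s * (Z (x.shift lam) - Z x) * G x| ≤ A₁ * (M * Real.exp (-(δ * E x))) := by
    rw [abs_mul]; exact mul_le_mul hA (hG0 x) (abs_nonneg _) hA0
  calc _ ≤ M * Real.exp (-(δ * E x)) + A₁ * (M * Real.exp (-(δ * E x))) := add_le_add h1 h2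
    _ = (1 + A₁) * M * Real.exp (-(δ * E x)) := by ring

end ProductRule

/-! ## §6  THE DERIVATIVE AND HÖLDER MEMBERS OF (2.5) AND (2.7) FOR `H^Π_{j,loc} = ζ^Π_jH_j` ON THE TORI, from the three members of (I.7.2.2) -/

section Kernel

variable {P : Params}

/-- `0 < L^n`. [folklore] -/
private theorem cast_pow_L_pos'' (n : ℕ) : (0 : ℝ) < (P.L : ℝ) ^ n := pow_pos P.cast_L_pos n

/-- the (2.1)/(7.2.2) distance to a unit site is 1-Lipschitz in the fine site: `|x − y| ≤ |z − y| + |x − z|_∞/L^j`.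
[cite: BalabanImbrieJaffe1985, (7.2.2) p.325] -/
theorem distEU_le_distEU_add (j : ℕ) (x z : TSite P 0) (y : TSite P j) :
    distEU P j x y ≤ distEU P j z y + (supDist x z : ℝ) / (P.L : ℝ) ^ j := by
  unfold distEU
  rw [← add_div, add_comm]
  exact div_le_div_of_nonneg_right (by exact_mod_cast supDist_triangle x z (ctr j y)) (cast_pow_L_pos'' j).le

/-- `A₂ ≤ C² + C` when the annulus has width `R₀ − R₁ ≥ 1`. [folklore] -/
private theorem secondDiffConst_le {C R₁ R₀ : ℝ} (hC : 0 ≤ C) (hw : 1 ≤ R₀ - R₁) : secondDiffConst C R₁ R₀ ≤ C ^ 2 + C := by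
  unfold secondDiffConst
  have hw0 : 0 < R₀ - R₁ := by linarith
  have h1 : C / (R₀ - R₁) ≤ C := div_le_self hC hw
  have h2 : C / (R₀ - R₁) ^ 2 ≤ C := div_le_self hC (by nlinarith)
  have h3 : (C / (R₀ - R₁)) ^ 2 ≤ C ^ 2 := pow_le_pow_left₀ (div_nonneg hC hw0.le) h1 2
  linarith

/-- unpacking `r^{−α}X ≤ B` as `X ≤ B·r^α` (`r > 0`). [folklore] -/
private theorem le_mul_rpow_of {r α X B : ℝ} (hr : 0 < r) (h : r ^ (-α) * X ≤ B) : X ≤ B * r ^ α := by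
  have hrα : 0 < r ^ α := Real.rpow_pos_of_pos hr α
  have e : X = r ^ α * (r ^ (-α) * X) := by
    rw [← mul_assoc, ← Real.rpow_add hr, add_neg_cancel, Real.rpow_zero, one_mul]
  rw [e, mul_comm B]
  exact mul_le_mul_of_nonneg_left h hrα.le

/-- packing `X ≤ B·r^α` as `r^{−α}X ≤ B` (`r > 0`). [folklore] -/
private theorem rpow_neg_mul_le_of {r α X B : ℝ} (hr : 0 < r) (h : X ≤ B * r ^ α) : r ^ (-α) * X ≤ B := by
  have hrα : 0 < r ^ α := Real.rpow_pos_of_pos hr α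
  have hrn : 0 < r ^ (-α) := Real.rpow_pos_of_pos hr _
  calc r ^ (-α) * X ≤ r ^ (-α) * (B * r ^ α) := mul_le_mul_of_nonneg_left h hrn.le
    _ = B := by rw [Real.rpow_neg hr.le, mul_comm B, ← mul_assoc, inv_mul_cancel₀ hrα.ne', one_mul]

/-- **THE PRODUCT RULE OF §5 RUN ON ONE KERNEL COMPONENT — the Hölder member of (2.5) for `ζ^Π_jG` from the three members of (I.7.2.2)
for `G`**, stated POINTWISE IN THE TORUS AND THE SCALE so that the constants can be fed uniformly (§8): if `z ↦ G(z)` (a component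
`H_{j,μν}(·; y)`) obeys `|G(z)| + ‖λ ↦ ∇_λG(z)‖ ≤ Me^{−δ|z − y|}` for all `z` and `|x − x′|^{−α}‖λ ↦ ∇_λG(x) − ∇_λG(x′)‖ ≤ M_αe^{−δ|x − y|}`, then
`|x − x′|^{−α}‖λ ↦ ∇_λ(ζ^Π_jG)(x) − ∇_λ(ζ^Π_jG)(x′)‖ ≤ holderConst(d, M_α, M, C_σ, C_σ² + C_σ, δ)·e^{−δ|x − y|}` for all admissible radii
(`R₀ − R₁ ≥ 1`, `R₁L^j ≥ 1`, `R₀L^j ≤ (|T_η| − 3)/2`). [cite: BalabanImbrieJaffe1988, (2.5) p.260] -/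
theorem holder25_zetaPi_of_bounds {j : ℕ} {C δ M Mα α R₁ R₀ : ℝ} (hC0 : 0 ≤ C) (hC1 : ∀ u, |deriv Real.smoothTransition u| ≤ C)
    (hC2 : ∀ u, |deriv (deriv Real.smoothTransition) u| ≤ C) (hδ : 0 ≤ δ) (hM : 0 ≤ M) (hMα : 0 ≤ Mα) (hα1 : α ≤ 1)
    (hw1 : 1 ≤ R₀ - R₁) (hR1 : 1 ≤ R₁ * (P.L : ℝ) ^ j) (hR0 : R₀ * (P.L : ℝ) ^ j ≤ ((P.sitesPerDir 0 : ℝ) - 3) / 2)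
    {y : TSite P j} {G : TSite P 0 → ℝ}
    (hHB : ∀ z : TSite P 0, |G z| + ‖fun lam : Fin P.d => (P.L : ℝ) ^ j * (G (z.shift lam) - G z)‖ ≤ M * Real.exp (-(δ * distEU P j z y)))
    {x x' : TSite P 0} (hne : x ≠ x') (hr : (supDist x x' : ℝ) / (P.L : ℝ) ^ j ≤ 1)
    (hHol : ((supDist x x' : ℝ) / (P.L : ℝ) ^ j) ^ (-α) *
        ‖fun lam : Fin P.d => (P.L : ℝ) ^ j * (G (x.shift lam) - G x) - (P.L : ℝ) ^ j * (G (x'.shift lam) - G x')‖ ≤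
      Mα * Real.exp (-(δ * distEU P j x y))) :
    ((supDist x x' : ℝ) / (P.L : ℝ) ^ j) ^ (-α) *
        ‖fun lam : Fin P.d =>
          (P.L : ℝ) ^ j * (zetaPi R₁ R₀ j (x.shift lam) y * G (x.shift lam) - zetaPi R₁ R₀ j x y * G x) -
            (P.L : ℝ) ^ j * (zetaPi R₁ R₀ j (x'.shift lam) y * G (x'.shift lam) - zetaPi R₁ R₀ j x' y * G x')‖ ≤
      holderConst P.d Mα M C (C ^ 2 + C) δ * Real.exp (-(δ * distEU P j x y)) := by
  have hs := cast_pow_L_pos'' (P := P) j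
  have hR : R₁ < R₀ := by linarith
  have hr0 : 0 < (supDist x x' : ℝ) / (P.L : ℝ) ^ j := by
    refine div_pos ?_ hs
    have h1 : supDist x x' ≠ 0 := fun h0 => hne ((supDist_eq_zero_iff x x').mp h0)
    exact_mod_cast Nat.pos_of_ne_zero h1
  -- the kernel inputs, component by component
  have hG0 : ∀ z : TSite P 0, |G z| ≤ M * Real.exp (-(δ * distEU P j z y)) := fun z =>
    (le_add_of_nonneg_right (norm_nonneg _)).trans (hHB z)
  have hG1 : ∀ (z : TSite P 0) (κ : Fin P.d), |(P.L : ℝ) ^ j * (G (z.shift κ) - G z)| ≤ M * Real.exp (-(δ * distEU P j z y)) := by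
    intro z κ
    refine le_trans ?_ ((le_add_of_nonneg_left (abs_nonneg _)).trans (hHB z))
    have := norm_le_pi_norm (fun lam : Fin P.d => (P.L : ℝ) ^ j * (G (z.shift lam) - G z)) κ
    rwa [Real.norm_eq_abs] at this
  have hGh : ∀ lam : Fin P.d, |(P.L : ℝ) ^ j * (G (x.shift lam) - G x) - (P.L : ℝ) ^ j * (G (x'.shift lam) - G x')| ≤
      Mα * ((supDist x x' : ℝ) / (P.L : ℝ) ^ j) ^ α * Real.exp (-(δ * distEU P j x y)) := by
    intro lam
    have h' := le_mul_rpow_of hr0 hHol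
    refine le_trans ?_ (h'.trans (le_of_eq (by ring)))
    have := norm_le_pi_norm (fun lam : Fin P.d => (P.L : ℝ) ^ j * (G (x.shift lam) - G x) - (P.L : ℝ) ^ j * (G (x'.shift lam) - G x')) lam
    rwa [Real.norm_eq_abs] at this
  -- the cutoff inputs from §4
  have hZd : ∀ (z : TSite P 0) (κ : Fin P.d), |zetaPi R₁ R₀ j (z.shift κ) y - zetaPi R₁ R₀ j z y| ≤ C / (P.L : ℝ) ^ j :=
    fun z κ => (abs_zetaPi_shift_sub_le hC1 hR j z y κ).trans (div_le_div_of_nonneg_right (div_le_self hC0 hw1) hs.le)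
  have hZdd : ∀ (z : TSite P 0) (κ lam : Fin P.d), |zetaPi R₁ R₀ j ((z.shift lam).shift κ) y - zetaPi R₁ R₀ j (z.shift lam) y -
      zetaPi R₁ R₀ j (z.shift κ) y + zetaPi R₁ R₀ j z y| ≤ (C ^ 2 + C) / ((P.L : ℝ) ^ j) ^ 2 :=
    fun z κ lam => (abs_zetaPi_secondDiff_le hC1 hC2 hR j hR1 hR0 z y κ lam).trans
      (div_le_div_of_nonneg_right (secondDiffConst_le hC0 hw1) (by positivity))
  have hcomp := fun lam : Fin P.d =>
    holder_prodRule_comp (P := P) (Z := fun z => zetaPi R₁ R₀ j z y) (G := G) (E := fun z => distEU P j z y) hs hC0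
      (by positivity) hM hδ hα1 (fun z => abs_zetaPi_le_one R₁ R₀ j z y) hZd hZdd hG0 hG1
      (fun z => distEU_le_distEU_add j x z y) hne hr lam (hGh lam)
  refine rpow_neg_mul_le_of hr0 ?_
  rw [mul_assoc]
  refine (pi_norm_le_iff_of_nonneg (mul_nonneg (holderConst_nonneg P.d hMα hM hC0 (by positivity) δ) (by positivity))).2
    fun lam => ?_
  rw [Real.norm_eq_abs]
  have h := hcomp lam
  linarith [h]

/-- **The derivative member of (2.5) for `ζ^Π_jG`, pointwise in the torus and the scale**: `|G| + ‖∇G‖ ≤ Me^{−δ|· − y|}` gives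
`‖λ ↦ ∇_λ(ζ^Π_jG)(x)‖ ≤ (1 + C_σ)Me^{−δ|x − y|}` for `R₀ − R₁ ≥ 1`. [cite: BalabanImbrieJaffe1988, (2.5) p.260] -/
theorem deriv25_zetaPi_of_bounds {j : ℕ} {C δ M R₁ R₀ : ℝ} (hC0 : 0 ≤ C) (hC1 : ∀ u, |deriv Real.smoothTransition u| ≤ C)
    (hw1 : 1 ≤ R₀ - R₁) {y : TSite P j} {G : TSite P 0 → ℝ}
    (hHB : ∀ z : TSite P 0, |G z| + ‖fun lam : Fin P.d => (P.L : ℝ) ^ j * (G (z.shift lam) - G z)‖ ≤ M * Real.exp (-(δ * distEU P j z y)))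
    (x : TSite P 0) :
    ‖fun lam : Fin P.d => (P.L : ℝ) ^ j * (zetaPi R₁ R₀ j (x.shift lam) y * G (x.shift lam) - zetaPi R₁ R₀ j x y * G x)‖ ≤
      (1 + C) * M * Real.exp (-(δ * distEU P j x y)) := by
  have hs := cast_pow_L_pos'' (P := P) j
  have hR : R₁ < R₀ := by linarith
  have hM : 0 ≤ M := by
    have h := (add_nonneg (abs_nonneg _) (norm_nonneg _)).trans (hHB x)
    exact (mul_nonneg_iff_of_pos_right (Real.exp_pos _)).1 h
  have hG0 : ∀ z : TSite P 0, |G z| ≤ M * Real.exp (-(δ * distEU P j z y)) := fun z =>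
    (le_add_of_nonneg_right (norm_nonneg _)).trans (hHB z)
  have hG1 : ∀ (z : TSite P 0) (κ : Fin P.d), |(P.L : ℝ) ^ j * (G (z.shift κ) - G z)| ≤ M * Real.exp (-(δ * distEU P j z y)) := by
    intro z κ
    refine le_trans ?_ ((le_add_of_nonneg_left (abs_nonneg _)).trans (hHB z))
    have := norm_le_pi_norm (fun lam : Fin P.d => (P.L : ℝ) ^ j * (G (z.shift lam) - G z)) κ
    rwa [Real.norm_eq_abs] at this
  have hZd : ∀ (z : TSite P 0) (κ : Fin P.d), |zetaPi R₁ R₀ j (z.shift κ) y - zetaPi R₁ R₀ j z y| ≤ C / (P.L : ℝ) ^ j :=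
    fun z κ => (abs_zetaPi_shift_sub_le hC1 hR j z y κ).trans (div_le_div_of_nonneg_right (div_le_self hC0 hw1) hs.le)
  refine (pi_norm_le_iff_of_nonneg (by positivity)).2 fun lam => ?_
  rw [Real.norm_eq_abs]
  exact deriv_prodRule_comp (P := P) (Z := fun z => zetaPi R₁ R₀ j z y) (G := G) (E := fun z => distEU P j z y) hs
    (fun z => abs_zetaPi_le_one R₁ R₀ j z y) hZd hG0 hG1 x lam


/-- **THE HÖLDER MEMBER OF (2.5) FOR THE PRODUCT-FORM LOCALIZATION `ζ^Π_jH_j`, FROM THE THREE MEMBERS OF (I.7.2.2)** (r15's typed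
`KernelData.Ineq722` for p09's torus kernel family `H_{j,μν}(x; y)`, as extracted by p08's `exists_holderBounds_of_ineq722`), p. 260 *"Since ζ_k and
H_k have good decay properties, so does H_{k,loc} [see (I.7.2.2)]. Thus |H_{k,loc}(b,b′)| ≦ ce^{−c dist(b,b′)} (2.5) and the derivative and Hölder
derivative of order less than 2 also have exponential decay"*: for every exponent `0 ≤ α < 1` there are `δ > 0`, `M′ ≥ 0` (UNIFORM IN THE SCALE) with,
at every scale `j = lev i` and for all radii with `R₀ − R₁ ≥ 1`, `R₁L^j ≥ 1`, `R₀L^j ≤ (|T_η| − 3)/2`: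
`|x − x′|^{−α}·‖λ ↦ ∇_λ(ζ^Π_jH_{j,μν})(x; y) − ∇_λ(ζ^Π_jH_{j,μν})(x′; y)‖ ≤ M′e^{−δ|x − y|}` for `x ≠ x′`, `|x − x′| = |x − x′|_∞/L^j ≤ 1`
(`∇_λF(x) = L^j(F(x + ηe_λ) − F(x))`, `|x − y| = distEU`). [cite: BalabanImbrieJaffe1988, (2.5) p.260] -/
theorem holder25_zetaPi_of_ineq722 {lev : ℕ → ℕ} (hlev : ∀ i, lev i ≤ P.m + P.K) {a : ℝ} {BondU : ℕ → Type}
    {distEB : (i : ℕ) → TSite P 0 → BondU i → ℝ} {Cker : (i : ℕ) → Fin P.d → Fin P.d → TSite P (lev i) → TSite P (lev i) → ℝ}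
    {Dker : (i : ℕ) → TSite P 0 → BondU i → ℝ}
    (h722 : KernelData.Ineq722
      (fun i => torusKernelData P (lev i) (deltaAData (hlev i) a) (BondU i) (distEB i) (Cker i) (Dker i)))
    {α : ℝ} (hα0 : 0 ≤ α) (hα1 : α < 1) :
    ∃ δ M' : ℝ, 0 < δ ∧ 0 ≤ M' ∧ ∀ (i : ℕ) (R₁ R₀ : ℝ), 1 ≤ R₀ - R₁ → 1 ≤ R₁ * (P.L : ℝ) ^ lev i →
      R₀ * (P.L : ℝ) ^ lev i ≤ ((P.sitesPerDir 0 : ℝ) - 3) / 2 →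
      ∀ (μ ν : Fin P.d) (x x' : TSite P 0) (y : TSite P (lev i)), x ≠ x' → (supDist x x' : ℝ) / (P.L : ℝ) ^ lev i ≤ 1 →
        ((supDist x x' : ℝ) / (P.L : ℝ) ^ lev i) ^ (-α) *
          ‖fun lam : Fin P.d =>
            (P.L : ℝ) ^ lev i * (zetaPi R₁ R₀ (lev i) (x.shift lam) y * (torusRep P (lev i) (deltaAData (hlev i) a)).H (x.shift lam, μ) (y, ν) -
                zetaPi R₁ R₀ (lev i) x y * (torusRep P (lev i) (deltaAData (hlev i) a)).H (x, μ) (y, ν)) -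
            (P.L : ℝ) ^ lev i * (zetaPi R₁ R₀ (lev i) (x'.shift lam) y * (torusRep P (lev i) (deltaAData (hlev i) a)).H (x'.shift lam, μ) (y, ν) -
                zetaPi R₁ R₀ (lev i) x' y * (torusRep P (lev i) (deltaAData (hlev i) a)).H (x', μ) (y, ν))‖ ≤
          M' * Real.exp (-(δ * distEU P (lev i) x y)) := by
  obtain ⟨C, hC0, hC1, hC2⟩ := exists_abs_deriv_and_deriv_deriv_smoothTransition_le
  obtain ⟨δ, M, Mα, hδ, hM, hMα, key, keyα⟩ := exists_holderBounds_of_ineq722 hlev h722 hα0 hα1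
  refine ⟨δ, holderConst P.d Mα M C (C ^ 2 + C) δ, hδ, holderConst_nonneg P.d hMα hM hC0 (by positivity) δ,
    fun i R₁ R₀ hw1 hR1 hR0 μ ν x x' y hne hr => ?_⟩
  have hHB := fun z : TSite P 0 => key i μ ν z y
  simp only [torusKernelData_gradH] at hHB
  have hHol := keyα i μ ν x x' y hne hr
  rw [torusKernelData_gradHDiff] at hHol
  exact holder25_zetaPi_of_bounds hC0 hC1 hC2 hδ.le hM hMα hα1.le hw1 hR1 hR0
    (G := fun z => (torusRep P (lev i) (deltaAData (hlev i) a)).H (z, μ) (y, ν)) hHB hne hr hHol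

/-- **THE DERIVATIVE MEMBER OF (2.5) FOR `ζ^Π_jH_j`**: one `(δ, M′)` for all scales, all radii with `R₀ − R₁ ≥ 1`:
`‖λ ↦ ∇_λ(ζ^Π_jH_{j,μν})(x; y)‖ ≤ M′e^{−δ|x − y|}`. [cite: BalabanImbrieJaffe1988, (2.5) p.260] -/
theorem deriv25_zetaPi_of_ineq722 {lev : ℕ → ℕ} (hlev : ∀ i, lev i ≤ P.m + P.K) {a : ℝ} {BondU : ℕ → Type}
    {distEB : (i : ℕ) → TSite P 0 → BondU i → ℝ} {Cker : (i : ℕ) → Fin P.d → Fin P.d → TSite P (lev i) → TSite P (lev i) → ℝ}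
    {Dker : (i : ℕ) → TSite P 0 → BondU i → ℝ}
    (h722 : KernelData.Ineq722
      (fun i => torusKernelData P (lev i) (deltaAData (hlev i) a) (BondU i) (distEB i) (Cker i) (Dker i))) :
    ∃ δ M' : ℝ, 0 < δ ∧ 0 ≤ M' ∧ ∀ (i : ℕ) (R₁ R₀ : ℝ), 1 ≤ R₀ - R₁ →
      ∀ (μ ν : Fin P.d) (x : TSite P 0) (y : TSite P (lev i)),
        ‖fun lam : Fin P.d =>
            (P.L : ℝ) ^ lev i * (zetaPi R₁ R₀ (lev i) (x.shift lam) y * (torusRep P (lev i) (deltaAData (hlev i) a)).H (x.shift lam, μ) (y, ν) -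
                zetaPi R₁ R₀ (lev i) x y * (torusRep P (lev i) (deltaAData (hlev i) a)).H (x, μ) (y, ν))‖ ≤
          M' * Real.exp (-(δ * distEU P (lev i) x y)) := by
  obtain ⟨C, hC0, hC1, -⟩ := exists_abs_deriv_and_deriv_deriv_smoothTransition_le
  obtain ⟨δ, M, Mα, hδ, hM, -, key, -⟩ := exists_holderBounds_of_ineq722 hlev h722 le_rfl zero_lt_one
  refine ⟨δ, (1 + C) * M, hδ, by positivity, fun i R₁ R₀ hw1 μ ν x y => ?_⟩
  have hHB := fun z : TSite P 0 => key i μ ν z y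
  simp only [torusKernelData_gradH] at hHB
  exact deriv25_zetaPi_of_bounds hC0 hC1 hw1 (G := fun z => (torusRep P (lev i) (deltaAData (hlev i) a)).H (z, μ) (y, ν)) hHB x

/-! ### (2.7): the same for `H^Π_{j,loc} − H_j = (ζ^Π_j − 1)H_j`, with the small factor `e^{−(δ/2)(R₁ − 2)}` -/

/-- `cdist 1 ≤ 1`. [folklore] -/
private theorem cdist_one_le' {n : ℕ} [NeZero n] : cdist (1 : ZMod n) ≤ 1 :=
  (Balaban1983to89.B3TorusRadialSums.cdist_le_val _).trans (by rw [ZMod.val_one_eq_one_mod]; exact Nat.mod_le 1 n)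

/-- `|x + e_λ − x|_∞ ≤ 1`. [folklore] -/
private theorem supDist_shift_self_le (x : TSite P 0) (lam : Fin P.d) : supDist (x.shift lam) x ≤ 1 := by
  rw [supDist_eq_sup_cdist]
  refine Finset.sup_le fun μ _ => ?_
  by_cases h : μ = lam
  · subst h
    have e : x.shift μ μ - x μ = 1 := by simp only [Balaban1983to89.Site.shift, Function.update_self]; ring
    rw [e]; exact cdist_one_le'
  · rw [shift_ne x h, sub_self]
    simp [Balaban1983to89.B3TorusRadialSums.cdist]

/-- `ζ^Π_j(z, y) = 1` for `|z − y| ≤ R₁` (site form of `isCutoff_zetaPiB`). [cite: BalabanImbrieJaffe1988, (2.1) p.260] -/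
theorem zetaPi_eq_one_of_le {R₁ R₀ : ℝ} (hR : R₁ < R₀) {j : ℕ} {z : TSite P 0} {y : TSite P j} (h : distEU P j z y ≤ R₁) :
    zetaPi R₁ R₀ j z y = 1 :=
  (isCutoff_zetaPiB (P := P) hR j).1 ⟨z, ⟨0, P.hd⟩⟩ ⟨y, ⟨0, P.hd⟩⟩ h

/-- the exponential bookkeeping of (2.7): beyond `R₁ − 2`, `e^{−δD} ≤ e^{−(δ/2)(R₁−2)}·e^{−(δ/2)D}`. [folklore] -/
private theorem exp_split_le {δ D R₁ : ℝ} (hδ : 0 ≤ δ) (hD : R₁ - 2 ≤ D) :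
    Real.exp (-(δ * D)) ≤ Real.exp (-(δ / 2 * (R₁ - 2))) * Real.exp (-(δ / 2 * D)) := by
  rw [← Real.exp_add]
  exact Real.exp_le_exp.2 (by nlinarith)

/-- **The Hölder member of (2.7) for `(ζ^Π_j − 1)G`, pointwise in the torus and the scale** (inputs as in `holder25_zetaPi_of_bounds`):
`|x − x′|^{−α}‖λ ↦ ∇_λ(ζ^Π_jG − G)(x) − ∇_λ(ζ^Π_jG − G)(x′)‖ ≤ holderConst(…)·e^{−(δ/2)(R₁ − 2)}·e^{−(δ/2)|x − y|}` — zero when `|x − y| + 2 ≤ R₁`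
(all four points inside the `ζ^Π = 1` region), the (2.5)-type bound with the split `e^{−δD} ≤ e^{−(δ/2)(R₁−2)}e^{−(δ/2)D}` beyond.
[cite: BalabanImbrieJaffe1988, (2.7) p.260] -/
theorem holder27_zetaPi_of_bounds {j : ℕ} {C δ M Mα α R₁ R₀ : ℝ} (hC0 : 0 ≤ C) (hC1 : ∀ u, |deriv Real.smoothTransition u| ≤ C)
    (hC2 : ∀ u, |deriv (deriv Real.smoothTransition) u| ≤ C) (hδ : 0 ≤ δ) (hM : 0 ≤ M) (hMα : 0 ≤ Mα) (hα1 : α ≤ 1)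
    (hw1 : 1 ≤ R₀ - R₁) (hR1 : 1 ≤ R₁ * (P.L : ℝ) ^ j) (hR0 : R₀ * (P.L : ℝ) ^ j ≤ ((P.sitesPerDir 0 : ℝ) - 3) / 2)
    {y : TSite P j} {G : TSite P 0 → ℝ}
    (hHB : ∀ z : TSite P 0, |G z| + ‖fun lam : Fin P.d => (P.L : ℝ) ^ j * (G (z.shift lam) - G z)‖ ≤ M * Real.exp (-(δ * distEU P j z y)))
    {x x' : TSite P 0} (hne : x ≠ x') (hr : (supDist x x' : ℝ) / (P.L : ℝ) ^ j ≤ 1)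
    (hHol : ((supDist x x' : ℝ) / (P.L : ℝ) ^ j) ^ (-α) *
        ‖fun lam : Fin P.d => (P.L : ℝ) ^ j * (G (x.shift lam) - G x) - (P.L : ℝ) ^ j * (G (x'.shift lam) - G x')‖ ≤
      Mα * Real.exp (-(δ * distEU P j x y))) :
    ((supDist x x' : ℝ) / (P.L : ℝ) ^ j) ^ (-α) *
        ‖fun lam : Fin P.d =>
          ((P.L : ℝ) ^ j * (zetaPi R₁ R₀ j (x.shift lam) y * G (x.shift lam) - zetaPi R₁ R₀ j x y * G x) -
              (P.L : ℝ) ^ j * (G (x.shift lam) - G x)) -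
            ((P.L : ℝ) ^ j * (zetaPi R₁ R₀ j (x'.shift lam) y * G (x'.shift lam) - zetaPi R₁ R₀ j x' y * G x') -
              (P.L : ℝ) ^ j * (G (x'.shift lam) - G x'))‖ ≤
      holderConst P.d Mα M C (C ^ 2 + C) δ * Real.exp (-(δ / 2 * (R₁ - 2))) * Real.exp (-(δ / 2 * distEU P j x y)) := by
  have hs := cast_pow_L_pos'' (P := P) j
  have hR : R₁ < R₀ := by linarith
  have hK0 := holderConst_nonneg P.d hMα hM hC0 (by positivity : (0:ℝ) ≤ C ^ 2 + C) δ
  set K := holderConst P.d Mα M C (C ^ 2 + C) δ with hK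
  have hr0 : 0 < (supDist x x' : ℝ) / (P.L : ℝ) ^ j := by
    refine div_pos ?_ hs
    have h1 : supDist x x' ≠ 0 := fun h0 => hne ((supDist_eq_zero_iff x x').mp h0)
    exact_mod_cast Nat.pos_of_ne_zero h1
  -- the component identity: `((ζ−1)H)`-gradient differences = the printed `∇(ζH) − ∇H` differences
  have ecomp : ∀ lam : Fin P.d,
      ((P.L : ℝ) ^ j * (zetaPi R₁ R₀ j (x.shift lam) y * G (x.shift lam) - zetaPi R₁ R₀ j x y * G x) -
          (P.L : ℝ) ^ j * (G (x.shift lam) - G x)) -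
        ((P.L : ℝ) ^ j * (zetaPi R₁ R₀ j (x'.shift lam) y * G (x'.shift lam) - zetaPi R₁ R₀ j x' y * G x') -
          (P.L : ℝ) ^ j * (G (x'.shift lam) - G x')) =
      (P.L : ℝ) ^ j * ((zetaPi R₁ R₀ j (x.shift lam) y - 1) * G (x.shift lam) -
          (zetaPi R₁ R₀ j x y - 1) * G x) -
        (P.L : ℝ) ^ j * ((zetaPi R₁ R₀ j (x'.shift lam) y - 1) * G (x'.shift lam) -
          (zetaPi R₁ R₀ j x' y - 1) * G x') := fun lam => by ring
  by_cases hnear : distEU P j x y + 2 ≤ R₁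
  · -- all four points are within `R₁`: the difference vanishes
    have hL1 : 1 / (P.L : ℝ) ^ j ≤ 1 := by
      rw [div_le_one hs]; exact one_le_pow₀ (by exact_mod_cast P.L_pos)
    have hsh : ∀ z : TSite P 0, ∀ lam : Fin P.d, distEU P j (z.shift lam) y ≤ distEU P j z y + 1 := by
      intro z lam
      have h1 := distEU_le_distEU_add j (z.shift lam) z y
      have h2 : (supDist (z.shift lam) z : ℝ) / (P.L : ℝ) ^ j ≤ 1 / (P.L : ℝ) ^ j :=
        div_le_div_of_nonneg_right (by exact_mod_cast supDist_shift_self_le z lam) hs.le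
      linarith
    have hx' : distEU P j x' y ≤ distEU P j x y + 1 := by
      have h1 := distEU_le_distEU_add j x' x y
      rw [supDist_comm] at h1
      linarith
    have z1 : zetaPi R₁ R₀ j x y = 1 := zetaPi_eq_one_of_le hR (by linarith)
    have z2 : zetaPi R₁ R₀ j x' y = 1 := zetaPi_eq_one_of_le hR (by linarith)
    have z3 : ∀ lam : Fin P.d, zetaPi R₁ R₀ j (x.shift lam) y = 1 := fun lam =>
      zetaPi_eq_one_of_le hR (by linarith [hsh x lam])
    have z4 : ∀ lam : Fin P.d, zetaPi R₁ R₀ j (x'.shift lam) y = 1 := fun lam =>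
      zetaPi_eq_one_of_le hR (by linarith [hsh x' lam])
    have hv : (fun lam : Fin P.d =>
        ((P.L : ℝ) ^ j * (zetaPi R₁ R₀ j (x.shift lam) y * G (x.shift lam) - zetaPi R₁ R₀ j x y * G x) -
            (P.L : ℝ) ^ j * (G (x.shift lam) - G x)) -
          ((P.L : ℝ) ^ j * (zetaPi R₁ R₀ j (x'.shift lam) y * G (x'.shift lam) -
              zetaPi R₁ R₀ j x' y * G x') -
            (P.L : ℝ) ^ j * (G (x'.shift lam) - G x'))) = 0 := by
      funext lam
      rw [z1, z2, z3 lam, z4 lam]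
      simp only [Pi.zero_apply]; ring
    rw [hv, norm_zero, mul_zero]
    positivity
  · -- beyond `R₁ − 2`: the (2.5)-type bound for the cutoff `ζ^Π − 1`, exponential split
    rw [not_le] at hnear
    have hG0 : ∀ z : TSite P 0, |G z| ≤ M * Real.exp (-(δ * distEU P j z y)) := fun z =>
      (le_add_of_nonneg_right (norm_nonneg _)).trans (hHB z)
    have hG1 : ∀ (z : TSite P 0) (κ : Fin P.d), |(P.L : ℝ) ^ j * (G (z.shift κ) - G z)| ≤
        M * Real.exp (-(δ * distEU P j z y)) := by
      intro z κ
      refine le_trans ?_ ((le_add_of_nonneg_left (abs_nonneg _)).trans (hHB z))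
      have := norm_le_pi_norm (fun lam : Fin P.d => (P.L : ℝ) ^ j * (G (z.shift lam) - G z)) κ
      rwa [Real.norm_eq_abs] at this
    have hGh : ∀ lam : Fin P.d, |(P.L : ℝ) ^ j * (G (x.shift lam) - G x) -
        (P.L : ℝ) ^ j * (G (x'.shift lam) - G x')| ≤
        Mα * ((supDist x x' : ℝ) / (P.L : ℝ) ^ j) ^ α * Real.exp (-(δ * distEU P j x y)) := by
      intro lam
      have h' := le_mul_rpow_of hr0 hHol
      refine le_trans ?_ (h'.trans (le_of_eq (by ring)))
      have := norm_le_pi_norm (fun lam : Fin P.d => (P.L : ℝ) ^ j * (G (x.shift lam) - G x) -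
        (P.L : ℝ) ^ j * (G (x'.shift lam) - G x')) lam
      rwa [Real.norm_eq_abs] at this
    have hZd : ∀ (z : TSite P 0) (κ : Fin P.d),
        |(zetaPi R₁ R₀ j (z.shift κ) y - 1) - (zetaPi R₁ R₀ j z y - 1)| ≤ C / (P.L : ℝ) ^ j := by
      intro z κ
      rw [sub_sub_sub_cancel_right]
      exact (abs_zetaPi_shift_sub_le hC1 hR j z y κ).trans (div_le_div_of_nonneg_right (div_le_self hC0 hw1) hs.le)
    have hZdd : ∀ (z : TSite P 0) (κ lam : Fin P.d), |(zetaPi R₁ R₀ j ((z.shift lam).shift κ) y - 1) -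
        (zetaPi R₁ R₀ j (z.shift lam) y - 1) - (zetaPi R₁ R₀ j (z.shift κ) y - 1) + (zetaPi R₁ R₀ j z y - 1)| ≤
        (C ^ 2 + C) / ((P.L : ℝ) ^ j) ^ 2 := by
      intro z κ lam
      have e : (zetaPi R₁ R₀ j ((z.shift lam).shift κ) y - 1) - (zetaPi R₁ R₀ j (z.shift lam) y - 1) -
          (zetaPi R₁ R₀ j (z.shift κ) y - 1) + (zetaPi R₁ R₀ j z y - 1) =
          zetaPi R₁ R₀ j ((z.shift lam).shift κ) y - zetaPi R₁ R₀ j (z.shift lam) y -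
            zetaPi R₁ R₀ j (z.shift κ) y + zetaPi R₁ R₀ j z y := by ring
      rw [e]
      exact (abs_zetaPi_secondDiff_le hC1 hC2 hR j hR1 hR0 z y κ lam).trans
        (div_le_div_of_nonneg_right (secondDiffConst_le hC0 hw1) (by positivity))
    have hcomp := fun lam : Fin P.d =>
      holder_prodRule_comp (P := P) (Z := fun z => zetaPi R₁ R₀ j z y - 1) (G := fun z => G z)
        (E := fun z => distEU P j z y) hs hC0 (by positivity) hM hδ hα1
        (fun z => abs_zetaPi_sub_one_le_one R₁ R₀ j z y) hZd hZdd hG0 hG1 (fun z => distEU_le_distEU_add j x z y)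
        hne hr lam (hGh lam)
    have hexp := exp_split_le (R₁ := R₁) (D := distEU P j x y) hδ (by linarith)
    refine rpow_neg_mul_le_of hr0 ?_
    refine (pi_norm_le_iff_of_nonneg (by positivity)).2 fun lam => ?_
    rw [Real.norm_eq_abs, ecomp lam]
    refine (hcomp lam).trans ?_
    have hrα : 0 ≤ ((supDist x x' : ℝ) / (P.L : ℝ) ^ j) ^ α := Real.rpow_nonneg hr0.le α
    calc K * ((supDist x x' : ℝ) / (P.L : ℝ) ^ j) ^ α * Real.exp (-(δ * distEU P j x y))
        ≤ K * ((supDist x x' : ℝ) / (P.L : ℝ) ^ j) ^ α *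
          (Real.exp (-(δ / 2 * (R₁ - 2))) * Real.exp (-(δ / 2 * distEU P j x y))) :=
          mul_le_mul_of_nonneg_left hexp (mul_nonneg hK0 hrα)
      _ = _ := by ring


/-- **THE HÖLDER MEMBER OF (2.7) FOR THE PRODUCT-FORM LOCALIZATION**, p. 260 *"Furthermore, H_{k,loc} − H_k is small: |H_{k,loc}(b,b′) −
H_k(b,b′)| ≦ e^{−cr(e_k)}e^{−c dist(b,b′)} (2.7)"* together with (2.5)'s *"the derivative and Hölder derivative of order less than 2"*: for every
`0 ≤ α < 1`, one `δ > 0`, `M′ ≥ 0` for all scales `j = lev i` and all admissible radii (`R₀ − R₁ ≥ 1`, `R₁L^j ≥ 1`, `R₀L^j ≤ (|T_η| − 3)/2`):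
`|x − x′|^{−α}·‖λ ↦ (∇_λ(ζ^Π_jH_{j,μν}) − ∇_λH_{j,μν})(x; y) − (∇_λ(ζ^Π_jH_{j,μν}) − ∇_λH_{j,μν})(x′; y)‖ ≤ M′e^{−(δ/2)(R₁ − 2)}·e^{−(δ/2)|x − y|}`
(`x ≠ x′`, `|x − x′| ≤ 1`) — inside `R₁ − 2` the difference VANISHES (all four points `x, x + ηe_λ, x′, x′ + ηe_λ` lie within `R₁`), outside
the (2.5)-bound for the cutoff `ζ^Π − 1` splits its exponential; at print's `R₁ = r(e_k)/16` the prefactor is `e^{δ}·e^{−(δ/32)r(e_k)}`.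
[cite: BalabanImbrieJaffe1988, (2.7) p.260] -/
theorem holder27_zetaPi_of_ineq722 {lev : ℕ → ℕ} (hlev : ∀ i, lev i ≤ P.m + P.K) {a : ℝ} {BondU : ℕ → Type}
    {distEB : (i : ℕ) → TSite P 0 → BondU i → ℝ} {Cker : (i : ℕ) → Fin P.d → Fin P.d → TSite P (lev i) → TSite P (lev i) → ℝ}
    {Dker : (i : ℕ) → TSite P 0 → BondU i → ℝ}
    (h722 : KernelData.Ineq722
      (fun i => torusKernelData P (lev i) (deltaAData (hlev i) a) (BondU i) (distEB i) (Cker i) (Dker i)))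
    {α : ℝ} (hα0 : 0 ≤ α) (hα1 : α < 1) :
    ∃ δ M' : ℝ, 0 < δ ∧ 0 ≤ M' ∧ ∀ (i : ℕ) (R₁ R₀ : ℝ), 1 ≤ R₀ - R₁ → 1 ≤ R₁ * (P.L : ℝ) ^ lev i →
      R₀ * (P.L : ℝ) ^ lev i ≤ ((P.sitesPerDir 0 : ℝ) - 3) / 2 →
      ∀ (μ ν : Fin P.d) (x x' : TSite P 0) (y : TSite P (lev i)), x ≠ x' → (supDist x x' : ℝ) / (P.L : ℝ) ^ lev i ≤ 1 →
        ((supDist x x' : ℝ) / (P.L : ℝ) ^ lev i) ^ (-α) *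
          ‖fun lam : Fin P.d =>
            ((P.L : ℝ) ^ lev i * (zetaPi R₁ R₀ (lev i) (x.shift lam) y * (torusRep P (lev i) (deltaAData (hlev i) a)).H (x.shift lam, μ) (y, ν) -
                zetaPi R₁ R₀ (lev i) x y * (torusRep P (lev i) (deltaAData (hlev i) a)).H (x, μ) (y, ν)) -
              (P.L : ℝ) ^ lev i * ((torusRep P (lev i) (deltaAData (hlev i) a)).H (x.shift lam, μ) (y, ν) -
                (torusRep P (lev i) (deltaAData (hlev i) a)).H (x, μ) (y, ν))) -
            ((P.L : ℝ) ^ lev i * (zetaPi R₁ R₀ (lev i) (x'.shift lam) y * (torusRep P (lev i) (deltaAData (hlev i) a)).H (x'.shift lam, μ) (y, ν) -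
                zetaPi R₁ R₀ (lev i) x' y * (torusRep P (lev i) (deltaAData (hlev i) a)).H (x', μ) (y, ν)) -
              (P.L : ℝ) ^ lev i * ((torusRep P (lev i) (deltaAData (hlev i) a)).H (x'.shift lam, μ) (y, ν) -
                (torusRep P (lev i) (deltaAData (hlev i) a)).H (x', μ) (y, ν)))‖ ≤
          M' * Real.exp (-(δ / 2 * (R₁ - 2))) * Real.exp (-(δ / 2 * distEU P (lev i) x y)) := by
  obtain ⟨C, hC0, hC1, hC2⟩ := exists_abs_deriv_and_deriv_deriv_smoothTransition_le
  obtain ⟨δ, M, Mα, hδ, hM, hMα, key, keyα⟩ := exists_holderBounds_of_ineq722 hlev h722 hα0 hα1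
  refine ⟨δ, holderConst P.d Mα M C (C ^ 2 + C) δ, hδ, holderConst_nonneg P.d hMα hM hC0 (by positivity) δ,
    fun i R₁ R₀ hw1 hR1 hR0 μ ν x x' y hne hr => ?_⟩
  have hHB := fun z : TSite P 0 => key i μ ν z y
  simp only [torusKernelData_gradH] at hHB
  have hHol := keyα i μ ν x x' y hne hr
  rw [torusKernelData_gradHDiff] at hHol
  exact holder27_zetaPi_of_bounds hC0 hC1 hC2 hδ.le hM hMα hα1.le hw1 hR1 hR0
    (G := fun z => (torusRep P (lev i) (deltaAData (hlev i) a)).H (z, μ) (y, ν)) hHB hne hr hHol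

end Kernel

/-! ## §7  (2.4) WITH THE SMOOTH CUTOFF: `H^Π_{j,loc} := ζ^Π_j·H_j` for the `H_j` of record (`BIJ88CurlyDkLocTorus.hKer`); the sup members of
(2.5)/(2.6)/(2.7) by p08's `eq25_26_27_HkE_torus_unscaled`; the derivative and Hölder members in this vocabulary; everything given only the
typed (7.2.2), and HYPOTHESIS-FREE on every torus by p19's `BIJ85Prop12AllTori.ineq722_deltaA_printed` -/

section Loc

variable {P : Params}

/-- `0 < L^n`. [folklore] -/
private theorem cast_pow_L_pos''' (n : ℕ) : (0 : ℝ) < (P.L : ℝ) ^ n := pow_pos P.cast_L_pos n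

/-- **(2.4) WITH PRINT'S SMOOTH-IN-`b` CUTOFF**: `H^Π_{j,loc}(b, b₁) := ζ^Π_j(b, b₁)·H_j(b, b₁)` — r18's `loc` of the product-form cutoff and the Landau
kernel of record `hKer w c j` (p11's `HkE`); the twin of the object of record `BIJ88CurlyDkLocTorus.hlKer` (same `H_j`, same 0/1 regions of the
cutoff, smooth instead of Lipschitz in between). [cite: BalabanImbrieJaffe1988, (2.4) p.260] -/
def hlKerPi (w c R₁ R₀ : ℝ) (j : ℕ) : PBond P 0 → PBond P j → ℝ := loc (zetaPiB R₁ R₀ j) (hKer w c j)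

/-- unfolding (2.4). [cite: BalabanImbrieJaffe1988, (2.4) p.260] -/
theorem hlKerPi_apply (w c R₁ R₀ : ℝ) (j : ℕ) (b : PBond P 0) (b₁ : PBond P j) :
    hlKerPi (P := P) w c R₁ R₀ j b b₁ = zetaPi R₁ R₀ j b.src b₁.src * hKer w c j b b₁ := rfl

/-- the kernel of record IS p09's `H_{j,μν}(x; y)` (p08's `ofLp_HkE_single`; any `a > 0`: the Landau minimizer does not see the mass).
[cite: BalabanImbrieJaffe1985, (7.2.1) p.325] -/
theorem hKer_eq_H {j : ℕ} (hj : j ≤ P.m + P.K) {w c a : ℝ} (hw : 0 < w) (hc : c ≠ 0) (ha : 0 < a) (z : TSite P 0) (μ : Fin P.d)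
    (b₁ : PBond P j) : hKer (P := P) w c j ⟨z, μ⟩ b₁ = (torusRep P j (deltaAData hj a)).H (z, μ) (b₁.src, b₁.dir) :=
  ofLp_HkE_single hj hc hw ha b₁ z μ

/-- hence (2.4) with the smooth cutoff reads `H^Π_{j,loc}(⟨z,μ⟩, ⟨y,ν⟩) = ζ^Π_j(z, y)·H_{j,μν}(z; y)`. [cite: BalabanImbrieJaffe1988, (2.4) p.260] -/
theorem hlKerPi_eq_H {j : ℕ} (hj : j ≤ P.m + P.K) {w c a : ℝ} (hw : 0 < w) (hc : c ≠ 0) (ha : 0 < a) (R₁ R₀ : ℝ) (z : TSite P 0)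
    (μ : Fin P.d) (b₁ : PBond P j) :
    hlKerPi (P := P) w c R₁ R₀ j ⟨z, μ⟩ b₁ = zetaPi R₁ R₀ j z b₁.src * (torusRep P j (deltaAData hj a)).H (z, μ) (b₁.src, b₁.dir) := by
  rw [hlKerPi_apply, hKer_eq_H hj hw hc ha]

/-- **(2.5) sup member, (2.6), (2.7) sup member FOR `H^Π_{j,loc}`, given the typed (7.2.2)** — p08's `eq25_26_27_HkE_torus_unscaled` (ANY
`IsCutoff`) instantiated at the product cutoff (`isCutoff_zetaPiB`, `zetaPiB_mem_Icc`): one `(δ, M)` for all scales and radii `R₁ < R₀`: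
`|H^Π_{j,loc}(b, b₁)| ≤ Me^{−δ dist(b,b₁)}`, `H^Π_{j,loc}(b, b₁) = 0` for `dist ≥ R₀`, `|H^Π_{j,loc} − H_j|(b, b₁) ≤ Me^{−(δ/2)R₁}e^{−(δ/2)dist(b,b₁)}`.
[cite: BalabanImbrieJaffe1988, (2.5)–(2.7) p.260] -/
theorem eq25_26_27_hlKerPi_of_ineq722 {lev : ℕ → ℕ} (hlev : ∀ i, lev i ≤ P.m + P.K) {a : ℝ} (ha : 0 < a) {BondU : ℕ → Type}
    {distEB : (i : ℕ) → TSite P 0 → BondU i → ℝ} {Cker : (i : ℕ) → Fin P.d → Fin P.d → TSite P (lev i) → TSite P (lev i) → ℝ}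
    {Dker : (i : ℕ) → TSite P 0 → BondU i → ℝ}
    (h722 : KernelData.Ineq722
      (fun i => torusKernelData P (lev i) (deltaAData (hlev i) a) (BondU i) (distEB i) (Cker i) (Dker i))) :
    ∃ δ M : ℝ, 0 < δ ∧ 0 ≤ M ∧ ∀ (i : ℕ) (c : ℝ), c ≠ 0 → ∀ (w : ℝ), 0 < w → ∀ (R₁ R₀ : ℝ), R₁ < R₀ →
      (∀ (b : PBond P 0) (b₁ : PBond P (lev i)),
          |hlKerPi (P := P) w c R₁ R₀ (lev i) b b₁| ≤ M * Real.exp (-(δ * distEU P (lev i) b.src b₁.src))) ∧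
        Vanishes (hdist (P := P) (lev i)) (hlKerPi (P := P) w c R₁ R₀ (lev i)) R₀ ∧
        Close (hdist (P := P) (lev i)) (hlKerPi (P := P) w c R₁ R₀ (lev i)) (hKer w c (lev i)) (M * Real.exp (-(δ / 2) * R₁)) (δ / 2) := by
  obtain ⟨δ, M, hδ, hM, h⟩ := eq25_26_27_HkE_torus_unscaled hlev ha h722
  refine ⟨δ, M, hδ, hM, fun i c hc w hw R₁ R₀ hR => ?_⟩
  exact h i c hc w hw R₁ R₀ (zetaPiB R₁ R₀ (lev i)) (isCutoff_zetaPiB hR (lev i)) (zetaPiB_mem_Icc R₁ R₀ (lev i))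

/-- **THE DERIVATIVE MEMBER OF (2.5) FOR `H^Π_{j,loc}`, given the typed (7.2.2)**: one `(δ, M′)` for all scales `j = lev i`, all `w > 0`,
`c ≠ 0`, all radii with `R₀ − R₁ ≥ 1`: `‖λ ↦ L^j(H^Π_{j,loc}(⟨x + ηe_λ, μ⟩, b₁) − H^Π_{j,loc}(⟨x, μ⟩, b₁))‖ ≤ M′e^{−δ dist_j(x, b₁)}` — *"the derivative
… also [has] exponential decay"*. [cite: BalabanImbrieJaffe1988, (2.5) p.260] -/
theorem deriv25_hlKerPi_of_ineq722 {lev : ℕ → ℕ} (hlev : ∀ i, lev i ≤ P.m + P.K) {a : ℝ} (ha : 0 < a) {BondU : ℕ → Type}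
    {distEB : (i : ℕ) → TSite P 0 → BondU i → ℝ} {Cker : (i : ℕ) → Fin P.d → Fin P.d → TSite P (lev i) → TSite P (lev i) → ℝ}
    {Dker : (i : ℕ) → TSite P 0 → BondU i → ℝ}
    (h722 : KernelData.Ineq722
      (fun i => torusKernelData P (lev i) (deltaAData (hlev i) a) (BondU i) (distEB i) (Cker i) (Dker i))) :
    ∃ δ M' : ℝ, 0 < δ ∧ 0 ≤ M' ∧ ∀ (i : ℕ) (R₁ R₀ : ℝ), 1 ≤ R₀ - R₁ → ∀ (w : ℝ), 0 < w → ∀ (c : ℝ), c ≠ 0 →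
      ∀ (μ : Fin P.d) (x : TSite P 0) (b₁ : PBond P (lev i)),
        ‖fun lam : Fin P.d => (P.L : ℝ) ^ lev i *
            (hlKerPi (P := P) w c R₁ R₀ (lev i) ⟨x.shift lam, μ⟩ b₁ - hlKerPi (P := P) w c R₁ R₀ (lev i) ⟨x, μ⟩ b₁)‖ ≤
          M' * Real.exp (-(δ * distEU P (lev i) x b₁.src)) := by
  obtain ⟨δ, M', hδ, hM', h⟩ := deriv25_zetaPi_of_ineq722 hlev h722
  refine ⟨δ, M', hδ, hM', fun i R₁ R₀ hw1 w hw c hc μ x b₁ => ?_⟩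
  have hv : (fun lam : Fin P.d => (P.L : ℝ) ^ lev i *
        (hlKerPi (P := P) w c R₁ R₀ (lev i) ⟨x.shift lam, μ⟩ b₁ - hlKerPi (P := P) w c R₁ R₀ (lev i) ⟨x, μ⟩ b₁)) =
      fun lam : Fin P.d => (P.L : ℝ) ^ lev i *
        (zetaPi R₁ R₀ (lev i) (x.shift lam) b₁.src * (torusRep P (lev i) (deltaAData (hlev i) a)).H (x.shift lam, μ) (b₁.src, b₁.dir) -
          zetaPi R₁ R₀ (lev i) x b₁.src * (torusRep P (lev i) (deltaAData (hlev i) a)).H (x, μ) (b₁.src, b₁.dir)) :=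
    funext fun lam => by rw [hlKerPi_eq_H (hlev i) hw hc ha, hlKerPi_eq_H (hlev i) hw hc ha]
  rw [hv]
  exact h i R₁ R₀ hw1 μ b₁.dir x b₁.src

/-- **THE HÖLDER MEMBER OF ORDER `1 + α` OF (2.5) FOR `H^Π_{j,loc}`, given the typed (7.2.2)**, p. 260 *"and the derivative and Hölder
derivative of order less than 2 also have exponential decay"*: for every `0 ≤ α < 1` one `(δ, M′)` for all scales `j = lev i`, all `w > 0`,
`c ≠ 0` and all admissible radii (`R₀ − R₁ ≥ 1`, `R₁L^j ≥ 1`, `R₀L^j ≤ (|T_η| − 3)/2`):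
`|x − x′|^{−α}·‖λ ↦ ∇_λH^Π_{j,loc}(⟨x,μ⟩, b₁) − ∇_λH^Π_{j,loc}(⟨x′,μ⟩, b₁)‖ ≤ M′e^{−δ dist_j(x, b₁)}`, `x ≠ x′`, `|x − x′| = |x − x′|_∞/L^j ≤ 1`,
`∇_λF(⟨x,μ⟩) = L^j(F(⟨x + ηe_λ, μ⟩) − F(⟨x, μ⟩))`. [cite: BalabanImbrieJaffe1988, (2.5) p.260] -/
theorem holder25_hlKerPi_of_ineq722 {lev : ℕ → ℕ} (hlev : ∀ i, lev i ≤ P.m + P.K) {a : ℝ} (ha : 0 < a) {BondU : ℕ → Type}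
    {distEB : (i : ℕ) → TSite P 0 → BondU i → ℝ} {Cker : (i : ℕ) → Fin P.d → Fin P.d → TSite P (lev i) → TSite P (lev i) → ℝ}
    {Dker : (i : ℕ) → TSite P 0 → BondU i → ℝ}
    (h722 : KernelData.Ineq722
      (fun i => torusKernelData P (lev i) (deltaAData (hlev i) a) (BondU i) (distEB i) (Cker i) (Dker i)))
    {α : ℝ} (hα0 : 0 ≤ α) (hα1 : α < 1) :
    ∃ δ M' : ℝ, 0 < δ ∧ 0 ≤ M' ∧ ∀ (i : ℕ) (R₁ R₀ : ℝ), 1 ≤ R₀ - R₁ → 1 ≤ R₁ * (P.L : ℝ) ^ lev i →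
      R₀ * (P.L : ℝ) ^ lev i ≤ ((P.sitesPerDir 0 : ℝ) - 3) / 2 → ∀ (w : ℝ), 0 < w → ∀ (c : ℝ), c ≠ 0 →
      ∀ (μ : Fin P.d) (x x' : TSite P 0) (b₁ : PBond P (lev i)), x ≠ x' → (supDist x x' : ℝ) / (P.L : ℝ) ^ lev i ≤ 1 →
        ((supDist x x' : ℝ) / (P.L : ℝ) ^ lev i) ^ (-α) *
          ‖fun lam : Fin P.d =>
            (P.L : ℝ) ^ lev i * (hlKerPi (P := P) w c R₁ R₀ (lev i) ⟨x.shift lam, μ⟩ b₁ - hlKerPi (P := P) w c R₁ R₀ (lev i) ⟨x, μ⟩ b₁) -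
            (P.L : ℝ) ^ lev i * (hlKerPi (P := P) w c R₁ R₀ (lev i) ⟨x'.shift lam, μ⟩ b₁ - hlKerPi (P := P) w c R₁ R₀ (lev i) ⟨x', μ⟩ b₁)‖ ≤
          M' * Real.exp (-(δ * distEU P (lev i) x b₁.src)) := by
  obtain ⟨δ, M', hδ, hM', h⟩ := holder25_zetaPi_of_ineq722 hlev h722 hα0 hα1
  refine ⟨δ, M', hδ, hM', fun i R₁ R₀ hw1 hR1 hR0 w hw c hc μ x x' b₁ hne hr => ?_⟩
  have hv : (fun lam : Fin P.d =>
        (P.L : ℝ) ^ lev i * (hlKerPi (P := P) w c R₁ R₀ (lev i) ⟨x.shift lam, μ⟩ b₁ - hlKerPi (P := P) w c R₁ R₀ (lev i) ⟨x, μ⟩ b₁) -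
        (P.L : ℝ) ^ lev i * (hlKerPi (P := P) w c R₁ R₀ (lev i) ⟨x'.shift lam, μ⟩ b₁ - hlKerPi (P := P) w c R₁ R₀ (lev i) ⟨x', μ⟩ b₁)) =
      fun lam : Fin P.d =>
        (P.L : ℝ) ^ lev i * (zetaPi R₁ R₀ (lev i) (x.shift lam) b₁.src *
              (torusRep P (lev i) (deltaAData (hlev i) a)).H (x.shift lam, μ) (b₁.src, b₁.dir) -
            zetaPi R₁ R₀ (lev i) x b₁.src * (torusRep P (lev i) (deltaAData (hlev i) a)).H (x, μ) (b₁.src, b₁.dir)) -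
        (P.L : ℝ) ^ lev i * (zetaPi R₁ R₀ (lev i) (x'.shift lam) b₁.src *
              (torusRep P (lev i) (deltaAData (hlev i) a)).H (x'.shift lam, μ) (b₁.src, b₁.dir) -
            zetaPi R₁ R₀ (lev i) x' b₁.src * (torusRep P (lev i) (deltaAData (hlev i) a)).H (x', μ) (b₁.src, b₁.dir)) :=
    funext fun lam => by simp only [hlKerPi_eq_H (hlev i) hw hc ha]
  rw [hv]
  exact h i R₁ R₀ hw1 hR1 hR0 μ b₁.dir x x' b₁.src hne hr

/-- **THE HÖLDER MEMBER OF (2.7) FOR `H^Π_{j,loc} − H_j`, given the typed (7.2.2)**: for every `0 ≤ α < 1` one `(δ, M′)` for all scales and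
admissible radii: `|x − x′|^{−α}·‖λ ↦ ∇_λ(H^Π_{j,loc} − H_j)(⟨x,μ⟩, b₁) − ∇_λ(H^Π_{j,loc} − H_j)(⟨x′,μ⟩, b₁)‖ ≤ M′e^{−(δ/2)(R₁ − 2)}e^{−(δ/2)dist_j(x,b₁)}`
— *"H_{k,loc} − H_k is small"* (2.7) for the Hölder derivative of order `1 + α`. [cite: BalabanImbrieJaffe1988, (2.7) p.260] -/
theorem holder27_hlKerPi_of_ineq722 {lev : ℕ → ℕ} (hlev : ∀ i, lev i ≤ P.m + P.K) {a : ℝ} (ha : 0 < a) {BondU : ℕ → Type}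
    {distEB : (i : ℕ) → TSite P 0 → BondU i → ℝ} {Cker : (i : ℕ) → Fin P.d → Fin P.d → TSite P (lev i) → TSite P (lev i) → ℝ}
    {Dker : (i : ℕ) → TSite P 0 → BondU i → ℝ}
    (h722 : KernelData.Ineq722
      (fun i => torusKernelData P (lev i) (deltaAData (hlev i) a) (BondU i) (distEB i) (Cker i) (Dker i)))
    {α : ℝ} (hα0 : 0 ≤ α) (hα1 : α < 1) :
    ∃ δ M' : ℝ, 0 < δ ∧ 0 ≤ M' ∧ ∀ (i : ℕ) (R₁ R₀ : ℝ), 1 ≤ R₀ - R₁ → 1 ≤ R₁ * (P.L : ℝ) ^ lev i →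
      R₀ * (P.L : ℝ) ^ lev i ≤ ((P.sitesPerDir 0 : ℝ) - 3) / 2 → ∀ (w : ℝ), 0 < w → ∀ (c : ℝ), c ≠ 0 →
      ∀ (μ : Fin P.d) (x x' : TSite P 0) (b₁ : PBond P (lev i)), x ≠ x' → (supDist x x' : ℝ) / (P.L : ℝ) ^ lev i ≤ 1 →
        ((supDist x x' : ℝ) / (P.L : ℝ) ^ lev i) ^ (-α) *
          ‖fun lam : Fin P.d =>
            (P.L : ℝ) ^ lev i * ((hlKerPi (P := P) w c R₁ R₀ (lev i) ⟨x.shift lam, μ⟩ b₁ - hKer w c (lev i) ⟨x.shift lam, μ⟩ b₁) -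
                (hlKerPi (P := P) w c R₁ R₀ (lev i) ⟨x, μ⟩ b₁ - hKer w c (lev i) ⟨x, μ⟩ b₁)) -
            (P.L : ℝ) ^ lev i * ((hlKerPi (P := P) w c R₁ R₀ (lev i) ⟨x'.shift lam, μ⟩ b₁ - hKer w c (lev i) ⟨x'.shift lam, μ⟩ b₁) -
                (hlKerPi (P := P) w c R₁ R₀ (lev i) ⟨x', μ⟩ b₁ - hKer w c (lev i) ⟨x', μ⟩ b₁))‖ ≤
          M' * Real.exp (-(δ / 2 * (R₁ - 2))) * Real.exp (-(δ / 2 * distEU P (lev i) x b₁.src)) := by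
  obtain ⟨δ, M', hδ, hM', h⟩ := holder27_zetaPi_of_ineq722 hlev h722 hα0 hα1
  refine ⟨δ, M', hδ, hM', fun i R₁ R₀ hw1 hR1 hR0 w hw c hc μ x x' b₁ hne hr => ?_⟩
  have hv : (fun lam : Fin P.d =>
        (P.L : ℝ) ^ lev i * ((hlKerPi (P := P) w c R₁ R₀ (lev i) ⟨x.shift lam, μ⟩ b₁ - hKer w c (lev i) ⟨x.shift lam, μ⟩ b₁) -
            (hlKerPi (P := P) w c R₁ R₀ (lev i) ⟨x, μ⟩ b₁ - hKer w c (lev i) ⟨x, μ⟩ b₁)) -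
        (P.L : ℝ) ^ lev i * ((hlKerPi (P := P) w c R₁ R₀ (lev i) ⟨x'.shift lam, μ⟩ b₁ - hKer w c (lev i) ⟨x'.shift lam, μ⟩ b₁) -
            (hlKerPi (P := P) w c R₁ R₀ (lev i) ⟨x', μ⟩ b₁ - hKer w c (lev i) ⟨x', μ⟩ b₁))) =
      fun lam : Fin P.d =>
        ((P.L : ℝ) ^ lev i * (zetaPi R₁ R₀ (lev i) (x.shift lam) b₁.src *
              (torusRep P (lev i) (deltaAData (hlev i) a)).H (x.shift lam, μ) (b₁.src, b₁.dir) -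
            zetaPi R₁ R₀ (lev i) x b₁.src * (torusRep P (lev i) (deltaAData (hlev i) a)).H (x, μ) (b₁.src, b₁.dir)) -
          (P.L : ℝ) ^ lev i * ((torusRep P (lev i) (deltaAData (hlev i) a)).H (x.shift lam, μ) (b₁.src, b₁.dir) -
            (torusRep P (lev i) (deltaAData (hlev i) a)).H (x, μ) (b₁.src, b₁.dir))) -
        ((P.L : ℝ) ^ lev i * (zetaPi R₁ R₀ (lev i) (x'.shift lam) b₁.src *
              (torusRep P (lev i) (deltaAData (hlev i) a)).H (x'.shift lam, μ) (b₁.src, b₁.dir) -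
            zetaPi R₁ R₀ (lev i) x' b₁.src * (torusRep P (lev i) (deltaAData (hlev i) a)).H (x', μ) (b₁.src, b₁.dir)) -
          (P.L : ℝ) ^ lev i * ((torusRep P (lev i) (deltaAData (hlev i) a)).H (x'.shift lam, μ) (b₁.src, b₁.dir) -
            (torusRep P (lev i) (deltaAData (hlev i) a)).H (x', μ) (b₁.src, b₁.dir))) :=
    funext fun lam => by simp only [hlKerPi_eq_H (hlev i) hw hc ha, hKer_eq_H (hlev i) hw hc ha]; ring
  rw [hv]
  exact h i R₁ R₀ hw1 hR1 hR0 μ b₁.dir x x' b₁.src hne hr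

/-! ### hypothesis-free on every torus (p19's (7.2.2) of record) -/

/-- **(2.5)/(2.6)/(2.7) SUP MEMBERS FOR `H^Π_{j,loc}`, HYPOTHESIS-FREE** on every torus of the series (constants per torus, uniform in the
scale `j ≤ m + K`, the weights `w > 0`, `c ≠ 0` and the radii). [cite: BalabanImbrieJaffe1988, (2.5)–(2.7) p.260] -/
theorem eq25_26_27_hlKerPi :
    ∃ δ M : ℝ, 0 < δ ∧ 0 ≤ M ∧ ∀ (j : ℕ) (_ : j ≤ P.m + P.K) (c : ℝ), c ≠ 0 → ∀ (w : ℝ), 0 < w → ∀ (R₁ R₀ : ℝ), R₁ < R₀ →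
      (∀ (b : PBond P 0) (b₁ : PBond P j),
          |hlKerPi (P := P) w c R₁ R₀ j b b₁| ≤ M * Real.exp (-(δ * distEU P j b.src b₁.src))) ∧
        Vanishes (hdist (P := P) j) (hlKerPi (P := P) w c R₁ R₀ j) R₀ ∧
        Close (hdist (P := P) j) (hlKerPi (P := P) w c R₁ R₀ j) (hKer w c j) (M * Real.exp (-(δ / 2) * R₁)) (δ / 2) := by
  obtain ⟨δ, M, hδ, hM, h⟩ := eq25_26_27_hlKerPi_of_ineq722 (lev := fun j => min j (P.m + P.K)) (fun j => min_le_right _ _) one_pos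
    (ineq722_deltaA_printed P _ _ one_pos (fun _ => PUnit) (fun _ _ _ => 0) (fun _ _ _ _ _ => 0) (fun _ _ _ => 0))
  refine ⟨δ, M, hδ, hM, fun j hj c hc w hw R₁ R₀ hR => ?_⟩
  have e : min j (P.m + P.K) = j := min_eq_left hj
  have h' := h j c hc w hw R₁ R₀ hR
  rw [e] at h'
  exact h'

/-- **THE DERIVATIVE MEMBER OF (2.5) FOR `H^Π_{j,loc}`, HYPOTHESIS-FREE** on every torus (constants per torus, uniform in the scale).
[cite: BalabanImbrieJaffe1988, (2.5) p.260] -/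
theorem deriv25_hlKerPi :
    ∃ δ M' : ℝ, 0 < δ ∧ 0 ≤ M' ∧ ∀ (j : ℕ) (_ : j ≤ P.m + P.K) (R₁ R₀ : ℝ), 1 ≤ R₀ - R₁ → ∀ (w : ℝ), 0 < w → ∀ (c : ℝ), c ≠ 0 →
      ∀ (μ : Fin P.d) (x : TSite P 0) (b₁ : PBond P j),
        ‖fun lam : Fin P.d => (P.L : ℝ) ^ j *
            (hlKerPi (P := P) w c R₁ R₀ j ⟨x.shift lam, μ⟩ b₁ - hlKerPi (P := P) w c R₁ R₀ j ⟨x, μ⟩ b₁)‖ ≤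
          M' * Real.exp (-(δ * distEU P j x b₁.src)) := by
  obtain ⟨δ, M', hδ, hM', h⟩ := deriv25_hlKerPi_of_ineq722 (lev := fun j => min j (P.m + P.K)) (fun j => min_le_right _ _) one_pos
    (ineq722_deltaA_printed P _ _ one_pos (fun _ => PUnit) (fun _ _ _ => 0) (fun _ _ _ _ _ => 0) (fun _ _ _ => 0))
  refine ⟨δ, M', hδ, hM', fun j hj R₁ R₀ hw1 w hw c hc μ x b₁ => ?_⟩
  have e : min j (P.m + P.K) = j := min_eq_left hj
  have h' := h j R₁ R₀ hw1 w hw c hc μ x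
  rw [e] at h'
  exact h' b₁

/-- **THE HÖLDER MEMBER OF (2.5) FOR `H^Π_{j,loc}`, HYPOTHESIS-FREE ON EVERY TORUS** (constants per torus, uniform in the scale `j ≤ m + K`,
`w > 0`, `c ≠ 0` and the admissible radii): *"the derivative and Hölder derivative of order less than 2 also have exponential decay"* for a
localization function that IS *"a smooth function of b"*. [cite: BalabanImbrieJaffe1988, (2.5) p.260] -/
theorem holder25_hlKerPi {α : ℝ} (hα0 : 0 ≤ α) (hα1 : α < 1) :
    ∃ δ M' : ℝ, 0 < δ ∧ 0 ≤ M' ∧ ∀ (j : ℕ) (_ : j ≤ P.m + P.K) (R₁ R₀ : ℝ), 1 ≤ R₀ - R₁ → 1 ≤ R₁ * (P.L : ℝ) ^ j →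
      R₀ * (P.L : ℝ) ^ j ≤ ((P.sitesPerDir 0 : ℝ) - 3) / 2 → ∀ (w : ℝ), 0 < w → ∀ (c : ℝ), c ≠ 0 →
      ∀ (μ : Fin P.d) (x x' : TSite P 0) (b₁ : PBond P j), x ≠ x' → (supDist x x' : ℝ) / (P.L : ℝ) ^ j ≤ 1 →
        ((supDist x x' : ℝ) / (P.L : ℝ) ^ j) ^ (-α) *
          ‖fun lam : Fin P.d =>
            (P.L : ℝ) ^ j * (hlKerPi (P := P) w c R₁ R₀ j ⟨x.shift lam, μ⟩ b₁ - hlKerPi (P := P) w c R₁ R₀ j ⟨x, μ⟩ b₁) -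
            (P.L : ℝ) ^ j * (hlKerPi (P := P) w c R₁ R₀ j ⟨x'.shift lam, μ⟩ b₁ - hlKerPi (P := P) w c R₁ R₀ j ⟨x', μ⟩ b₁)‖ ≤
          M' * Real.exp (-(δ * distEU P j x b₁.src)) := by
  obtain ⟨δ, M', hδ, hM', h⟩ := holder25_hlKerPi_of_ineq722 (lev := fun j => min j (P.m + P.K)) (fun j => min_le_right _ _) one_pos
    (ineq722_deltaA_printed P _ _ one_pos (fun _ => PUnit) (fun _ _ _ => 0) (fun _ _ _ _ _ => 0) (fun _ _ _ => 0)) hα0 hα1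
  refine ⟨δ, M', hδ, hM', fun j hj R₁ R₀ hw1 hR1 hR0 w hw c hc μ x x' b₁ hne hr => ?_⟩
  have e : min j (P.m + P.K) = j := min_eq_left hj
  have h' := h j R₁ R₀ hw1
  rw [e] at h'
  exact h' hR1 hR0 w hw c hc μ x x' b₁ hne hr

/-- **THE HÖLDER MEMBER OF (2.7) FOR `H^Π_{j,loc} − H_j`, HYPOTHESIS-FREE ON EVERY TORUS** (constants per torus, uniform in the scale).
[cite: BalabanImbrieJaffe1988, (2.7) p.260] -/
theorem holder27_hlKerPi {α : ℝ} (hα0 : 0 ≤ α) (hα1 : α < 1) :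
    ∃ δ M' : ℝ, 0 < δ ∧ 0 ≤ M' ∧ ∀ (j : ℕ) (_ : j ≤ P.m + P.K) (R₁ R₀ : ℝ), 1 ≤ R₀ - R₁ → 1 ≤ R₁ * (P.L : ℝ) ^ j →
      R₀ * (P.L : ℝ) ^ j ≤ ((P.sitesPerDir 0 : ℝ) - 3) / 2 → ∀ (w : ℝ), 0 < w → ∀ (c : ℝ), c ≠ 0 →
      ∀ (μ : Fin P.d) (x x' : TSite P 0) (b₁ : PBond P j), x ≠ x' → (supDist x x' : ℝ) / (P.L : ℝ) ^ j ≤ 1 →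
        ((supDist x x' : ℝ) / (P.L : ℝ) ^ j) ^ (-α) *
          ‖fun lam : Fin P.d =>
            (P.L : ℝ) ^ j * ((hlKerPi (P := P) w c R₁ R₀ j ⟨x.shift lam, μ⟩ b₁ - hKer w c j ⟨x.shift lam, μ⟩ b₁) -
                (hlKerPi (P := P) w c R₁ R₀ j ⟨x, μ⟩ b₁ - hKer w c j ⟨x, μ⟩ b₁)) -
            (P.L : ℝ) ^ j * ((hlKerPi (P := P) w c R₁ R₀ j ⟨x'.shift lam, μ⟩ b₁ - hKer w c j ⟨x'.shift lam, μ⟩ b₁) -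
                (hlKerPi (P := P) w c R₁ R₀ j ⟨x', μ⟩ b₁ - hKer w c j ⟨x', μ⟩ b₁))‖ ≤
          M' * Real.exp (-(δ / 2 * (R₁ - 2))) * Real.exp (-(δ / 2 * distEU P j x b₁.src)) := by
  obtain ⟨δ, M', hδ, hM', h⟩ := holder27_hlKerPi_of_ineq722 (lev := fun j => min j (P.m + P.K)) (fun j => min_le_right _ _) one_pos
    (ineq722_deltaA_printed P _ _ one_pos (fun _ => PUnit) (fun _ _ _ => 0) (fun _ _ _ _ _ => 0) (fun _ _ _ => 0)) hα0 hα1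
  refine ⟨δ, M', hδ, hM', fun j hj R₁ R₀ hw1 hR1 hR0 w hw c hc μ x x' b₁ hne hr => ?_⟩
  have e : min j (P.m + P.K) = j := min_eq_left hj
  have h' := h j R₁ R₀ hw1
  rw [e] at h'
  exact h' hR1 hR0 w hw c hc μ x x' b₁ hne hr

/-! ### (2.6) for the derivative, and the printed radii -/

/-- **(2.6) FOR THE DERIVATIVE OF `H^Π_{j,loc}`**: one unit beyond the outer radius the whole gradient vanishes,
`λ ↦ L^j(H^Π_{j,loc}(⟨x + ηe_λ, μ⟩, b₁) − H^Π_{j,loc}(⟨x, μ⟩, b₁)) = 0` for `dist_j(x, b₁) ≥ R₀ + 1` (both points lie beyond `R₀`; *"similarly for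
∂H_{k,loc}"* of (2.6)). [cite: BalabanImbrieJaffe1988, (2.6) p.260] -/
theorem deriv26_hlKerPi {R₁ R₀ : ℝ} (hR : R₁ < R₀) (j : ℕ) (w c : ℝ) (μ : Fin P.d) (x : TSite P 0) (b₁ : PBond P j)
    (h : R₀ + 1 ≤ distEU P j x b₁.src) :
    (fun lam : Fin P.d => (P.L : ℝ) ^ j *
        (hlKerPi (P := P) w c R₁ R₀ j ⟨x.shift lam, μ⟩ b₁ - hlKerPi (P := P) w c R₁ R₀ j ⟨x, μ⟩ b₁)) = 0 := by
  have hs := cast_pow_L_pos''' (P := P) j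
  have hV := (isCutoff_zetaPiB (P := P) hR j).2
  funext lam
  have h1 : hlKerPi (P := P) w c R₁ R₀ j ⟨x, μ⟩ b₁ = 0 := by
    rw [hlKerPi_apply]
    have hz : zetaPiB R₁ R₀ j (⟨x, μ⟩ : PBond P 0) b₁ = 0 := hV ⟨x, μ⟩ b₁ (by show R₀ ≤ distEU P j x b₁.src; linarith)
    rw [show zetaPi R₁ R₀ j x b₁.src = zetaPiB R₁ R₀ j (⟨x, μ⟩ : PBond P 0) b₁ from rfl, hz, zero_mul]
  have h2 : hlKerPi (P := P) w c R₁ R₀ j ⟨x.shift lam, μ⟩ b₁ = 0 := by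
    rw [hlKerPi_apply]
    have hd : R₀ ≤ distEU P j (x.shift lam) b₁.src := by
      have h3 := distEU_le_distEU_add j x (x.shift lam) b₁.src
      have h4 : (supDist x (x.shift lam) : ℝ) / (P.L : ℝ) ^ j ≤ 1 := by
        rw [div_le_one hs, supDist_comm]
        have h5 : (supDist (x.shift lam) x : ℝ) ≤ 1 := by exact_mod_cast supDist_shift_self_le x lam
        exact h5.trans (one_le_pow₀ (by exact_mod_cast P.L_pos))
      linarith
    have hz : zetaPiB R₁ R₀ j (⟨x.shift lam, μ⟩ : PBond P 0) b₁ = 0 := hV ⟨x.shift lam, μ⟩ b₁ hd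
    rw [show zetaPi R₁ R₀ j (x.shift lam) b₁.src = zetaPiB R₁ R₀ j (⟨x.shift lam, μ⟩ : PBond P 0) b₁ from rfl, hz, zero_mul]
  simp only [h1, h2, sub_self, mul_zero, Pi.zero_apply]

/-- **THE PRINTED RADII ARE ADMISSIBLE**: for `R₁ = r(e_j)/16`, `R₀ = r(e_j)/8` (2.1) the three side conditions of the Hölder members read
`r(e_j) ≥ 16` (annulus width `r(e_j)/16 ≥ 1` and, as `L^j ≥ 1`, inner radius `≥ 1` fine step) and `r(e_j)L^j/4 + 3 ≤ |T_η|` (the annulus ends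
`3/2` fine steps before the antipode: print's *"ζ_k permits a sampling only of b near b′, relative to the size of T_{0,η}"*).
[cite: BalabanImbrieJaffe1988, (2.1) p.260] -/
theorem printedRadii_admissible (j : ℕ) {rek : ℝ} (h16 : 16 ≤ rek) (hT : rek * (P.L : ℝ) ^ j / 4 + 3 ≤ (P.sitesPerDir 0 : ℝ)) :
    1 ≤ rek / 8 - rek / 16 ∧ 1 ≤ rek / 16 * (P.L : ℝ) ^ j ∧ rek / 8 * (P.L : ℝ) ^ j ≤ ((P.sitesPerDir 0 : ℝ) - 3) / 2 := by
  have hL1 : (1 : ℝ) ≤ (P.L : ℝ) ^ j := one_le_pow₀ (by exact_mod_cast P.L_pos)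
  refine ⟨by linarith, ?_, by linarith⟩
  calc (1 : ℝ) = 1 * 1 := (one_mul _).symm
    _ ≤ rek / 16 * (P.L : ℝ) ^ j := mul_le_mul (by linarith) hL1 zero_le_one (by linarith)

end Loc

/-! ## §8  ONE `(δ, M′)` FOR ALL TORI AND ALL SCALES — (I.7.2.2)'s *"constants independent of k, T_η"* for the members of §6–§7

[6I] Prop. 1.2 OVER ALL TORI AND ALL SCALES `0 ≤ j ≤ m + K` is in the tree with ONE set of constants (p19's
`BIJ85Prop12AllTori.prop12Printed_allTori_allScales`, hypothesis-free); p09's one-scale theorem with EXPLICIT constants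
(`BIJ85Ineq722ProofPart2.ineq722_kernelData`: rate `rate722 d C δ₀ …`, constant `M722 d … α·e^{rate/2}`) then bounds the three members of
(7.2.2) on EVERY torus `P` with `P.d = d`, `P.L = L` by the same numbers, because the structural inputs of the torus
(`BIJ85Ineq722AllTori.hyps_torus_deltaA_dim`, `cutoffHyps_torus`, `distEU_le`, `dS_pos`) carry torus-independent constants.  Feeding these into
the pointwise product rules `holder25/deriv25/holder27_zetaPi_of_bounds` of §6 gives the theorems of §6–§7 with `(δ, M′)` depending on
`(d, L, a, α)` only — for every torus of the family at once (no enumeration / transport needed). -/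

section AllTori

/-- `x + ηe_μ ≠ x` on every torus (`1 ≠ 0` in `ZMod (2L^{m+K})`; p08's private lemma, re-proved). [cite: Balaban1987RG1, (0.1) p.251] -/
private theorem shift_ne_self'' {P : Params} (x : TSite P 0) (μ : Fin P.d) : x.shift μ ≠ x := by
  intro h
  have h1 := congrFun h μ
  simp only [Balaban1983to89.Site.shift, Function.update_self] at h1
  exact one_ne_zero (add_eq_left.1 h1)

/-- **THE THREE MEMBERS OF (I.7.2.2) ON ONE TORUS AT ONE SCALE WITH p09's EXPLICIT CONSTANTS** (the numbers depend on `(d, a, α)` and on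
the Prop. 1.2 constants `(C, δ₀, C_α)` only — not on the torus, not on the scale): for `x ≠ x′`, `|x − x′| ≤ 1`,
`|H| + ‖∇H‖ + |x − x′|^{−α}‖∇H(x) − ∇H(x′)‖ ≤ M722(…, α)e^{rate/2}·e^{−rate·|x − y|}`. [cite: BalabanImbrieJaffe1985, (7.2.2) p.325] -/
private theorem ineq722_explicit_torus {P : Params} {d : ℕ} {a C δ₀ : ℝ} {Cα : ℝ → ℝ} (ha : 0 < a) (hPd : P.d = d) {k : ℕ}
    (hk : k ≤ P.m + P.K) (h12 : (torusRep P k (deltaAData hk a)).Prop12Hyps C Cα δ₀) {α : ℝ} (hα0 : 0 ≤ α) (hα1 : α < 1)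
    (μ ν : Fin P.d) (x x' : TSite P 0) (y : TSite P k) (hne : x ≠ x') (hle : (supDist x x' : ℝ) / (P.L : ℝ) ^ k ≤ 1) :
    |(torusRep P k (deltaAData hk a)).H (x, μ) (y, ν)| +
          ‖fun lam : Fin P.d => (P.L : ℝ) ^ k *
              ((torusRep P k (deltaAData hk a)).H (x.shift lam, μ) (y, ν) - (torusRep P k (deltaAData hk a)).H (x, μ) (y, ν))‖ +
        ((supDist x x' : ℝ) / (P.L : ℝ) ^ k) ^ (-α) *
          ‖fun lam : Fin P.d =>
            (P.L : ℝ) ^ k * ((torusRep P k (deltaAData hk a)).H (x.shift lam, μ) (y, ν) -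
                (torusRep P k (deltaAData hk a)).H (x, μ) (y, ν)) -
              (P.L : ℝ) ^ k * ((torusRep P k (deltaAData hk a)).H (x'.shift lam, μ) (y, ν) -
                (torusRep P k (deltaAData hk a)).H (x', μ) (y, ν))‖ ≤
      BIJ85Ineq722ProofPart2.M722 d C δ₀ (T4GaugeActionRate.gam0 d / (4 * d + a)) 1 1 1 (fun t : ℝ => (2 * (1 + (d : ℝ) / t)) ^ d) Cα
            (1 / 4) 4 0 1 α *
          Real.exp (BIJ85Ineq722Proof.Rep103.rate722 d C δ₀ (T4GaugeActionRate.gam0 d / (4 * d + a)) 1 1 1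
            (fun t : ℝ => (2 * (1 + (d : ℝ) / t)) ^ d) * (1 / 2)) *
        Real.exp (-(BIJ85Ineq722Proof.Rep103.rate722 d C δ₀ (T4GaugeActionRate.gam0 d / (4 * d + a)) 1 1 1
            (fun t : ℝ => (2 * (1 + (d : ℝ) / t)) ^ d) * distEU P k x y)) := by
  have hH := BIJ85Ineq722AllTori.hyps_torus_deltaA_dim hPd hk ha
  have h := BIJ85Ineq722ProofPart2.ineq722_kernelData (R := torusRep P k (deltaAData hk a)) (BondU := PUnit)
    (distEU := distEU P k) (distEB := fun _ _ => (0 : ℝ)) (Cker := fun _ _ _ _ => (0 : ℝ)) (Dker := fun _ _ => (0 : ℝ))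
    hH h12 (cutoffHyps_torus hk) hα0 hα1 (distEU_le hk) (fun z z' hzz => dS_pos z z' hzz) μ ν x x' y hne
    (by rw [torusRep_dS]; exact hle)
  have hcard : Fintype.card (torusRep P k (deltaAData hk a)).Dir = d := by rw [← hPd]; exact Fintype.card_fin P.d
  rw [hcard] at h
  have h' : |(torusKernelData P k (deltaAData hk a) PUnit (fun _ _ => (0 : ℝ)) (fun _ _ _ _ => (0 : ℝ)) (fun _ _ => (0 : ℝ))).H μ ν x y| +
        (torusKernelData P k (deltaAData hk a) PUnit (fun _ _ => (0 : ℝ)) (fun _ _ _ _ => (0 : ℝ)) (fun _ _ => (0 : ℝ))).gradH μ ν x y +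
      (torusKernelData P k (deltaAData hk a) PUnit (fun _ _ => (0 : ℝ)) (fun _ _ _ _ => (0 : ℝ)) (fun _ _ => (0 : ℝ))).distEta x x' ^ (-α) *
        (torusKernelData P k (deltaAData hk a) PUnit (fun _ _ => (0 : ℝ)) (fun _ _ _ _ => (0 : ℝ)) (fun _ _ => (0 : ℝ))).gradHDiff
          μ ν x x' y ≤ _ := h
  rw [torusKernelData_H, torusKernelData_gradH hk a, torusKernelData_gradHDiff hk a,
    BIJ88Ineq217Ineq722Torus.torusKernelData_distEta, torusRep_dS] at h'
  exact h'

/-- **ONE SET OF CONSTANTS FOR EVERY TORUS AND EVERY SCALE**: for `0 ≤ α < 1` there are `δ > 0`, `M ≥ 0` (depending on `(d, L, a, α)`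
only) such that on every torus `P` with `P.d = d`, `P.L = L`, at every scale `j ≤ m + K`, p09's kernel `H_{j,μν}(x; y)` satisfies
`|H| + ‖∇H‖ ≤ Me^{−δ|x − y|}` for all `x` and `|x − x′|^{−α}‖∇H(x) − ∇H(x′)‖ ≤ Me^{−δ|x − y|}` for `x ≠ x′`, `|x − x′| ≤ 1` — (I.7.2.2) with
*"constants independent of k, T_η"*, from [6I] Prop. 1.2 over all tori (p19's `prop12Printed_allTori_allScales`).
[cite: BalabanImbrieJaffe1985, (7.2.2) p.325] -/
theorem exists_holderBounds_allTori (d L : ℕ) {a : ℝ} (ha : 0 < a) {α : ℝ} (hα0 : 0 ≤ α) (hα1 : α < 1) :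
    ∃ δ M : ℝ, 0 < δ ∧ 0 ≤ M ∧ ∀ (P : Params) (_ : P.d = d) (_ : P.L = L) (j : ℕ) (hj : j ≤ P.m + P.K)
      (μ ν : Fin P.d) (y : TSite P j),
      (∀ z : TSite P 0, |(torusRep P j (deltaAData hj a)).H (z, μ) (y, ν)| +
          ‖fun lam : Fin P.d => (P.L : ℝ) ^ j *
              ((torusRep P j (deltaAData hj a)).H (z.shift lam, μ) (y, ν) - (torusRep P j (deltaAData hj a)).H (z, μ) (y, ν))‖ ≤
        M * Real.exp (-(δ * distEU P j z y))) ∧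
      (∀ x x' : TSite P 0, x ≠ x' → (supDist x x' : ℝ) / (P.L : ℝ) ^ j ≤ 1 →
        ((supDist x x' : ℝ) / (P.L : ℝ) ^ j) ^ (-α) *
            ‖fun lam : Fin P.d =>
              (P.L : ℝ) ^ j * ((torusRep P j (deltaAData hj a)).H (x.shift lam, μ) (y, ν) -
                  (torusRep P j (deltaAData hj a)).H (x, μ) (y, ν)) -
                (P.L : ℝ) ^ j * ((torusRep P j (deltaAData hj a)).H (x'.shift lam, μ) (y, ν) -
                  (torusRep P j (deltaAData hj a)).H (x', μ) (y, ν))‖ ≤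
          M * Real.exp (-(δ * distEU P j x y))) := by
  obtain ⟨δ₀, C, Cα, Cε, Cαε, hδ₀, hC, hall⟩ := BIJ85Prop12AllTori.prop12Printed_allTori_allScales d L ha
  by_cases hex : ∃ P : Params, P.d = d ∧ P.L = L
  · obtain ⟨P₀, hP₀d, hP₀L⟩ := hex
    have hk₀ : 0 ≤ P₀.m + P₀.K := Nat.zero_le _
    have hH₀ := BIJ85Ineq722AllTori.hyps_torus_deltaA_dim hP₀d hk₀ ha
    have h12₀ : (torusRep P₀ 0 (deltaAData hk₀ a)).Prop12Hyps C Cα δ₀ :=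
      BIJ85Ineq722ProofPart2.prop12Hyps_of_ineq110_114 hC.le hδ₀ (hall ⟨(P₀, 0), hP₀d, hP₀L, hk₀⟩)
    have hc₀ := cutoffHyps_torus (D := deltaAData hk₀ a) hk₀
    set r := BIJ85Ineq722Proof.Rep103.rate722 d C δ₀ (T4GaugeActionRate.gam0 d / (4 * d + a)) 1 1 1
      (fun t : ℝ => (2 * (1 + (d : ℝ) / t)) ^ d) with hr
    set Mu := BIJ85Ineq722ProofPart2.M722 d C δ₀ (T4GaugeActionRate.gam0 d / (4 * d + a)) 1 1 1
      (fun t : ℝ => (2 * (1 + (d : ℝ) / t)) ^ d) Cα (1 / 4) 4 0 1 α with hMu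
    have hrpos : 0 < r := BIJ85Ineq722Proof.Rep103.rate722_pos hH₀ h12₀ d
    have hMu0 : 0 ≤ Mu := by
      have h1 := BIJ85Ineq722Proof.Rep103.const722_nonneg hH₀ h12₀ d
      have h2 := BIJ85Ineq722ProofPart2.holderConst_nonneg hH₀ h12₀ hc₀ d α
      rw [hMu, BIJ85Ineq722ProofPart2.M722]
      linarith
    refine ⟨r, Mu * Real.exp (r * (1 / 2)), hrpos, by positivity, fun P hPd hPL j hj μ ν y => ?_⟩
    have h12 : (torusRep P j (deltaAData hj a)).Prop12Hyps C Cα δ₀ :=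
      BIJ85Ineq722ProofPart2.prop12Hyps_of_ineq110_114 hC.le hδ₀ (hall ⟨(P, j), hPd, hPL, hj⟩)
    have hL1 : (1 : ℝ) ≤ (P.L : ℝ) := by exact_mod_cast P.L_pos
    refine ⟨fun z => ?_, fun x x' hne hle => ?_⟩
    · -- the `|H| + ‖∇H‖` part at the admissible pair `(z, z + ηe_μ)`
      have hadm : (supDist z (z.shift μ) : ℝ) / (P.L : ℝ) ^ j ≤ 1 := by
        rw [div_le_one (cast_pow_L_pos'' (P := P) j), supDist_comm]
        have h1 : (supDist (z.shift μ) z : ℝ) ≤ 1 := by exact_mod_cast supDist_shift_self_le z μ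
        exact h1.trans (one_le_pow₀ hL1)
      have h := ineq722_explicit_torus ha hPd hj h12 hα0 hα1 μ ν z (z.shift μ) y (shift_ne_self'' z μ).symm hadm
      rw [← hr, ← hMu] at h
      exact (le_add_of_nonneg_right (mul_nonneg (Real.rpow_nonneg (div_nonneg (Nat.cast_nonneg _)
        (cast_pow_L_pos'' (P := P) j).le) _) (norm_nonneg _))).trans h
    · have h := ineq722_explicit_torus ha hPd hj h12 hα0 hα1 μ ν x x' y hne hle
      rw [← hr, ← hMu] at h
      exact (le_add_of_nonneg_left (add_nonneg (abs_nonneg _) (norm_nonneg _))).trans h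
  · exact ⟨1, 0, one_pos, le_rfl, fun P hPd hPL => (hex ⟨P, hPd, hPL⟩).elim⟩

/-- **THE HÖLDER MEMBER OF (2.5) FOR `ζ^Π_jH_j` WITH ONE `(δ, M′)` FOR ALL TORI (`P.d = d`, `P.L = L`) AND ALL SCALES `j ≤ m + K`**, all
admissible radii (`R₀ − R₁ ≥ 1`, `R₁L^j ≥ 1`, `R₀L^j ≤ (|T_η| − 3)/2`): the statement of `holder25_zetaPi_of_ineq722` with the constants now
depending on `(d, L, a, α)` only — (I.7.2.2)'s *"independent of k, T_η"* carried through §5's product rule.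
[cite: BalabanImbrieJaffe1988, (2.5) p.260] -/
theorem holder25_zetaPi_allTori (d L : ℕ) {a : ℝ} (ha : 0 < a) {α : ℝ} (hα0 : 0 ≤ α) (hα1 : α < 1) :
    ∃ δ M' : ℝ, 0 < δ ∧ 0 ≤ M' ∧ ∀ (P : Params) (_ : P.d = d) (_ : P.L = L) (j : ℕ) (hj : j ≤ P.m + P.K) (R₁ R₀ : ℝ),
      1 ≤ R₀ - R₁ → 1 ≤ R₁ * (P.L : ℝ) ^ j → R₀ * (P.L : ℝ) ^ j ≤ ((P.sitesPerDir 0 : ℝ) - 3) / 2 →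
      ∀ (μ ν : Fin P.d) (x x' : TSite P 0) (y : TSite P j), x ≠ x' → (supDist x x' : ℝ) / (P.L : ℝ) ^ j ≤ 1 →
        ((supDist x x' : ℝ) / (P.L : ℝ) ^ j) ^ (-α) *
          ‖fun lam : Fin P.d =>
            (P.L : ℝ) ^ j * (zetaPi R₁ R₀ j (x.shift lam) y * (torusRep P j (deltaAData hj a)).H (x.shift lam, μ) (y, ν) -
                zetaPi R₁ R₀ j x y * (torusRep P j (deltaAData hj a)).H (x, μ) (y, ν)) -
            (P.L : ℝ) ^ j * (zetaPi R₁ R₀ j (x'.shift lam) y * (torusRep P j (deltaAData hj a)).H (x'.shift lam, μ) (y, ν) -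
                zetaPi R₁ R₀ j x' y * (torusRep P j (deltaAData hj a)).H (x', μ) (y, ν))‖ ≤
          M' * Real.exp (-(δ * distEU P j x y)) := by
  obtain ⟨C, hC0, hC1, hC2⟩ := exists_abs_deriv_and_deriv_deriv_smoothTransition_le
  obtain ⟨δ, M, hδ, hM, hall⟩ := exists_holderBounds_allTori d L ha hα0 hα1
  refine ⟨δ, holderConst d M M C (C ^ 2 + C) δ, hδ, holderConst_nonneg d hM hM hC0 (by positivity) δ,
    fun P hPd hPL j hj R₁ R₀ hw1 hR1 hR0 μ ν x x' y hne hr => ?_⟩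
  obtain ⟨hHB, hHol⟩ := hall P hPd hPL j hj μ ν y
  have h := holder25_zetaPi_of_bounds hC0 hC1 hC2 hδ.le hM hM hα1.le hw1 hR1 hR0
    (G := fun z => (torusRep P j (deltaAData hj a)).H (z, μ) (y, ν)) hHB hne hr (hHol x x' hne hr)
  have e : holderConst P.d M M C (C ^ 2 + C) δ = holderConst d M M C (C ^ 2 + C) δ := by rw [hPd]
  rw [e] at h
  exact h

/-- **THE DERIVATIVE MEMBER OF (2.5) FOR `ζ^Π_jH_j` WITH ONE `(δ, M′)` FOR ALL TORI AND ALL SCALES** (`R₀ − R₁ ≥ 1`).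
[cite: BalabanImbrieJaffe1988, (2.5) p.260] -/
theorem deriv25_zetaPi_allTori (d L : ℕ) {a : ℝ} (ha : 0 < a) :
    ∃ δ M' : ℝ, 0 < δ ∧ 0 ≤ M' ∧ ∀ (P : Params) (_ : P.d = d) (_ : P.L = L) (j : ℕ) (hj : j ≤ P.m + P.K) (R₁ R₀ : ℝ),
      1 ≤ R₀ - R₁ → ∀ (μ ν : Fin P.d) (x : TSite P 0) (y : TSite P j),
        ‖fun lam : Fin P.d =>
            (P.L : ℝ) ^ j * (zetaPi R₁ R₀ j (x.shift lam) y * (torusRep P j (deltaAData hj a)).H (x.shift lam, μ) (y, ν) -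
                zetaPi R₁ R₀ j x y * (torusRep P j (deltaAData hj a)).H (x, μ) (y, ν))‖ ≤
          M' * Real.exp (-(δ * distEU P j x y)) := by
  obtain ⟨C, hC0, hC1, -⟩ := exists_abs_deriv_and_deriv_deriv_smoothTransition_le
  obtain ⟨δ, M, hδ, hM, hall⟩ := exists_holderBounds_allTori d L ha le_rfl zero_lt_one
  refine ⟨δ, (1 + C) * M, hδ, by positivity, fun P hPd hPL j hj R₁ R₀ hw1 μ ν x y => ?_⟩
  exact deriv25_zetaPi_of_bounds hC0 hC1 hw1 (G := fun z => (torusRep P j (deltaAData hj a)).H (z, μ) (y, ν))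
    (hall P hPd hPL j hj μ ν y).1 x

/-- **THE HÖLDER MEMBER OF (2.7) FOR `ζ^Π_jH_j − H_j` WITH ONE `(δ, M′)` FOR ALL TORI AND ALL SCALES**, all admissible radii: the statement of
`holder27_zetaPi_of_ineq722` with constants depending on `(d, L, a, α)` only. [cite: BalabanImbrieJaffe1988, (2.7) p.260] -/
theorem holder27_zetaPi_allTori (d L : ℕ) {a : ℝ} (ha : 0 < a) {α : ℝ} (hα0 : 0 ≤ α) (hα1 : α < 1) :
    ∃ δ M' : ℝ, 0 < δ ∧ 0 ≤ M' ∧ ∀ (P : Params) (_ : P.d = d) (_ : P.L = L) (j : ℕ) (hj : j ≤ P.m + P.K) (R₁ R₀ : ℝ),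
      1 ≤ R₀ - R₁ → 1 ≤ R₁ * (P.L : ℝ) ^ j → R₀ * (P.L : ℝ) ^ j ≤ ((P.sitesPerDir 0 : ℝ) - 3) / 2 →
      ∀ (μ ν : Fin P.d) (x x' : TSite P 0) (y : TSite P j), x ≠ x' → (supDist x x' : ℝ) / (P.L : ℝ) ^ j ≤ 1 →
        ((supDist x x' : ℝ) / (P.L : ℝ) ^ j) ^ (-α) *
          ‖fun lam : Fin P.d =>
            ((P.L : ℝ) ^ j * (zetaPi R₁ R₀ j (x.shift lam) y * (torusRep P j (deltaAData hj a)).H (x.shift lam, μ) (y, ν) -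
                zetaPi R₁ R₀ j x y * (torusRep P j (deltaAData hj a)).H (x, μ) (y, ν)) -
              (P.L : ℝ) ^ j * ((torusRep P j (deltaAData hj a)).H (x.shift lam, μ) (y, ν) -
                (torusRep P j (deltaAData hj a)).H (x, μ) (y, ν))) -
            ((P.L : ℝ) ^ j * (zetaPi R₁ R₀ j (x'.shift lam) y * (torusRep P j (deltaAData hj a)).H (x'.shift lam, μ) (y, ν) -
                zetaPi R₁ R₀ j x' y * (torusRep P j (deltaAData hj a)).H (x', μ) (y, ν)) -
              (P.L : ℝ) ^ j * ((torusRep P j (deltaAData hj a)).H (x'.shift lam, μ) (y, ν) -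
                (torusRep P j (deltaAData hj a)).H (x', μ) (y, ν)))‖ ≤
          M' * Real.exp (-(δ / 2 * (R₁ - 2))) * Real.exp (-(δ / 2 * distEU P j x y)) := by
  obtain ⟨C, hC0, hC1, hC2⟩ := exists_abs_deriv_and_deriv_deriv_smoothTransition_le
  obtain ⟨δ, M, hδ, hM, hall⟩ := exists_holderBounds_allTori d L ha hα0 hα1
  refine ⟨δ, holderConst d M M C (C ^ 2 + C) δ, hδ, holderConst_nonneg d hM hM hC0 (by positivity) δ,
    fun P hPd hPL j hj R₁ R₀ hw1 hR1 hR0 μ ν x x' y hne hr => ?_⟩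
  obtain ⟨hHB, hHol⟩ := hall P hPd hPL j hj μ ν y
  have h := holder27_zetaPi_of_bounds hC0 hC1 hC2 hδ.le hM hM hα1.le hw1 hR1 hR0
    (G := fun z => (torusRep P j (deltaAData hj a)).H (z, μ) (y, ν)) hHB hne hr (hHol x x' hne hr)
  have e : holderConst P.d M M C (C ^ 2 + C) δ = holderConst d M M C (C ^ 2 + C) δ := by rw [hPd]
  rw [e] at h
  exact h

/-- **THE HÖLDER MEMBER OF (2.5) FOR `H^Π_{j,loc}` WITH ONE `(δ, M′)` FOR ALL TORI AND ALL SCALES**, in the (2.4) vocabulary of §7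
(`hlKerPi w c R₁ R₀ j = loc ζ^Π_j hKer`, any `w > 0`, `c ≠ 0`): *"|H_{k,loc}(b,b′)| ≦ ce^{−c dist(b,b′)} … and similarly for … Hölder
derivatives of H_{k,loc} of order less than two"*, the constant uniform in the torus and the scale as (I.7.2.2) states it.
[cite: BalabanImbrieJaffe1988, (2.5) p.260] -/
theorem holder25_hlKerPi_allTori (d L : ℕ) {α : ℝ} (hα0 : 0 ≤ α) (hα1 : α < 1) :
    ∃ δ M' : ℝ, 0 < δ ∧ 0 ≤ M' ∧ ∀ (P : Params) (_ : P.d = d) (_ : P.L = L) (j : ℕ) (_ : j ≤ P.m + P.K) (R₁ R₀ : ℝ),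
      1 ≤ R₀ - R₁ → 1 ≤ R₁ * (P.L : ℝ) ^ j → R₀ * (P.L : ℝ) ^ j ≤ ((P.sitesPerDir 0 : ℝ) - 3) / 2 → ∀ (w : ℝ), 0 < w → ∀ (c : ℝ), c ≠ 0 →
      ∀ (μ : Fin P.d) (x x' : TSite P 0) (b₁ : PBond P j), x ≠ x' → (supDist x x' : ℝ) / (P.L : ℝ) ^ j ≤ 1 →
        ((supDist x x' : ℝ) / (P.L : ℝ) ^ j) ^ (-α) *
          ‖fun lam : Fin P.d =>
            (P.L : ℝ) ^ j * (hlKerPi (P := P) w c R₁ R₀ j ⟨x.shift lam, μ⟩ b₁ - hlKerPi (P := P) w c R₁ R₀ j ⟨x, μ⟩ b₁) -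
            (P.L : ℝ) ^ j * (hlKerPi (P := P) w c R₁ R₀ j ⟨x'.shift lam, μ⟩ b₁ - hlKerPi (P := P) w c R₁ R₀ j ⟨x', μ⟩ b₁)‖ ≤
          M' * Real.exp (-(δ * distEU P j x b₁.src)) := by
  obtain ⟨δ, M', hδ, hM', h⟩ := holder25_zetaPi_allTori d L one_pos hα0 hα1
  refine ⟨δ, M', hδ, hM', fun P hPd hPL j hj R₁ R₀ hw1 hR1 hR0 w hw c hc μ x x' b₁ hne hr => ?_⟩
  have hv : (fun lam : Fin P.d =>
        (P.L : ℝ) ^ j * (hlKerPi (P := P) w c R₁ R₀ j ⟨x.shift lam, μ⟩ b₁ - hlKerPi (P := P) w c R₁ R₀ j ⟨x, μ⟩ b₁) -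
        (P.L : ℝ) ^ j * (hlKerPi (P := P) w c R₁ R₀ j ⟨x'.shift lam, μ⟩ b₁ - hlKerPi (P := P) w c R₁ R₀ j ⟨x', μ⟩ b₁)) =
      fun lam : Fin P.d =>
        (P.L : ℝ) ^ j * (zetaPi R₁ R₀ j (x.shift lam) b₁.src * (torusRep P j (deltaAData hj 1)).H (x.shift lam, μ) (b₁.src, b₁.dir) -
            zetaPi R₁ R₀ j x b₁.src * (torusRep P j (deltaAData hj 1)).H (x, μ) (b₁.src, b₁.dir)) -
        (P.L : ℝ) ^ j * (zetaPi R₁ R₀ j (x'.shift lam) b₁.src * (torusRep P j (deltaAData hj 1)).H (x'.shift lam, μ) (b₁.src, b₁.dir) -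
            zetaPi R₁ R₀ j x' b₁.src * (torusRep P j (deltaAData hj 1)).H (x', μ) (b₁.src, b₁.dir)) :=
    funext fun lam => by simp only [hlKerPi_eq_H hj hw hc one_pos]
  rw [hv]
  exact h P hPd hPL j hj R₁ R₀ hw1 hR1 hR0 μ b₁.dir x x' b₁.src hne hr

/-- **THE DERIVATIVE MEMBER OF (2.5) FOR `H^Π_{j,loc}` WITH ONE `(δ, M′)` FOR ALL TORI AND ALL SCALES.** [cite: BalabanImbrieJaffe1988, (2.5) p.260] -/
theorem deriv25_hlKerPi_allTori (d L : ℕ) :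
    ∃ δ M' : ℝ, 0 < δ ∧ 0 ≤ M' ∧ ∀ (P : Params) (_ : P.d = d) (_ : P.L = L) (j : ℕ) (_ : j ≤ P.m + P.K) (R₁ R₀ : ℝ),
      1 ≤ R₀ - R₁ → ∀ (w : ℝ), 0 < w → ∀ (c : ℝ), c ≠ 0 → ∀ (μ : Fin P.d) (x : TSite P 0) (b₁ : PBond P j),
        ‖fun lam : Fin P.d => (P.L : ℝ) ^ j * (hlKerPi (P := P) w c R₁ R₀ j ⟨x.shift lam, μ⟩ b₁ - hlKerPi (P := P) w c R₁ R₀ j ⟨x, μ⟩ b₁)‖ ≤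
          M' * Real.exp (-(δ * distEU P j x b₁.src)) := by
  obtain ⟨δ, M', hδ, hM', h⟩ := deriv25_zetaPi_allTori d L one_pos
  refine ⟨δ, M', hδ, hM', fun P hPd hPL j hj R₁ R₀ hw1 w hw c hc μ x b₁ => ?_⟩
  have hv : (fun lam : Fin P.d => (P.L : ℝ) ^ j * (hlKerPi (P := P) w c R₁ R₀ j ⟨x.shift lam, μ⟩ b₁ - hlKerPi (P := P) w c R₁ R₀ j ⟨x, μ⟩ b₁)) =
      fun lam : Fin P.d =>
        (P.L : ℝ) ^ j * (zetaPi R₁ R₀ j (x.shift lam) b₁.src * (torusRep P j (deltaAData hj 1)).H (x.shift lam, μ) (b₁.src, b₁.dir) -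
          zetaPi R₁ R₀ j x b₁.src * (torusRep P j (deltaAData hj 1)).H (x, μ) (b₁.src, b₁.dir)) :=
    funext fun lam => by simp only [hlKerPi_eq_H hj hw hc one_pos]
  rw [hv]
  exact h P hPd hPL j hj R₁ R₀ hw1 μ b₁.dir x b₁.src

/-- **THE HÖLDER MEMBER OF (2.7) FOR `H^Π_{j,loc} − H_j` WITH ONE `(δ, M′)` FOR ALL TORI AND ALL SCALES.** [cite: BalabanImbrieJaffe1988, (2.7) p.260] -/
theorem holder27_hlKerPi_allTori (d L : ℕ) {α : ℝ} (hα0 : 0 ≤ α) (hα1 : α < 1) :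
    ∃ δ M' : ℝ, 0 < δ ∧ 0 ≤ M' ∧ ∀ (P : Params) (_ : P.d = d) (_ : P.L = L) (j : ℕ) (_ : j ≤ P.m + P.K) (R₁ R₀ : ℝ),
      1 ≤ R₀ - R₁ → 1 ≤ R₁ * (P.L : ℝ) ^ j → R₀ * (P.L : ℝ) ^ j ≤ ((P.sitesPerDir 0 : ℝ) - 3) / 2 → ∀ (w : ℝ), 0 < w → ∀ (c : ℝ), c ≠ 0 →
      ∀ (μ : Fin P.d) (x x' : TSite P 0) (b₁ : PBond P j), x ≠ x' → (supDist x x' : ℝ) / (P.L : ℝ) ^ j ≤ 1 →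
        ((supDist x x' : ℝ) / (P.L : ℝ) ^ j) ^ (-α) *
          ‖fun lam : Fin P.d =>
            (P.L : ℝ) ^ j * ((hlKerPi (P := P) w c R₁ R₀ j ⟨x.shift lam, μ⟩ b₁ - hKer w c j ⟨x.shift lam, μ⟩ b₁) -
                (hlKerPi (P := P) w c R₁ R₀ j ⟨x, μ⟩ b₁ - hKer w c j ⟨x, μ⟩ b₁)) -
            (P.L : ℝ) ^ j * ((hlKerPi (P := P) w c R₁ R₀ j ⟨x'.shift lam, μ⟩ b₁ - hKer w c j ⟨x'.shift lam, μ⟩ b₁) -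
                (hlKerPi (P := P) w c R₁ R₀ j ⟨x', μ⟩ b₁ - hKer w c j ⟨x', μ⟩ b₁))‖ ≤
          M' * Real.exp (-(δ / 2 * (R₁ - 2))) * Real.exp (-(δ / 2 * distEU P j x b₁.src)) := by
  obtain ⟨δ, M', hδ, hM', h⟩ := holder27_zetaPi_allTori d L one_pos hα0 hα1
  refine ⟨δ, M', hδ, hM', fun P hPd hPL j hj R₁ R₀ hw1 hR1 hR0 w hw c hc μ x x' b₁ hne hr => ?_⟩
  have hv : (fun lam : Fin P.d =>
        (P.L : ℝ) ^ j * ((hlKerPi (P := P) w c R₁ R₀ j ⟨x.shift lam, μ⟩ b₁ - hKer w c j ⟨x.shift lam, μ⟩ b₁) -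
            (hlKerPi (P := P) w c R₁ R₀ j ⟨x, μ⟩ b₁ - hKer w c j ⟨x, μ⟩ b₁)) -
        (P.L : ℝ) ^ j * ((hlKerPi (P := P) w c R₁ R₀ j ⟨x'.shift lam, μ⟩ b₁ - hKer w c j ⟨x'.shift lam, μ⟩ b₁) -
            (hlKerPi (P := P) w c R₁ R₀ j ⟨x', μ⟩ b₁ - hKer w c j ⟨x', μ⟩ b₁))) =
      fun lam : Fin P.d =>
        ((P.L : ℝ) ^ j * (zetaPi R₁ R₀ j (x.shift lam) b₁.src *
              (torusRep P j (deltaAData hj 1)).H (x.shift lam, μ) (b₁.src, b₁.dir) -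
            zetaPi R₁ R₀ j x b₁.src * (torusRep P j (deltaAData hj 1)).H (x, μ) (b₁.src, b₁.dir)) -
          (P.L : ℝ) ^ j * ((torusRep P j (deltaAData hj 1)).H (x.shift lam, μ) (b₁.src, b₁.dir) -
            (torusRep P j (deltaAData hj 1)).H (x, μ) (b₁.src, b₁.dir))) -
        ((P.L : ℝ) ^ j * (zetaPi R₁ R₀ j (x'.shift lam) b₁.src *
              (torusRep P j (deltaAData hj 1)).H (x'.shift lam, μ) (b₁.src, b₁.dir) -
            zetaPi R₁ R₀ j x' b₁.src * (torusRep P j (deltaAData hj 1)).H (x', μ) (b₁.src, b₁.dir)) -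
          (P.L : ℝ) ^ j * ((torusRep P j (deltaAData hj 1)).H (x'.shift lam, μ) (b₁.src, b₁.dir) -
            (torusRep P j (deltaAData hj 1)).H (x', μ) (b₁.src, b₁.dir))) :=
    funext fun lam => by simp only [hlKerPi_eq_H hj hw hc one_pos, hKer_eq_H hj hw hc one_pos]; ring
  rw [hv]
  exact h P hPd hPL j hj R₁ R₀ hw1 hR1 hR0 μ b₁.dir x x' b₁.src hne hr

end AllTori






end

end Literature.MathematicalPhysics.QuantumFieldTheory.BalabanImbrieJaffe1984to88.BIJ88HkLocHolderTorus
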